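import Summits.CriticalPhenomena.SAWScalingLimit.Theses.SAWLoopFugacityFlow
import Literature.Probability.RandomPlanarGeometry.RectangleConformalMap
import Literature.Probability.RandomPlanarGeometry.CaratheodoryHalfPlaneProofs
import Literature.Probability.RandomPlanarGeometry.HullSubdomainPullback
import Literature.Probability.RandomPlanarGeometry.SAWScalingLimitFamily
import Literature.Probability.RandomPlanarGeometry.JordanDomainProofs
import Literature.Probability.RandomPlanarGeometry.StarHullExtension
import Literature.Probability.RandomPlanarGeometry.RestrictionHullsProofs
import Literature.Probability.RandomPlanarGeometry.RestrictionHullsRiemannProofs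
import Literature.Probability.LatticeModels.DiluteLoopModelSAWLaw
import Literature.Probability.Percolation.CLE6Proofs
import Literature.Probability.RandomPlanarGeometry.SelfAvoidingWalkProofs
import Summits.CriticalPhenomena.SAWScalingLimit.Theorems.IsingBoundaryRatio.Negative.IsingBoundaryRatioNesting

/-!
# Disproof work file for the crux `AvoidanceLimit` (stmt-CriticalPhenomena-10649)

Standing adversary of `Summit.CriticalPhenomena.SAWScalingLimit.Theses.SAWLoopFugacityFlow.AvoidanceLimit`
(route SAWLoopFugacityFlow, rank 2): for every Dobrushin domain `(D; a, b)`, hull subdomain `D'`,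
endpoint approximation, chordal uniformizer `φ`, pulled-back hull `A = closure (ℍ ∖ φ⁻¹ D')` and
restriction data `(Φ, d = Φ'_A(0))`, `P_δ(range γ_δ ⊆ closure D') → d^(5/8)` as `δ → 0+`.

## Findings (cycle 1) — the sorry-free theorems below are also LANDED as `Theorems/AvoidanceLimit/Negative/*`

* NO KILL of the crux itself. It is implied by the summit conjunct `SAWScalingLimit` (portmanteau
  + `sle_restriction_eightThirds_holds` + hull-boundary null sets) and is LSW04 Prediction 1 read on
  avoidance marginals; every degenerate instance tried is consistent (see `## Why it resists`).
* LOAD-BEARING ANALYSIS (all sorry-free, LANDED: p73384 witness domains, p73802, p73809, p73823, p73832;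
  namespace `Summit.CriticalPhenomena.SAWScalingLimit.Theorems.AvoidanceLimit.Negative`): dropping any one
  of the following hypotheses makes the statement FALSE, by a witness on the square `(-2,2)²` marked at
  `2` and `-2` (`bigSq`; re-marked `topSq`; strip `flatRect`):
  - `avoidanceLimit_false_without_chordal` — drop `D.IsChordalUniformizing φ`: re-uniformize the
    square so that `φ(0), φ(∞)` land on the top side, off `closure D'` for the strip
    `D' = (-2,2) × (-1,1)`; then `φ⁻¹ D'` is bounded and bounded away from `0`, both normalising
    filters of `IsRestrictionMap` / `HasRestrictionDeriv` are `⊥`, any Riemann map `Φ` of `φ⁻¹ D'`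
    qualifies with EVERY `d`, and the conclusion would have two limits `1 ≠ 0`.
  - `avoidanceLimit_false_without_reachable` — keep `δ·a_δ → a`, `δ·b_δ → b` but drop reachability in
    `Ω_δ`: endpoints just outside the square give `law = 0` (empty SAW space), so `P_δ = 0 ↛ 1`.
  - `avoidanceLimit_false_without_normalisation` — keep `Φ(0) = 0` but drop `Φ(z)/z → 1` at `∞`:
    `Φ = 2·id` on `ℍ ∖ ∅` has `d = 2`, against `d = 1` for `id` (`D' = D`).
  - `avoidanceLimit_false_without_deriv` — drop `HasRestrictionDeriv`: `d` is free.
  - `avoidanceLimit_false_without_hullEq` — drop `A = closure (ℍ ∖ φ⁻¹ D')`: take `ℍ ∖ A` a disc.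
  So any proof must use: the chordal normalisation of `φ` (it is what makes `0 ∈ closure (ℍ ∖ A)` and
  `ℍ ∖ A` a neighbourhood of `∞`, i.e. what pins `d`), reachability (probability normalisation of
  `SAW.law`), both normalisations of `Φ_A`, and the identification of `A` with the pulled-back hull.
* DECORATIVE hypothesis (LANDED p73832, `avoidanceLimitWithoutPt_of`; the iff is below): `D'.pt 0 = D.pt 0`,
  `D'.pt 1 = D.pt 1` — the conclusion sees `D'` only through its carrier and `a, b ∈ ∂D'` follows from
  the ball agreement (re-marking a Jordan domain at two frontier points); no proof can use them.
* POSSIBLY UNNECESSARY (no proof either way): `D'.carrier ⊆ D.carrier` — without it the event and the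
  hull only see `D ∩ D'`; every instance tried is vacuous (disconnected / pinched `D ∩ D'`) or
  conjecturally consistent.
* NEAR-MISS (mathematically false, not formalisable cheaply): dropping the ε-ball agreement at `a`
  (`AvoidanceLimitWithoutBall`, see its docstring for the bump witness).

## Why it resists (for provers and planners)

1. With all hypotheses present, `A` is a `*`-hull (`IsStarHull.pullbackHull`), `Φ_A` exists and is
   unique, `d ∈ (0,1]` is pinned (`HasRestrictionDeriv.unique`), and `SAW.law` is a probability measure
   for all small `δ` — no junk value is reachable.
2. A "probability-zero" kill (`P_δ = 0` along `δ_n → 0`, i.e. no `Ω_δ`-SAW from `a_δ` to `b_δ` inside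
   `closure D'`) is IMPOSSIBLE for Jordan `D, D'` agreeing in balls at `a, b`: inside `ball(a, ε/2)` one
   has `closure D ∩ ball = closure D' ∩ ball`, so the initial piece of any `Ω_δ`-path from `a_δ` lies in
   `closure D'`; a counterexample would need infinitely many pairwise lattice-separated galleries of
   `D` of diameter `≥ ε/2` accumulating near `a`, contradicting local connectivity of the Jordan curve
   `∂D`. Slit / comb subdomains (where `closure D' = closure D` but `d < 1`) are excluded because
   `DobrushinDomain` carries an injective boundary loop.
3. A "probability-one" kill needs `D ∖ closure D'` unreachable by SAWs, impossible for `D' ⊊ D` Jordan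
   (`D ∖ closure D'` is a non-empty open set attached to `∂D` along a non-degenerate arc).
4. Hence any refutation must control critical-SAW asymptotics quantitatively (e.g. a confinement
   free-energy deficit `log μ − log μ_n ≫ 1/n` for strips of width `n`, which would contradict
   `ν = 3/4`); nothing of the kind is in print (LSW04 §3–4; Madras–Slade 1993).
5. Uniformity in `D'` at fixed mesh is genuinely false (sub-mesh boundary perturbations next to `a`
   are invisible to `Ω_δ` but move `Φ'_A(0)` by `O(1)`; Kennedy–Lawler lattice effects) — but the crux
   only asserts pointwise-in-`D'` limits, where the ε-ball agreement absorbs this.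

## Findings (cycle 2, gen-2 seat) — new checked content in §§ (a'), (c') below; landed / proposed as noted

* STILL NO KILL. Two new kernel-checked results, both sorry-free with standard axioms:
  - §(c') **EXPONENT RIGIDITY** (LANDED as `Negative/AvoidanceLimitExponentRigidity.lean`, p75063):
    `AvoidanceLimitExp p` := the crux with `5/8 ↦ p` (`AvoidanceLimitExp (5/8) ↔ AvoidanceLimit` by
    `Iff.rfl`). `avoidanceLimitExp_unique : AvoidanceLimitExp p → AvoidanceLimitExp q → p = q`;
    `avoidanceLimit_not_exp : AvoidanceLimit → q ≠ 5/8 → ¬ AvoidanceLimitExp q` (so the Ising value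
    `1/2` and the excursion value `1` are EXCLUDED by the crux); `not_avoidanceLimitExp_of_neg : p < 0 →
    ¬ AvoidanceLimitExp p` UNCONDITIONALLY (probabilities `≤ 1 < d^p`). The engine is the new
    Literature-grade lemma `restrictionDeriv_lt_one : IsStarHull A → IsRestrictionMap A Φ →
    HasRestrictionDeriv A Φ d → (A ∩ ℍ).Nonempty → d < 1` (strict [LSW] (2.4); Schwarz reflection
    `hullExt`, `Im Φ ≤ Im z`, local analysis of `z − E(z)` at `0`, identity theorem on `ℍ ∖ A`),
    applied to the pulled-back hull of `flatRect ⊊ bigSq` (a `*`-hull meeting `ℍ`, so `d ∈ (0,1)`).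
    MORAL FOR PROVERS: the crux genuinely pins the number `5/8`; no exponent-blind argument (pure
    restriction covariance / "the limit exists and is conformally covariant", cf. the value-free
    sibling `SAWRestrictionRigidity.AvoidanceCocycleLimit`) can prove it without an extra input that
    singles out `5/8` (in this route: `b(n)` continued from `b(1) = 1/2`; in LSW: `κ = 8/3`).
  - §(a') **BOTH ANCHORING CLAUSES DROPPED ⇒ FALSE** (`avoidanceLimit_false_without_ball_and_pt`,
    LANDED as `Negative/AvoidanceLimitFalseWithoutBallAndPt.lean`, p75773): with neither `hpt` nor the
    ε-ball agreement, `D' = smallSq = (-1,1)² ⊆ bigSq` need not reach `±2`, `ℍ ∖ A = φ⁻¹(D')` stays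
    away from `0` and `∞`, the restriction data are vacuous, two limits `1 ≠ 0`. This completes the
    table: `hpt` decorative GIVEN `hball` (cycle 1); `hball` GIVEN `hpt` a paper near-miss (below);
    both dropped: provably false.
  - §(b') **AN OPEN SHADOW OF THE CRUX** (conditional on the crux, sorry-free; landing copy
    `Negative/AvoidanceLimitStripWindow.lean`, p76280):
    `avoidanceLimit_strip_limit` / `avoidanceLimit_strip_window` — under `AvoidanceLimit` the
    probability that the critical SAW crossing `(-2,2)²` from `2` to `-2` stays in the closed strip
    `|Im| ≤ 1` converges to some `L ∈ (0,1)`, hence is eventually in `[c, 1-c]`, `c > 0`. Even this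
    qualitative scale-invariance statement (an `O(1)` confinement cost at `x_c`, for every endpoint
    approximation) is not in print: a cheaper milestone for planners, and the spot where
    transfer-matrix numerics (`Z_strip/Z_box` trend in `N`) could in principle turn against the crux.
* LOAD-BEARING TABLE (cycles 1+2, all kernel-checked unless marked): chordal normalisation of `φ` ✗,
  reachability clause of `IsEndpointApprox` ✗, `Φ(z)/z → 1` at `∞` ✗, `HasRestrictionDeriv` ✗,
  `A = pulled-back hull` ✗, `hpt ∧ hball` jointly ✗ (✗ = dropping it makes the statement FALSE);
  `hpt` alone: decorative (iff); `hball` alone: near-miss (paper-false); `hsub : D' ⊆ D`: a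
  normalisation (see 11 below), neither refutable nor provably redundant; exponent `5/8`: rigid.

## Why it resists, continued (cycle 2: attacks 6–13, all informal unless stated; numbers, not adjectives)

6. CLOSED EVENT vs OPEN SUBDOMAIN. `meshGraph` joins lattice neighbours iff the CLOSED segment lies
   in `closure Ω`; vertices lie in the OPEN `Ω`; hence `range γ_δ ⊆ closure D` always (rattack seat's
   `SAW.range_curve_subset_closure`, evidence `Positive.lean` on the item, where the D' = D instance
   `avoidanceLimit_self` is PROVED) and `{range ⊆ closure D'}` = "γ_δ is a SAW of the subgraph of `Ω_δ`
   spanned by the closed edges inside `closure D'`". Versus walks of `Ω'_δ` this only adds vertices ON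
   `∂D' ∩ D` (one extra lattice row along lattice-aligned arcs of `∂D'` at meshes `δ = 2^{-n}`), i.e.
   the avoidance of a hull shrunk by `O(δ)`: `Φ'` moves by `o(1)` (kernel continuity,
   `RestrictionContinuity`), and a boundary row carries no entropic gain at `x_c` (1D walks of length
   `L/δ` weigh `x_c^{L/δ}`). No kill; the planner's "expected o(1)" is right.
7. SUB-MESH FEATURES OF `∂D` (can the lattice fail to see the boundary?). For Jordan `D` the exterior
   `ℂ ∖ closure D` is OPEN, so an edge of `δℤ²` with both ends in `D` leaves `closure D` only across
   an exterior finger thinner than `δ`; a finger invisible to `δ_n ℤ²` for infinitely many `n` at a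
   FIXED macroscopic place would need width `0` there. So invisible doors have sizes `L_n → 0` and
   (heuristically, two-sided boundary exponent) crossing probability `→ 0`; with local connectivity
   of `∂D` (Jordan) macroscopic fingers cannot accumulate. No kill from lattice/continuum mismatch of
   the DOMAIN (this is the domain-side twin of cycle 1's point 5).
8. FAT `∂D'` (Osgood arcs of positive area inside `D`). Jordan domains are regular open
   (`int closure D' = D'`), so `∂D' ∩ D ⊆ closure (D ∖ closure D')`, the pulled-back hull is the closure
   of its interior in `ℍ`, and for SLE(8/3) `{range ⊆ closure D'}` and `{γ ∩ A = ∅}` differ by a null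
   set (outer approximation `A_s ↑`, continuity of `Φ'_{A_s}(0)`; tree: `HullRestrictionNull`). On the
   lattice a fat arc only offers vertices to TOUCH, never a passage. No kill.
9. MESOSCOPIC-DEPTH ENDPOINTS (`a_δ` at depth `r_δ → 0`, `r_δ ≫ δ`, inside `D`; allowed by
   `IsEndpointApprox`). Bulk-to-boundary restriction heuristics (exponents `5/48` bulk, `5/8` boundary)
   degenerate correctly: in `(ℍ; 0, ∞)` with bulk start `i r`, the map normalised by `Φ(ir) = ir`,
   `Φ(∞) = ∞` is `λΦ_A + μ` with `λ → 1/d`, `μ → 0`, so `|Φ'(ir)| → 1` and the boundary factor at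
   `∞` is `1/λ → d`: predicted limit `d^{5/8} · 1^{5/48} = d^{5/8}` again. Tangential approach along
   `∂D`: `Φ'_A(x) → Φ'_A(0)` (`Φ_A` analytic across `ℝ` near `0`). So "every IsEndpointApprox" costs
   nothing at the level of predictions; Kennedy–Lawler local lattice factors at `a_δ`, `b_δ` are the
   SAME for `D` and `D'` (ball agreement) and cancel in the ratio `Z(cl D'-walks)/Z(D-walks)`.
10. WILD PRIME ENDS AT `a` (spiralling / fjorded `∂D` near `a`): `IsEndpointApprox` stays satisfiable
   (tree: `SAW.exists_isEndpointApprox` for EVERY Dobrushin domain: `a_δ` sits at the deepest turn of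
   width `≳ δ`); the normalised law forgets the exponentially small mass `exp(-(L/δ) m(w/δ))` of the
   access channel, and the macroscopic walk is a SAW from the channel mouth `→ a`. Conjecturally the
   same limit; any proof must cope with local environments of `a_δ` that never stabilise — survivable
   only because the crux claims RATIOS with `D' = D` near `a, b`.
11. `hsub : D' ⊆ D` (cycle 1: "possibly unnecessary"), settled as a NORMALISATION: without it the
   lattice event sees only `closure (D ∩ D') ∩ D`-vertices (a point of `D ∩ ∂D'` is a limit of
   `D ∩ D'`), the hull sees only `φ⁻¹(D ∩ D')`; if that is not simply connected the variant is
   vacuous (no `Φ`), if `D ∩ D'` is Jordan it IS the crux for `D ∩ D'`; the residual cases (`D ∩ D'`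
   simply connected, non-Jordan) are not cheaply refutable and the reduction is not provable (no
   Jordan structure on `D ∩ D'`). Provers: you may assume `hsub` freely; nothing is hidden in it.
12. THE `WithoutBall` NEAR-MISS, second look — why no cheap witness exists: (i) with `hpt` kept,
   `0 ∈ closure (ℍ ∖ A)` and `ℍ ∖ A` is unbounded, so both normalising filters are proper (no
   vacuity trick; uniqueness of `(Φ, d)` then holds: an automorphism `M` of `ℍ` with `M(w)/w → 1`
   along ONE sequence `w → ∞` and `M → 0` along one sequence `→ 0` is the identity); (ii) a `P = 1`
   witness needs `D ∖ closure D'` unreachable by SAWs `a_δ → b_δ`: a pocket of `Ω_δ` avoided by all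
   such SAWs must hang off a cut vertex at EVERY small `δ`, and a fixed open pocket has necks `≥ 2`
   columns wide eventually — impossible; (iii) a `P = 0` witness (`a_δ ∈ D ∖ closure D'`, so
   `D ∖ closure D'` accumulates at `a`) needs a certified `d`: at a CORNER of `D'` at `a` the certified
   value would be `d = 0` (`Φ ~ c z^{π/θ}`) — but then the conclusion `P_δ → 0` is TRUE on paper
   (smaller opening angle ⇒ larger boundary exponent, ratio of partition functions `→ 0`), and at a
   CUSP / bump chain `d > 0` is an angular derivative without Schwarz reflection (cycle 1). The
   near-miss is robust; it stays a `sorry` below with this docstring.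
13. NUMERICS / PRINT (no new contrary evidence): the half-plane restriction law `P(avoid A) =
   Φ'_A(0)^{5/8}` was Monte-Carlo tested by Kennedy (PRL 88 (2002) 130601; J. Stat. Phys. 114 (2004))
   to `~10^{-3}`; Kennedy–Lawler (lattice effects, 2011/13) locate lattice dependence in the partition
   function's local endpoint factors, which cancel in the crux's ratio by the ball agreement; the
   ideator-3 exact enumerations on the item (kit j008674, boxes ≤ 8×4) see effective exponents
   drifting `0.92 → 0.77` — pre-asymptotic, not contrary. Rigorous inequalities on critical SAW
   (sub-ballisticity, Hammersley–Welsh, bridge decay) give no power-law bound on avoidance ratios, so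
   no printed theorem contradicts `d^{5/8}`. PAGE ANCHORS (held text, read this cycle; remote
   `lit search` was down, rc 75): Werner, *Conformal restriction and related questions* (2003
   lecture notes), paper:arxiv-math-0307353 — §1.4 PDF pp. 8–9, Conjecture 1 (scaling limits
   `P^{SAW}_{D,A,B}` of the `μ^{-n}` measures exist and are conformally invariant) and Conjecture 2
   (`= SLE_{8/3}`), p. 9 L1 "the discrete measures on self-avoiding curves satisfy restriction as
   well"; p. 16 the finite-domain discrete restriction property ("the mass of a walk ω of length n
   from A to B in D is proportional to xⁿ … the conditional measure is supported on the self-avoiding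
   walks … in `D ∖ S[0,m]`") — exactly the identity `P_D(γ ⊆ cl D') = Z(cl D'-walks)/Z(D-walks)`
   used in 6 and 9; p. 15 L19 "the critical value is `α₀ = 5/8` and corresponds to `SLE_{8/3}`";
   Kennedy's simulations = ref. [24] there (PRL 88 (2002) 130601), p. 46.

## Findings (cycle 3, gen-3 seat) — new checked content in § (d'') at the end of the file

* STILL NO KILL. After an independent re-derivation of cycles 1–2 (every junk / degeneracy route
  re-examined from the definitions up, see 14) the verdict stands: the formal statement is a faithful
  transcription of LSW04 Prediction 1 on avoidance marginals, every quantity in it is pinned, and a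
  refutation needs a quantitative theorem about critical `ℤ²`-SAW that contradicts conformal
  invariance — none exists. New kernel-checked content (all sorry-free, axioms
  `propext / Classical.choice / Quot.sound`; landing as `Negative/` parts 6–8, see NOTES for p-ids):
  - §(d'') **KILL CRITERIA**: `not_avoidanceLimit_of_frequently_zero` — a lattice refutation "from
    below" must produce a datum along which, for meshes accumulating at `0`, NO SAW of `Ω_δ` from
    `a_δ` to `b_δ` stays in `closure D'`; `not_avoidanceLimit_of_frequently_one` — "from above", a
    hull subdomain `D' ≠ D` with ALL such SAWs confined, frequently. Behind them:
    `restrictionDeriv_pos_le_one` (under the crux's hypotheses `d` IS `Φ'_A(0) ∈ (0,1]`, unique — the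
    formal version of "no junk value is reachable"), `pullbackHull_inter_nonempty` + cycle 2's
    `restrictionDeriv_lt_one` (`d < 1` iff `D' ≠ D`), and `avoidanceLimit_window`: under the crux,
    `c ≤ P_δ ≤ 1 - c` eventually for EVERY hull subdomain `D' ≠ D` of every `D` (cycle 2's strip
    window, generalised).
  - §(d'') **ONE CONFINED PATH GIVES `P_δ > 0`** (`map_law_rangeSubset_pos_of_reachable`,
    `eventually_map_law_rangeSubset_pos`): sub-domain walks are confined walks of the big domain
    (`edges_mem_edgeSet_of_subset`: vertices of `Ω'_δ` lie in `Ω_δ` because `Ω_δ` is a union of mesh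
    components and `a_δ ∈ Ω_δ`), the law is an honest probability with atoms `x_c^n / Z > 0`
    (`law_apply_pos`, via the tree's `weight_univ_eq_domainPartitionFunction` and
    `criticalFugacity_pos_lt_one'`). So criterion 1 can only be met along data that are NOT endpoint
    approximations of `D'`.
  - §(d'') **ENDPOINT TRANSFER** (`isEndpointApprox_of_hull_of_axisCaps`, the main theorem of the
    cycle; instance `isEndpointApprox_of_hull_bigSq`): for `D` with real marked points near which `D`
    is stable under vertical shrinking towards the axis and meets the axis in an interval accumulating
    at the marked point (rectangles marked on vertical sides, discs, ellipses, stadiums …), every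
    endpoint approximation of `D` IS one of each Dobrushin `D'` with the same marked points agreeing
    with `D` in balls around them (`D' ⊆ D` not even needed): lattice staircases (`stair`) inside the
    caps `D ∩ B(pt i, ε) ⊆ D'` bring `a_δ, b_δ` next to axis points of `D` inside a fixed compact
    `K ⊆ D'`, and the tree's "largest mesh component of a Jordan domain is the bulk"
    (`JordanDomain.exists_forall_mem_meshDomain_and_reachable`) puts those sites in `Ω'_δ` and joins
    them. Hence `eventually_pos_bigSq`: in the square — where all three lines and all numerics live —
    the probability-zero door is CLOSED for every hull subdomain and EVERY endpoint approximation
    (mesoscopic depth, tangential approach included), unconditionally. The general statement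
    `EndpointTransfer` (all Jordan `D`) is recorded as a `Prop` with its paper proof (15 below); it is
    the lattice topology hidden in the route's "largest-component bookkeeping" (corner-germ
    `stub_cornerIdentification`, first clause) and makes the double hypothesis
    `IsEndpointApprox D a b ∧ IsEndpointApprox D' a b` of `IsingBoundaryRatio` redundant for
    `D = bigSq` (`eventually_pos_of_endpointTransfer`). LANDED: part 6 `Negative/AvoidanceLimitKillCriteria`
    (p80612), part 7 `Negative/AvoidanceLimitStaircase` (p82274); part 8 `Negative/AvoidanceLimitEndpointTransfer`
    (p84176) carries the general transfer only as the inline HYPOTHESIS of `eventually_pos_of_endpointTransfer`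
    (a named `Prop` would be relocated to Literature as a fact; this workfile keeps `EndpointTransfer` named).
* MORAL FOR PROVERS (cycle 3): (i) the two things any proof must DO on the lattice are now named —
  an `O(1)` confinement cost (`liminf P_δ > 0`, which needs more than connectivity: it is the
  scale-invariance of a confinement free energy at `x_c`) and a uniformly positive escape
  probability (`limsup P_δ < 1`: SAWs must poke into `D ∖ cl D'` with probability bounded below —
  a polymer "pressure" statement); (ii) the bookkeeping clause "a_δ, b_δ ∈ Ω'_δ, joined there" is a
  theorem in the square and a genuine (but soft) lattice-topology lemma in general — budget it.

## Why it resists, continued (cycle 3: attacks 14–18; numbers, not adjectives)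

14. JUNK AUDIT, from the definitions up (all negative = no lever): `connectiveConstant = ⨅ₙ c_{n+1}^{1/(n+1)}`
   is the TRUE `μ` (Fekete on `log cₙ`; the set is bounded below by `1`, so `iInf` is not junk) and
   `criticalFugacity = μ⁻¹ ∈ (0,1)` is PROVED (`criticalFugacity_pos_lt_one'`), so the weights are
   the intended `x_c^n`; `law = (W univ)⁻¹ • W` normalises whatever `x_c` is, and `W univ < ∞`
   (`weight_univ_eq_domainPartitionFunction`); `Measure.map curve` of a finite atomic measure
   evaluates "correctly" on EVERY set (Borel singletons in the Polish `CurveClass ℂ`; `le_map_apply`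
   suffices for lower bounds), so non-measurability of `rangeSubset` is no lever; `meshDomain` = union
   of the max-cardinality mesh components is a SINGLE component for small `δ` (tree:
   `exists_forall_mem_meshDomain_and_reachable`), so no tie / stray-component games; `IsEndpointApprox`
   allows `a δ = b δ` but the limits `2 ≠ -2` separate them eventually; with chordality + ball
   agreement, `0 ∉ A`, `A` compact, `ℍ ∖ A ⊇` a neighbourhood of `0` and of `∞` in `ℍ`, so both
   normalising filters are proper and `(Φ, d)` is unique (`restrictionDeriv_pos_le_one`); the
   dilation freedom `φ ↦ φ(λ·)` rescales `A` and leaves `d` invariant. Conclusion type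
   `ENNReal.ofReal (d^(5/8))` with `d ∈ (0,1]`: no coercion junk.
15. ACCESS CHANNELS — why `EndpointTransfer` holds for Jordan `D` (refines point 2; paper): let
   `a_n := a_{δ_n} → a` lie in the bulk of `Ω_{δ_n}` but NOT be joined to a fixed compact
   `K ⊆ D ∩ B(a, ε/2)` by a mesh path inside `B(a, ε)`. Carathéodory gives prime-end neighbourhoods
   `W_k ↓ {a}` cut off by circular crosscuts `Q_k ⊆ ∂B(a, r_k)`, with `D ∩ B(a, ρ) ⊆ W_{k+1}` for small
   `ρ` (two accesses to `a` separated by a crosscut would be two prime ends with impression `a`).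
   Any mesh path from `a_n` to the far bulk crosses the fixed quadrilateral `A_k = W_k ∖ cl W_{k+1}`
   from `Q_{k+1}` to `Q_k`; put `K` inside `A_k`. If the crossing corridor `Γ_n` is lattice-separated
   from `K` inside the ball for infinitely many `n`, Hausdorff limits show `Γ_n` hugs `∂D` (an
   interior limit point would be joined to `K` through a small disc at fine mesh), and the separating
   walls are detours of the boundary arc of `A_k` of diameter `≥ dist(Q_k, Q_{k+1}) > 0`; infinitely
   many such detours accumulate on a non-degenerate continuum of `∂D` — a convergence continuum,
   i.e. `∂D` not locally connected, contradicting the Jordan curve. (A spiral corridor winding to `a`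
   is NOT a counterexample: the whole spiral lies in `B(a, r₀)`.) So criterion 1 is out of reach for
   every Jordan `D`; kernel-checked for domains with axis caps (`isEndpointApprox_of_hull_of_axisCaps`).
   CROSS-CRUX NOTE: the IsingBoundaryRatio work file (§1/§3, `normalForm_iff_withoutOuterApprox`)
   says the INNER approximation `IsEndpointApprox D' a b` is load-bearing "for comb-like `D'` with
   corridors accumulating at `a`"; with the ball agreement such corridors are corridors of `D` too, and
   if they have length `≥ ε` (needed to separate bulks, since the meshes AGREE inside the ball) they
   contradict the Jordan property of `D` exactly as in its own point 5 — so for Jordan `D` the inner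
   approximation follows from the outer one (`EndpointTransfer`; a theorem for `D = bigSq` and all
   axis-cap domains), and the double hypothesis of `IsingBoundaryRatio` is a convenience, not a need.
16. THE THREE REGISTERED LINES' STUBS (read 2026-08-16; no `-- Targets` yet, no stuck stubs) — cheap
   attacks, all survived: THIN-FILL (`stub_restrictionForm` = `∃ α, AvoidanceLimitExp α`, weaker
   than the crux; `stub_nullArea`, `stub_noLakes`, `stub_noBoundaryTouch` are SLE_{8/3}-true
   (`ε → 0` after `limsup_δ`, fixed `z ∈ D`, fixed `r > 0`; the endpoint freedom is absorbed because
   for fixed `r` eventually `a_δ ∈ B(a, r)`); `stub_rangeLimitLaw` is vacuous off `α = 5/8` by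
   exponent rigidity and portmanteau-true at `5/8` under the summit); CORNER-GERM (`critLine 0 = x_c`
   is TRUE with the `sSup`: `[0, μ⁻¹)` is massive by `c_{m+k} ≤ c_m c_k`, `y = 1` is not, so the set
   is a bounded initial interval with `sSup = μ⁻¹` whatever happens AT `μ⁻¹`; `loopZ … 0 x = 1`
   (`0^0 = 1`, only `F = ∅`), so `ratio` at `n = 0` is the SAW ratio; for `n > 0`,
   `critLine n ≥ μ⁻¹` follows from `loopZ (Ω ∖ γ) ≤ vacZ` (non-negative weights) — consistent with
   `x_c(n)` increasing in `n` (honeycomb `(2 + √(2-n))^{-1/2}`); the junk scenario `critLine n = 0`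
   (massive for ALL `y`) would falsify `stub_cornerLipschitz` but needs a non-massiveness proof in the
   dense phase — not available and physically false; stubs 3–5 are universality claims for the
   strictly dilute `w = 0` square-lattice O(n) model, unfalsifiable cheaply); SYMPLECTIC
   (`SAWEndpointIdentity`, `Determinantal`, `VitaliTransport`, `SAWCriticalPoint` are TRUE as typed —
   degree-3 sources count as collisions and die at `w = 0`, `det(1 - xA)` expands over vertex-disjoint
   polygons `(-2)·x^k` (two orientations) and 2-cycles `-x²` (`t = -1`), Montel + identity theorem on
   the strip `-2 < Re z < 2` where `(2+z)/(2-z) ∉ (-∞,0]`, and `xcDim 0 0 = μ⁻¹` by boundedness of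
   the half-plane susceptibility below `μ⁻¹` (Hammersley–Welsh) / unboundedness above (bridges);
   `ExcursionRatio` is discrete potential theory (boundary Harnack at microscopic distance, true);
   `SymplecticWindow`, `FugacityContinuation` are physics with SIGNED weights on `[-2+η, 0)` — the
   only place a finite computation could bite (a real zero of `Z(Ω_δ; ∅)` at `x = x_c(n, n/2)`), but
   `xcDim n (n/2)` is unknown in closed form for `n ∉ {-2, 0}`, so no certified zero).
17. THE `WithoutBall` NEAR-MISS, third look — a cleaner paper witness (see its docstring): remove from
   `D` a thin HORN tangent to `∂D` at `a` (in `ℍ`-coordinates `H = {0 < Re z < 1, 0 < Im z < (Re z)²}`,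
   `D' = φ(ℍ ∖ cl H)`): `∂(ℍ ∖ cl H)` is Dini-smooth at `0` (tangent directions `π` and `0`), so by
   Kellogg–Warschawski (local form, Pommerenke, Boundary Behaviour, Thm 3.5/3.9) `Φ` has a continuous
   non-vanishing derivative at `0`: `d = Φ'(0) ∈ (0,1)` as an UNRESTRICTED limit, while `a_δ ∈ φ(H)`
   (outside `cl D'`, reachable, `→ a`) gives `P_δ = 0` for a sequence of meshes. Still not cheaply
   formalisable (no boundary regularity of Riemann maps in the tree); the `sorry` stays.
18. UNIFORMITY IN `D'` (order of limits; informal): the LITERAL uniformisation "`∀ η ∃ δ₀ ∀ δ < δ₀ ∀ D'`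
   (hull subdomain, its own ε)" is FALSE by bites shrinking to `a` (`D'_δ = D ∖` half-disc of radius
   `ρ_δ` about a boundary point at height `y_δ → 0`, `ρ_δ / y_δ = 1/2`, containing `a_δ`: `P_δ = 0`,
   `d(D'_δ) → 1 - 1/4`), but with FIXED agreement balls `B(a, ε₀), B(b, ε₀)` lattice blindness at
   mesh `δ` only moves `d` by `o(1)` (features of size `< δ` at distance `≥ ε₀` from `a, b`), so the
   honest uniform version is neither refutable cheaply nor needed: every line lets `δ → 0` at FIXED
   `D'` first (AvoidancePassage / HullApproximation), the right order. Services: `lit`/searchd and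
   the gate were intermittently unreachable this cycle (rc 75 / EAGAIN); no new print beyond 13.
-/

noncomputable section

open Set Filter Topology MeasureTheory Complex Metric
open UpperHalfPlane (upperHalfPlaneSet isOpen_upperHalfPlaneSet)
open Literature.Probability.RandomPlanarGeometry Literature.Probability.LatticeModels
open Summit.CriticalPhenomena.SAWScalingLimit.Theses.SAWLoopFugacityFlow (AvoidanceLimit)
open Summit.CriticalPhenomena.SAWScalingLimit.Theorems.IsingBoundaryRatio.Negative
  (mem_meshDomain_of_reachable_ne eventually_ne)
open scoped ENNReal

namespace Summit.CriticalPhenomena.SAWScalingLimit.Cruxes.AvoidanceLimit.Disproof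

/-! ### The witnesses: a square marked at two side midpoints, re-marked on its top side, and a strip -/

/-- The open square `(-2, 2)²` as a Jordan domain (tree: `rectDomain`). [folklore] -/
def sq : JordanDomain := rectDomain 2 2 two_pos two_pos

/-- The square `(-2,2)²` marked at the midpoints `2` and `-2` of its vertical sides. [folklore] -/
def bigSq : DobrushinDomain where
  toJordanDomain := sq
  mark := ![3 / 8, 7 / 8]
  strictMono_mark := Fin.strictMono_iff_lt_succ.2 fun i ↦ by fin_cases i; simp; norm_num
  mark_mem i := by fin_cases i <;> simp <;> norm_num

/-- The same square, re-marked at the points `1 + 2i` and `-1 + 2i` of its TOP side (same carrier as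
`bigSq`, definitionally). [folklore] -/
def topSq : DobrushinDomain where
  toJordanDomain := sq
  mark := ![9 / 16, 11 / 16]
  strictMono_mark := Fin.strictMono_iff_lt_succ.2 fun i ↦ by fin_cases i; simp; norm_num
  mark_mem i := by fin_cases i <;> simp <;> norm_num

/-- The strip `(-2, 2) × (-1, 1)` marked at `2` and `-2`: a hull subdomain of `bigSq`. [folklore] -/
def flatRect : DobrushinDomain where
  toJordanDomain := rectDomain 2 1 two_pos one_pos
  mark := ![3 / 8, 7 / 8]
  strictMono_mark := Fin.strictMono_iff_lt_succ.2 fun i ↦ by fin_cases i; simp; norm_num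
  mark_mem i := by fin_cases i <;> simp <;> norm_num

theorem bigSq_carrier : bigSq.carrier = symRect 2 2 := rfl
theorem topSq_carrier : topSq.carrier = symRect 2 2 := rfl
theorem flatRect_carrier : flatRect.carrier = symRect 2 1 := rfl

/-- Evaluation of the square's boundary loop at a parameter `(k + θ)/4`. [folklore] -/
private theorem loop_eval {a b : ℝ} {t : ℝ} (k : ℕ) (hk : k < 4) (θ : ℝ) (hθ : θ ∈ Icc (0:ℝ) 1)
    (ht : t = ((k : ℝ) + θ) / 4) :
    polygonLoop (rectVerts a b) t =
      AffineMap.lineMap ((rectVerts a b)[k]'(by simpa using hk))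
        ((rectVerts a b)[(k + 1) % 4]'(by simp; omega)) θ := by
  have h := polygonLoop_apply_div (l := rectVerts a b) (k := k) (by simpa using hk) hθ
  simp only [length_rectVerts, Nat.cast_ofNat] at h
  rw [ht, h]

theorem bigSq_pt_zero : bigSq.pt 0 = (2 : ℂ) := by
  show polygonLoop (rectVerts 2 2) (3 / 8 : ℝ) = 2
  rw [loop_eval 1 (by norm_num) (1 / 2) (by norm_num) (by norm_num)]
  apply Complex.ext <;> norm_num [rectVerts, AffineMap.lineMap_apply_module']

theorem bigSq_pt_one : bigSq.pt 1 = (-2 : ℂ) := by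
  show polygonLoop (rectVerts 2 2) (7 / 8 : ℝ) = -2
  rw [loop_eval 3 (by norm_num) (1 / 2) (by norm_num) (by norm_num)]
  apply Complex.ext <;> norm_num [rectVerts, AffineMap.lineMap_apply_module']

theorem flatRect_pt_zero : flatRect.pt 0 = (2 : ℂ) := by
  show polygonLoop (rectVerts 2 1) (3 / 8 : ℝ) = 2
  rw [loop_eval 1 (by norm_num) (1 / 2) (by norm_num) (by norm_num)]
  apply Complex.ext <;> norm_num [rectVerts, AffineMap.lineMap_apply_module']

theorem flatRect_pt_one : flatRect.pt 1 = (-2 : ℂ) := by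
  show polygonLoop (rectVerts 2 1) (7 / 8 : ℝ) = -2
  rw [loop_eval 3 (by norm_num) (1 / 2) (by norm_num) (by norm_num)]
  apply Complex.ext <;> norm_num [rectVerts, AffineMap.lineMap_apply_module']

theorem topSq_pt_zero : topSq.pt 0 = (1 : ℂ) + 2 * I := by
  show polygonLoop (rectVerts 2 2) (9 / 16 : ℝ) = 1 + 2 * I
  rw [loop_eval 2 (by norm_num) (1 / 4) (by norm_num) (by norm_num)]
  apply Complex.ext <;> norm_num [rectVerts, AffineMap.lineMap_apply_module']

theorem topSq_pt_one : topSq.pt 1 = (-1 : ℂ) + 2 * I := by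
  show polygonLoop (rectVerts 2 2) (11 / 16 : ℝ) = -1 + 2 * I
  rw [loop_eval 2 (by norm_num) (3 / 4) (by norm_num) (by norm_num)]
  apply Complex.ext <;> norm_num [rectVerts, AffineMap.lineMap_apply_module']

/-- The strip lies in the square. [folklore] -/
theorem flatRect_subset : flatRect.carrier ⊆ bigSq.carrier := by
  intro z hz
  rw [flatRect_carrier, mem_symRect] at hz
  rw [bigSq_carrier, mem_symRect]
  exact ⟨hz.1, by linarith [hz.2.1], by linarith [hz.2.2]⟩

/-- Near the marked points `±2` the strip and the square agree (balls of radius `1`). [folklore] -/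
theorem flatRect_ball_agree (c : ℂ) (hc : c.im = 0) :
    flatRect.carrier ∩ ball c 1 = bigSq.carrier ∩ ball c 1 := by
  ext z
  simp only [mem_inter_iff, Metric.mem_ball, flatRect_carrier, bigSq_carrier, mem_symRect]
  constructor
  · rintro ⟨⟨hre, him⟩, hd⟩
    exact ⟨⟨hre, by linarith [him.1], by linarith [him.2]⟩, hd⟩
  · rintro ⟨⟨hre, -⟩, hd⟩
    have h1 : |(z - c).im| ≤ ‖z - c‖ := Complex.abs_im_le_norm _
    rw [Complex.sub_im, hc, sub_zero] at h1
    rw [dist_eq_norm] at hd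
    have h2 := (abs_lt.1 (lt_of_le_of_lt h1 hd))
    exact ⟨⟨hre, h2.1, h2.2⟩, by rwa [dist_eq_norm]⟩

/-- The re-marked points of `topSq` are off the closed strip. [folklore] -/
theorem topSq_pt_notMem_closure (i : Fin 2) : topSq.pt i ∉ closure flatRect.carrier := by
  rw [flatRect_carrier, closure_symRect two_pos one_pos, mem_reProdIm]
  fin_cases i
  · simp [topSq_pt_zero]
  · simp [topSq_pt_one]

/-! ### (a) Load-bearing hypothesis: the chordal normalisation of `φ` -/

/-- The crux with the hypothesis `D.IsChordalUniformizing φ` DROPPED (everything else verbatim). -/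
def AvoidanceLimitWithoutChordal : Prop :=
  ∀ (D D' : DobrushinDomain) (a b : ℝ → Site 2), SAW.IsEndpointApprox D a b →
    D'.carrier ⊆ D.carrier → D'.pt 0 = D.pt 0 → D'.pt 1 = D.pt 1 →
    (∃ ε : ℝ, 0 < ε ∧ D'.carrier ∩ Metric.ball (D.pt 0) ε = D.carrier ∩ Metric.ball (D.pt 0) ε ∧
      D'.carrier ∩ Metric.ball (D.pt 1) ε = D.carrier ∩ Metric.ball (D.pt 1) ε) →
    ∀ (φ : ConformalEquiv upperHalfPlaneSet D.carrier),
    ∀ (A : Set ℂ), A = closure (upperHalfPlaneSet \ {z | z ∈ upperHalfPlaneSet ∧ φ z ∈ D'.carrier}) →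
    ∀ (Φ : ConformalEquiv (upperHalfPlaneSet \ A) upperHalfPlaneSet) (d : ℝ),
      IsRestrictionMap A Φ → HasRestrictionDeriv A Φ d →
      Tendsto (fun δ => ((SAW.law D.carrier δ (a δ) (b δ)).map (fun γ => γ.curve))
        (CurveClass.rangeSubset (closure D'.carrier))) (𝓝[>] 0)
        (𝓝 (ENNReal.ofReal (d ^ ((5 : ℝ) / 8))))

/-- Sanity: the dropped-hypothesis variant implies the crux (it quantifies over more `φ`). -/
theorem avoidanceLimit_of_withoutChordal (h : AvoidanceLimitWithoutChordal) : AvoidanceLimit :=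
  fun D D' a b hab hsub h0 h1 hball φ _ A hA Φ d hΦ hd ↦ h D D' a b hab hsub h0 h1 hball φ A hA Φ d hΦ hd

/-- Two limits of one function along `𝓝[>] 0` force `ofReal (d₁^(5/8)) = ofReal (d₂^(5/8))`. -/
private theorem limit_unique {F : ℝ → ENNReal} {d₁ d₂ : ℝ}
    (h₁ : Tendsto F (𝓝[>] 0) (𝓝 (ENNReal.ofReal (d₁ ^ ((5 : ℝ) / 8)))))
    (h₂ : Tendsto F (𝓝[>] 0) (𝓝 (ENNReal.ofReal (d₂ ^ ((5 : ℝ) / 8))))) :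
    ENNReal.ofReal (d₁ ^ ((5 : ℝ) / 8)) = ENNReal.ofReal (d₂ ^ ((5 : ℝ) / 8)) :=
  tendsto_nhds_unique h₁ h₂

private theorem one_ne_zero_rpow :
    ENNReal.ofReal ((1 : ℝ) ^ ((5 : ℝ) / 8)) ≠ ENNReal.ofReal ((0 : ℝ) ^ ((5 : ℝ) / 8)) := by
  rw [Real.one_rpow, Real.zero_rpow (by norm_num), ENNReal.ofReal_one, ENNReal.ofReal_zero]
  exact one_ne_zero

/-- **`IsChordalUniformizing` is load-bearing.** Witness: `D = bigSq`, `D' = flatRect`, `φ` a chordal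
uniformizer of the RE-MARKED square `topSq` (so `φ → 1+2i` at `0`, `φ → -1+2i` at `∞`, both off
`closure D'`): then `ℍ ∖ A = φ⁻¹(D')` stays away from `0` and from `∞`, the two normalising filters
`𝓝[ℍ ∖ A] 0` and `cocompact ⊓ 𝓟 (ℍ ∖ A)` are `⊥`, every Riemann map `Φ : ℍ ∖ A → ℍ` is a
"restriction map" with EVERY derivative `d`, and the conclusion would hold for `d = 1` and `d = 0`
at once. Moral for provers: the chordal normalisation is exactly what makes `0 ∈ closure (ℍ ∖ A)`
(pins `d`) and `ℍ ∖ A ⊇ ℍ ∖ (compact)` (pins the scale of `Φ`). [folklore] -/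
theorem avoidanceLimit_false_without_chordal : ¬ AvoidanceLimitWithoutChordal := by
  intro h
  obtain ⟨a, b, hab⟩ := SAW.exists_isEndpointApprox bigSq
  obtain ⟨φ, hφ⟩ := MarkedDomain.exists_isChordalUniformizing_holds topSq
  have hball : ∃ ε : ℝ, 0 < ε ∧
      flatRect.carrier ∩ Metric.ball (bigSq.pt 0) ε = bigSq.carrier ∩ Metric.ball (bigSq.pt 0) ε ∧
      flatRect.carrier ∩ Metric.ball (bigSq.pt 1) ε = bigSq.carrier ∩ Metric.ball (bigSq.pt 1) ε := by
    refine ⟨1, one_pos, ?_, ?_⟩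
    · rw [bigSq_pt_zero]; exact flatRect_ball_agree 2 (by simp)
    · rw [bigSq_pt_one]; exact flatRect_ball_agree (-2) (by simp)
  have hpt0 : flatRect.pt 0 = bigSq.pt 0 := by rw [flatRect_pt_zero, bigSq_pt_zero]
  have hpt1 : flatRect.pt 1 = bigSq.pt 1 := by rw [flatRect_pt_one, bigSq_pt_one]
  -- the pulled-back hull of the strip under the re-marked uniformizer
  set A : Set ℂ := φ.pullbackHull flatRect with hAdef
  have key := h bigSq flatRect a b hab flatRect_subset hpt0 hpt1 hball φ A rfl
  -- `ℍ ∖ A = φ⁻¹(D')`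
  have hdiff : upperHalfPlaneSet \ A = φ.pullbackDomain flatRect := ConformalEquiv.diff_pullbackHull
  -- (1) the filter at `0` is trivial: `φ z → topSq.pt 0 ∉ closure D'`
  have hbot0 : 𝓝[upperHalfPlaneSet \ A] (0 : ℂ) = ⊥ := by
    have hev : ∀ᶠ z in 𝓝[upperHalfPlaneSet] (0 : ℂ), φ z ∈ (closure flatRect.carrier)ᶜ :=
      hφ.1 (isClosed_closure.isOpen_compl.mem_nhds (topSq_pt_notMem_closure 0))
    have hle : 𝓝[upperHalfPlaneSet \ A] (0 : ℂ) ≤ 𝓝[upperHalfPlaneSet] 0 :=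
      nhdsWithin_mono _ sdiff_le
    rw [← Filter.eventually_false_iff_eq_bot]
    filter_upwards [hle hev, self_mem_nhdsWithin] with z hz hzA
    rw [hdiff] at hzA
    exact hz (subset_closure hzA.2)
  -- (2) the filter at `∞` is trivial: `φ z → topSq.pt 1 ∉ closure D'`
  have hbotInf : cocompact ℂ ⊓ 𝓟 (upperHalfPlaneSet \ A) = ⊥ := by
    have hev : ∀ᶠ z in cocompact ℂ ⊓ 𝓟 upperHalfPlaneSet, φ z ∈ (closure flatRect.carrier)ᶜ :=
      hφ.2 (isClosed_closure.isOpen_compl.mem_nhds (topSq_pt_notMem_closure 1))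
    have hle : cocompact ℂ ⊓ 𝓟 (upperHalfPlaneSet \ A) ≤ cocompact ℂ ⊓ 𝓟 upperHalfPlaneSet :=
      inf_le_inf_left _ (principal_mono.2 sdiff_le)
    rw [← Filter.eventually_false_iff_eq_bot]
    have hself : ∀ᶠ z in cocompact ℂ ⊓ 𝓟 (upperHalfPlaneSet \ A), z ∈ upperHalfPlaneSet \ A :=
      mem_inf_of_right (mem_principal_self _)
    filter_upwards [hle hev, hself] with z hz hzA
    rw [hdiff] at hzA
    exact hz (subset_closure hzA.2)
  -- a Riemann map of `ℍ ∖ A ≅ D'`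
  have hsc : IsSimplyConnected (upperHalfPlaneSet \ A) :=
    (φ.restrHull flatRect flatRect_subset).isSimplyConnected_iff.2
      (JordanDomain.isSimplyConnected_carrier flatRect.toJordanDomain)
  have hopen : IsOpen (upperHalfPlaneSet \ A) := by
    rw [hdiff]; exact ConformalEquiv.isOpen_pullbackDomain
  have hne : upperHalfPlaneSet \ A ≠ univ := fun heq ↦ by
    have : (-I : ℂ) ∈ upperHalfPlaneSet \ A := by rw [heq]; exact mem_univ _
    have h' : (0 : ℝ) < (-I).im := this.1
    norm_num at h'
  obtain ⟨Ψ⟩ := exists_conformalEquiv_upperHalfPlaneSet_holds hopen hsc hne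
  set Φ := Ψ.symm with hΦ
  have hR : IsRestrictionMap A Φ := by
    refine ⟨?_, ?_⟩
    · show Tendsto Φ (𝓝[upperHalfPlaneSet \ A] 0) (𝓝 0)
      rw [hbot0]; exact tendsto_bot
    · rw [hbotInf]; exact tendsto_bot
  have hD : ∀ d : ℝ, HasRestrictionDeriv A Φ d := fun d ↦ by
    show Tendsto _ (𝓝[upperHalfPlaneSet \ A] 0) _
    rw [hbot0]; exact tendsto_bot
  exact one_ne_zero_rpow (limit_unique (key Φ 1 hR (hD 1)) (key Φ 0 hR (hD 0)))


/-! ### (a) Load-bearing hypothesis: reachability of the endpoints in `Ω_δ` -/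

/-- The empty pulled-back hull: for `D' = D`, `closure (ℍ ∖ φ⁻¹ D) = ∅`. [folklore] -/
theorem empty_eq_pullback_self {D : DobrushinDomain} (φ : ConformalEquiv upperHalfPlaneSet D.carrier) :
    (∅ : Set ℂ) = closure (upperHalfPlaneSet \ {z | z ∈ upperHalfPlaneSet ∧ φ z ∈ D.carrier}) := by
  rw [eq_comm, closure_empty_iff, Set.sdiff_eq_empty]
  exact fun z hz ↦ ⟨hz, φ.mapsTo hz⟩

/-- The lattice site `(⌈2/δ⌉₊, 0)`: its mesh point `δ⌈2/δ⌉₊ ∈ [2, 2 + δ)` is just outside the open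
square `(-2,2)²` but tends to the marked point `2`. [folklore] -/
def farSite (δ : ℝ) : Site 2 := ![((⌈2 / δ⌉₊ : ℕ) : ℤ), 0]

/-- Its mirror image `(-⌈2/δ⌉₊, 0)`, tending to `-2` from outside. [folklore] -/
def negFarSite (δ : ℝ) : Site 2 := ![-((⌈2 / δ⌉₊ : ℕ) : ℤ), 0]

theorem meshPoint_farSite (δ : ℝ) : meshPoint δ (farSite δ) = ((δ * ⌈2 / δ⌉₊ : ℝ) : ℂ) := by
  apply Complex.ext <;> simp [farSite]

theorem meshPoint_negFarSite (δ : ℝ) : meshPoint δ (negFarSite δ) = -((δ * ⌈2 / δ⌉₊ : ℝ) : ℂ) := by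
  apply Complex.ext <;> simp [negFarSite]

theorem two_le_mul_ceil {δ : ℝ} (hδ : 0 < δ) : 2 ≤ δ * ⌈2 / δ⌉₊ := by
  have h := Nat.le_ceil (2 / δ)
  calc (2 : ℝ) = δ * (2 / δ) := by field_simp
    _ ≤ δ * ⌈2 / δ⌉₊ := by gcongr

theorem mul_ceil_lt {δ : ℝ} (hδ : 0 < δ) : δ * ⌈2 / δ⌉₊ < 2 + δ := by
  have h := Nat.ceil_lt_add_one (show (0 : ℝ) ≤ 2 / δ by positivity)
  calc δ * ⌈2 / δ⌉₊ < δ * (2 / δ + 1) := by gcongr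
    _ = 2 + δ := by field_simp

theorem tendsto_meshPoint_farSite :
    Tendsto (fun δ ↦ meshPoint δ (farSite δ)) (𝓝[>] 0) (𝓝 (2 : ℂ)) := by
  simp only [meshPoint_farSite]
  rw [show (2 : ℂ) = ((2 : ℝ) : ℂ) by norm_num]
  refine (Complex.continuous_ofReal.tendsto 2).comp ?_
  rw [Metric.tendsto_nhdsWithin_nhds]
  intro ε hε
  refine ⟨ε, hε, fun {δ} hδ hd ↦ ?_⟩
  rw [Real.dist_eq, abs_lt]
  rw [Real.dist_eq, sub_zero, abs_of_pos hδ] at hd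
  have h1 := two_le_mul_ceil hδ
  have h2 := mul_ceil_lt hδ
  constructor <;> linarith

theorem tendsto_meshPoint_negFarSite :
    Tendsto (fun δ ↦ meshPoint δ (negFarSite δ)) (𝓝[>] 0) (𝓝 (-2 : ℂ)) := by
  simp only [meshPoint_negFarSite, ← meshPoint_farSite]
  exact tendsto_meshPoint_farSite.neg

theorem farSite_ne_negFarSite {δ : ℝ} (hδ : 0 < δ) : farSite δ ≠ negFarSite δ := by
  intro h
  have h0 := congrFun h 0
  simp only [farSite, negFarSite, Matrix.cons_val_zero] at h0
  have hpos : 0 < ⌈2 / δ⌉₊ := Nat.ceil_pos.2 (by positivity)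
  omega

/-- No vertex of `Ω_δ` sits at the far site: its mesh point is outside the open square. [folklore] -/
theorem farSite_notMem_meshVertices {δ : ℝ} (hδ : 0 < δ) : farSite δ ∉ meshVertices (symRect 2 2) δ := by
  rw [mem_meshVertices_iff, meshPoint_farSite, mem_symRect]
  rintro ⟨⟨-, h⟩, -⟩
  rw [Complex.ofReal_re] at h
  linarith [two_le_mul_ceil hδ]

/-- There is no SAW of `Ω_δ` from the far site (it is an isolated vertex of `discreteDomainGraph`). [folklore] -/
theorem isEmpty_domainSAW_far {δ : ℝ} (hδ : 0 < δ) :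
    IsEmpty (SAW.DomainSAW (symRect 2 2) δ (farSite δ) (negFarSite δ)) := by
  refine ⟨fun γ ↦ ?_⟩
  obtain ⟨w, hadj, -, -⟩ := γ.walk.exists_eq_cons_of_ne (farSite_ne_negFarSite hδ)
  exact farSite_notMem_meshVertices hδ
    (meshDomain_subset_meshVertices _ _ (discreteDomainGraph_adj_iff.1 hadj).2.1)

/-- Hence the critical SAW law from the far sites is the zero measure (junk value of `SAW.law`). [folklore] -/
theorem law_far_eq_zero {δ : ℝ} (hδ : 0 < δ) :
    SAW.law (symRect 2 2) δ (farSite δ) (negFarSite δ) = 0 := by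
  haveI := isEmpty_domainSAW_far hδ
  exact Measure.eq_zero_of_isEmpty _

/-- The crux with `IsEndpointApprox D a b` WEAKENED to its two convergence clauses (the reachability
clause `∀ᶠ δ, Ω_δ.Reachable (a δ) (b δ)` dropped). -/
def AvoidanceLimitWithoutReachable : Prop :=
  ∀ (D D' : DobrushinDomain) (a b : ℝ → Site 2),
    Tendsto (fun δ ↦ meshPoint δ (a δ)) (𝓝[>] 0) (𝓝 (D.pt 0)) →
    Tendsto (fun δ ↦ meshPoint δ (b δ)) (𝓝[>] 0) (𝓝 (D.pt 1)) →
    D'.carrier ⊆ D.carrier → D'.pt 0 = D.pt 0 → D'.pt 1 = D.pt 1 →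
    (∃ ε : ℝ, 0 < ε ∧ D'.carrier ∩ Metric.ball (D.pt 0) ε = D.carrier ∩ Metric.ball (D.pt 0) ε ∧
      D'.carrier ∩ Metric.ball (D.pt 1) ε = D.carrier ∩ Metric.ball (D.pt 1) ε) →
    ∀ (φ : ConformalEquiv upperHalfPlaneSet D.carrier), D.IsChordalUniformizing φ →
    ∀ (A : Set ℂ), A = closure (upperHalfPlaneSet \ {z | z ∈ upperHalfPlaneSet ∧ φ z ∈ D'.carrier}) →
    ∀ (Φ : ConformalEquiv (upperHalfPlaneSet \ A) upperHalfPlaneSet) (d : ℝ),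
      IsRestrictionMap A Φ → HasRestrictionDeriv A Φ d →
      Tendsto (fun δ => ((SAW.law D.carrier δ (a δ) (b δ)).map (fun γ => γ.curve))
        (CurveClass.rangeSubset (closure D'.carrier))) (𝓝[>] 0)
        (𝓝 (ENNReal.ofReal (d ^ ((5 : ℝ) / 8))))

/-- Sanity: the weakened-hypothesis variant implies the crux. -/
theorem avoidanceLimit_of_withoutReachable (h : AvoidanceLimitWithoutReachable) : AvoidanceLimit :=
  fun D D' a b hab ↦ h D D' a b hab.tendsto_fst hab.tendsto_snd

/-- **Reachability in `Ω_δ` is load-bearing** (even with `δ a_δ → a`, `δ b_δ → b` kept). Witness: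
`D = D' = bigSq`, `a_δ = (⌈2/δ⌉₊, 0)`, `b_δ = -a_δ`: the mesh points converge to the marked points
`±2` from OUTSIDE the open square, the SAW space is empty, `SAW.law = 0` (junk value) and
`P_δ(range ⊆ closure D) = 0` for every `δ > 0`, against the value `Φ'_∅(0)^(5/8) = 1`.
Moral: every proof must route through `IsEndpointApprox.reachable` to know that `SAW.law` is
(eventually) a probability measure; the convergence clauses alone do not even put `a_δ` in `Ω_δ`. [folklore] -/
theorem avoidanceLimit_false_without_reachable : ¬ AvoidanceLimitWithoutReachable := by
  intro h
  obtain ⟨φ, hφ⟩ := MarkedDomain.exists_isChordalUniformizing_holds bigSq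
  have ha : Tendsto (fun δ ↦ meshPoint δ (farSite δ)) (𝓝[>] 0) (𝓝 (bigSq.pt 0)) := by
    rw [bigSq_pt_zero]; exact tendsto_meshPoint_farSite
  have hb : Tendsto (fun δ ↦ meshPoint δ (negFarSite δ)) (𝓝[>] 0) (𝓝 (bigSq.pt 1)) := by
    rw [bigSq_pt_one]; exact tendsto_meshPoint_negFarSite
  have key := h bigSq bigSq farSite negFarSite ha hb subset_rfl rfl rfl ⟨1, one_pos, rfl, rfl⟩ φ hφ
    ∅ (empty_eq_pullback_self φ) restrictionMapEmpty 1 isRestrictionMap_empty hasRestrictionDeriv_empty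
  have h0 : Tendsto (fun δ : ℝ ↦ ((SAW.law bigSq.carrier δ (farSite δ) (negFarSite δ)).map
      (fun γ ↦ γ.curve)) (CurveClass.rangeSubset (closure bigSq.carrier))) (𝓝[>] 0) (𝓝 0) := by
    refine tendsto_const_nhds.congr' ?_
    filter_upwards [self_mem_nhdsWithin] with δ hδ
    rw [bigSq_carrier, law_far_eq_zero hδ, Measure.map_zero, Measure.coe_zero, Pi.zero_apply]
  have := tendsto_nhds_unique key h0
  rw [Real.one_rpow, ENNReal.ofReal_one] at this
  exact one_ne_zero this

/-! ### (a) Load-bearing hypothesis: the hydrodynamic normalisation `Φ(z)/z → 1` at `∞` -/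

/-- The crux with `IsRestrictionMap A Φ` WEAKENED to its first clause `Φ(0) = 0`
(`Φ.HasBoundaryValue 0 0`); the normalisation `Φ(z)/z → 1` at `∞` is dropped. -/
def AvoidanceLimitWithoutNormalisation : Prop :=
  ∀ (D D' : DobrushinDomain) (a b : ℝ → Site 2), SAW.IsEndpointApprox D a b →
    D'.carrier ⊆ D.carrier → D'.pt 0 = D.pt 0 → D'.pt 1 = D.pt 1 →
    (∃ ε : ℝ, 0 < ε ∧ D'.carrier ∩ Metric.ball (D.pt 0) ε = D.carrier ∩ Metric.ball (D.pt 0) ε ∧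
      D'.carrier ∩ Metric.ball (D.pt 1) ε = D.carrier ∩ Metric.ball (D.pt 1) ε) →
    ∀ (φ : ConformalEquiv upperHalfPlaneSet D.carrier), D.IsChordalUniformizing φ →
    ∀ (A : Set ℂ), A = closure (upperHalfPlaneSet \ {z | z ∈ upperHalfPlaneSet ∧ φ z ∈ D'.carrier}) →
    ∀ (Φ : ConformalEquiv (upperHalfPlaneSet \ A) upperHalfPlaneSet) (d : ℝ),
      Φ.HasBoundaryValue 0 0 → HasRestrictionDeriv A Φ d →
      Tendsto (fun δ => ((SAW.law D.carrier δ (a δ) (b δ)).map (fun γ => γ.curve))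
        (CurveClass.rangeSubset (closure D'.carrier))) (𝓝[>] 0)
        (𝓝 (ENNReal.ofReal (d ^ ((5 : ℝ) / 8))))

/-- Sanity: the weakened-hypothesis variant implies the crux. -/
theorem avoidanceLimit_of_withoutNormalisation (h : AvoidanceLimitWithoutNormalisation) :
    AvoidanceLimit :=
  fun D D' a b hab hsub h0 h1 hball φ hφ A hA Φ d hΦ hd ↦
    h D D' a b hab hsub h0 h1 hball φ hφ A hA Φ d hΦ.1 hd

/-- The dilation `z ↦ 2z` viewed as a conformal equivalence `ℍ ∖ ∅ → ℍ`. [folklore] -/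
def dilationTwo : ConformalEquiv (upperHalfPlaneSet \ ∅) upperHalfPlaneSet :=
  (ConformalEquiv.smulUpperHalfPlane 2 two_pos).copy _ _ sdiff_empty rfl

@[simp] theorem dilationTwo_apply (z : ℂ) : dilationTwo z = (2 : ℝ) • z := rfl

theorem dilationTwo_hasBoundaryValue : dilationTwo.HasBoundaryValue 0 0 := by
  show Tendsto (fun z : ℂ ↦ dilationTwo z) _ _
  simp only [dilationTwo_apply]
  exact ((continuous_const_smul (2 : ℝ)).tendsto' (0 : ℂ) 0 (smul_zero _)).mono_left
    nhdsWithin_le_nhds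

/-- `Φ'(0) = 2` for the dilation. [folklore] -/
theorem dilationTwo_hasRestrictionDeriv : HasRestrictionDeriv ∅ dilationTwo 2 := by
  unfold HasRestrictionDeriv
  simp only [dilationTwo_apply]
  refine (tendsto_const_nhds (x := ((2 : ℝ) : ℂ))).congr' ?_
  filter_upwards [self_mem_nhdsWithin] with z hz
  have hz0 : z ≠ 0 := by
    rintro rfl
    exact absurd hz.1 (by simp [upperHalfPlaneSet])
  rw [Complex.real_smul, mul_div_assoc, div_self hz0, mul_one]

/-- **The normalisation at `∞` is load-bearing.** Witness: `D' = D = bigSq`, `A = ∅`; both `id`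
(`d = 1`) and `2·id` (`d = 2`) fix `0`, so the conclusion would give `1 = 2^(5/8)`.
Moral: `d = Φ'_A(0)` is only meaningful once the scale of `Φ_A` is pinned at `∞`. [folklore] -/
theorem avoidanceLimit_false_without_normalisation : ¬ AvoidanceLimitWithoutNormalisation := by
  intro h
  obtain ⟨a, b, hab⟩ := SAW.exists_isEndpointApprox bigSq
  obtain ⟨φ, hφ⟩ := MarkedDomain.exists_isChordalUniformizing_holds bigSq
  have key := h bigSq bigSq a b hab subset_rfl rfl rfl ⟨1, one_pos, rfl, rfl⟩ φ hφ
    ∅ (empty_eq_pullback_self φ)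
  have h1 := key restrictionMapEmpty 1 isRestrictionMap_empty.1 hasRestrictionDeriv_empty
  have h2 := key dilationTwo 2 dilationTwo_hasBoundaryValue dilationTwo_hasRestrictionDeriv
  have heq := limit_unique h2 h1
  rw [Real.one_rpow, ENNReal.ofReal_one, ENNReal.ofReal_eq_one] at heq
  have hlt : (1 : ℝ) < 2 ^ ((5 : ℝ) / 8) := Real.one_lt_rpow (by norm_num) (by norm_num)
  exact hlt.ne' heq

/-! ### (a) Load-bearing hypothesis: the derivative clause `HasRestrictionDeriv A Φ d` -/

/-- The crux with the clause `HasRestrictionDeriv A Φ d` DROPPED (so `d` is unconstrained). -/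
def AvoidanceLimitWithoutDeriv : Prop :=
  ∀ (D D' : DobrushinDomain) (a b : ℝ → Site 2), SAW.IsEndpointApprox D a b →
    D'.carrier ⊆ D.carrier → D'.pt 0 = D.pt 0 → D'.pt 1 = D.pt 1 →
    (∃ ε : ℝ, 0 < ε ∧ D'.carrier ∩ Metric.ball (D.pt 0) ε = D.carrier ∩ Metric.ball (D.pt 0) ε ∧
      D'.carrier ∩ Metric.ball (D.pt 1) ε = D.carrier ∩ Metric.ball (D.pt 1) ε) →
    ∀ (φ : ConformalEquiv upperHalfPlaneSet D.carrier), D.IsChordalUniformizing φ →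
    ∀ (A : Set ℂ), A = closure (upperHalfPlaneSet \ {z | z ∈ upperHalfPlaneSet ∧ φ z ∈ D'.carrier}) →
    ∀ (Φ : ConformalEquiv (upperHalfPlaneSet \ A) upperHalfPlaneSet) (d : ℝ),
      IsRestrictionMap A Φ →
      Tendsto (fun δ => ((SAW.law D.carrier δ (a δ) (b δ)).map (fun γ => γ.curve))
        (CurveClass.rangeSubset (closure D'.carrier))) (𝓝[>] 0)
        (𝓝 (ENNReal.ofReal (d ^ ((5 : ℝ) / 8))))

theorem avoidanceLimit_of_withoutDeriv (h : AvoidanceLimitWithoutDeriv) : AvoidanceLimit :=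
  fun D D' a b hab hsub h0 h1 hball φ hφ A hA Φ d hΦ _ ↦ h D D' a b hab hsub h0 h1 hball φ hφ A hA Φ d hΦ

/-- **The derivative clause is load-bearing** (trivially: it is the only link between `d` and `Φ`).
Witness `D' = D = bigSq`, `A = ∅`, `Φ = id`, `d ∈ {0, 1}`. [folklore] -/
theorem avoidanceLimit_false_without_deriv : ¬ AvoidanceLimitWithoutDeriv := by
  intro h
  obtain ⟨a, b, hab⟩ := SAW.exists_isEndpointApprox bigSq
  obtain ⟨φ, hφ⟩ := MarkedDomain.exists_isChordalUniformizing_holds bigSq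
  have key := h bigSq bigSq a b hab subset_rfl rfl rfl ⟨1, one_pos, rfl, rfl⟩ φ hφ
    ∅ (empty_eq_pullback_self φ) restrictionMapEmpty
  exact one_ne_zero_rpow (limit_unique (key 1 isRestrictionMap_empty) (key 0 isRestrictionMap_empty))

/-! ### (a) Load-bearing hypothesis: the identification `A = closure (ℍ ∖ φ⁻¹ D')` -/

/-- The crux with the identification `A = closure (ℍ ∖ φ⁻¹(D'))` DROPPED (`A` is a free set). -/
def AvoidanceLimitWithoutHullEq : Prop :=
  ∀ (D D' : DobrushinDomain) (a b : ℝ → Site 2), SAW.IsEndpointApprox D a b →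
    D'.carrier ⊆ D.carrier → D'.pt 0 = D.pt 0 → D'.pt 1 = D.pt 1 →
    (∃ ε : ℝ, 0 < ε ∧ D'.carrier ∩ Metric.ball (D.pt 0) ε = D.carrier ∩ Metric.ball (D.pt 0) ε ∧
      D'.carrier ∩ Metric.ball (D.pt 1) ε = D.carrier ∩ Metric.ball (D.pt 1) ε) →
    ∀ (φ : ConformalEquiv upperHalfPlaneSet D.carrier), D.IsChordalUniformizing φ →
    ∀ (A : Set ℂ),
    ∀ (Φ : ConformalEquiv (upperHalfPlaneSet \ A) upperHalfPlaneSet) (d : ℝ),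
      IsRestrictionMap A Φ → HasRestrictionDeriv A Φ d →
      Tendsto (fun δ => ((SAW.law D.carrier δ (a δ) (b δ)).map (fun γ => γ.curve))
        (CurveClass.rangeSubset (closure D'.carrier))) (𝓝[>] 0)
        (𝓝 (ENNReal.ofReal (d ^ ((5 : ℝ) / 8))))

theorem avoidanceLimit_of_withoutHullEq (h : AvoidanceLimitWithoutHullEq) : AvoidanceLimit :=
  fun D D' a b hab hsub h0 h1 hball φ hφ A _ Φ d hΦ hd ↦ h D D' a b hab hsub h0 h1 hball φ hφ A Φ d hΦ hd

/-- The disc `B(3i, 1)` lies in the open upper half-plane. [folklore] -/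
theorem ball_three_I_subset : ball (3 * I) 1 ⊆ upperHalfPlaneSet := by
  intro z hz
  rw [Metric.mem_ball, dist_eq_norm] at hz
  have h := Complex.abs_im_le_norm (z - 3 * I)
  simp only [Complex.sub_im, Complex.mul_im, Complex.I_im, Complex.re_ofNat, Complex.im_ofNat,
    Complex.I_re] at h
  show (0 : ℝ) < z.im
  have := (abs_le.1 (h.trans hz.le)).1
  linarith

/-- **The identification of `A` with the pulled-back hull is load-bearing.** Witness: `D' = D`,
`A = B(3i,1)ᶜ` (so `ℍ ∖ A` is a disc, away from `0` and bounded): any Riemann map of the disc is a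
"restriction map" with every `d`. [folklore] -/
theorem avoidanceLimit_false_without_hullEq : ¬ AvoidanceLimitWithoutHullEq := by
  intro h
  obtain ⟨a, b, hab⟩ := SAW.exists_isEndpointApprox bigSq
  obtain ⟨φ, hφ⟩ := MarkedDomain.exists_isChordalUniformizing_holds bigSq
  set A : Set ℂ := (ball (3 * I) 1)ᶜ with hA
  have hUA : upperHalfPlaneSet \ A = ball (3 * I) 1 := by
    ext z
    simp only [hA, Set.mem_sdiff, mem_compl_iff, not_not]
    exact ⟨fun hz ↦ hz.2, fun hz ↦ ⟨ball_three_I_subset hz, hz⟩⟩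
  have key := h bigSq bigSq a b hab subset_rfl rfl rfl ⟨1, one_pos, rfl, rfl⟩ φ hφ A
  -- a Riemann map of the disc
  have hsc : IsSimplyConnected (ball (3 * I) 1) := by
    have : ContractibleSpace (ball (3 * I) 1) :=
      (convex_ball (3 * I) 1).contractibleSpace ⟨3 * I, mem_ball_self one_pos⟩
    change SimplyConnectedSpace (ball (3 * I) 1)
    infer_instance
  have hne : ball (3 * I) 1 ≠ univ := fun heq ↦ by
    have : (0 : ℂ) ∈ ball (3 * I) 1 := by rw [heq]; exact mem_univ _
    rw [Metric.mem_ball, dist_eq_norm, zero_sub, norm_neg, norm_mul, Complex.norm_I] at this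
    norm_num at this
  obtain ⟨Ψ⟩ := exists_conformalEquiv_upperHalfPlaneSet_holds isOpen_ball hsc hne
  set Φ : ConformalEquiv (upperHalfPlaneSet \ A) upperHalfPlaneSet := Ψ.symm.copy _ _ hUA rfl with hΦ
  have hbot0 : 𝓝[upperHalfPlaneSet \ A] (0 : ℂ) = ⊥ := by
    rw [hUA, ← Filter.not_neBot, ← mem_closure_iff_nhdsWithin_neBot, closure_ball _ one_ne_zero,
      Metric.mem_closedBall, dist_eq_norm, zero_sub, norm_neg, norm_mul, Complex.norm_I]
    norm_num
  have hbotInf : cocompact ℂ ⊓ 𝓟 (upperHalfPlaneSet \ A) = ⊥ := by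
    rw [hUA, Filter.inf_principal_eq_bot]
    exact mem_of_superset (isCompact_closedBall (3 * I) 1).compl_mem_cocompact
      (compl_subset_compl.2 ball_subset_closedBall)
  have hR : IsRestrictionMap A Φ := by
    refine ⟨?_, ?_⟩
    · show Tendsto Φ (𝓝[upperHalfPlaneSet \ A] 0) (𝓝 0)
      rw [hbot0]; exact tendsto_bot
    · rw [hbotInf]; exact tendsto_bot
  have hD : ∀ d : ℝ, HasRestrictionDeriv A Φ d := fun d ↦ by
    show Tendsto _ (𝓝[upperHalfPlaneSet \ A] 0) _
    rw [hbot0]; exact tendsto_bot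
  exact one_ne_zero_rpow (limit_unique (key Φ 1 hR (hD 1)) (key Φ 0 hR (hD 0)))


/-! ### (c) A decorative hypothesis: agreement of the marked points -/

/-- The crux with the two clauses `D'.pt 0 = D.pt 0`, `D'.pt 1 = D.pt 1` DROPPED. This is NOT a
genuine strengthening: it is EQUIVALENT to the crux (`avoidanceLimitWithoutPt_iff`), because the
conclusion sees `D'` only through its carrier and the ball agreement already puts `a, b` on `∂D'`,
so `D'` can be re-marked at `a, b`. Information for provers: `hpt` cannot be used for anything. -/
def AvoidanceLimitWithoutPt : Prop :=
  ∀ (D D' : DobrushinDomain) (a b : ℝ → Site 2), SAW.IsEndpointApprox D a b →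
    D'.carrier ⊆ D.carrier →
    (∃ ε : ℝ, 0 < ε ∧ D'.carrier ∩ Metric.ball (D.pt 0) ε = D.carrier ∩ Metric.ball (D.pt 0) ε ∧
      D'.carrier ∩ Metric.ball (D.pt 1) ε = D.carrier ∩ Metric.ball (D.pt 1) ε) →
    ∀ (φ : ConformalEquiv upperHalfPlaneSet D.carrier), D.IsChordalUniformizing φ →
    ∀ (A : Set ℂ), A = closure (upperHalfPlaneSet \ {z | z ∈ upperHalfPlaneSet ∧ φ z ∈ D'.carrier}) →
    ∀ (Φ : ConformalEquiv (upperHalfPlaneSet \ A) upperHalfPlaneSet) (d : ℝ),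
      IsRestrictionMap A Φ → HasRestrictionDeriv A Φ d →
      Tendsto (fun δ => ((SAW.law D.carrier δ (a δ) (b δ)).map (fun γ => γ.curve))
        (CurveClass.rangeSubset (closure D'.carrier))) (𝓝[>] 0)
        (𝓝 (ENNReal.ofReal (d ^ ((5 : ℝ) / 8))))

private theorem injOn_shift' {X : Type*} {g : ℝ → X} (hp : Function.Periodic g 1)
    (hinj : InjOn g (Ico 0 1)) (c : ℝ) : InjOn (fun t ↦ g (t + c)) (Ico 0 1) := by
  have hfr : ∀ x, g (Int.fract x) = g x := fun x ↦ by
    rw [Int.fract]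
    have := hp.sub_int_mul_eq (x := x) ⌊x⌋
    rwa [mul_one] at this
  intro s hs t ht hst
  simp only at hst
  rw [← hfr (s + c), ← hfr (t + c)] at hst
  have h1 := hinj ⟨Int.fract_nonneg _, Int.fract_lt_one _⟩ ⟨Int.fract_nonneg _, Int.fract_lt_one _⟩ hst
  obtain ⟨z, hz⟩ := Int.fract_eq_fract.1 h1
  have hz' : (s - t : ℝ) = z := by linarith
  have habs : |(z : ℝ)| < 1 := by
    rw [← hz', abs_sub_lt_iff]
    exact ⟨by linarith [hs.1, hs.2, ht.1, ht.2], by linarith [hs.1, hs.2, ht.1, ht.2]⟩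
  have hz0 : z = 0 := by
    have : |z| < 1 := by exact_mod_cast habs
    exact Int.abs_lt_one_iff.1 this
  rw [hz0, Int.cast_zero, sub_eq_zero] at hz'
  exact hz'

private theorem range_shift' {X : Type*} (g : ℝ → X) (c : ℝ) : range (fun t ↦ g (t + c)) = range g := by
  ext x
  constructor
  · rintro ⟨t, rfl⟩; exact ⟨t + c, rfl⟩
  · rintro ⟨t, rfl⟩; exact ⟨t - c, by simp⟩

/-- **Re-marking a Jordan domain**: two distinct frontier points `p ≠ q` of a Jordan domain are the
marked points of some Dobrushin structure on the SAME carrier (shift the boundary loop to start at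
`p`; the second mark is `fract (s_q - s_p) ∈ (0, 1)`). [folklore] -/
theorem exists_dobrushin_remark (J : JordanDomain) {p q : ℂ} (hp : p ∈ frontier J.carrier)
    (hq : q ∈ frontier J.carrier) (hpq : p ≠ q) :
    ∃ D : DobrushinDomain, D.carrier = J.carrier ∧ D.pt 0 = p ∧ D.pt 1 = q := by
  rw [J.frontier_eq_image_Ico] at hp hq
  obtain ⟨s, -, rfl⟩ := hp
  obtain ⟨s', -, rfl⟩ := hq
  set γ : ℝ → ℂ := fun t ↦ J.boundary (t + s) with hγ
  have hγp : γ.Periodic 1 := fun t ↦ by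
    simp only [hγ]
    rw [add_right_comm]
    exact J.periodic_boundary _
  let J' : JordanDomain :=
    { carrier := J.carrier
      boundary := γ
      isOpen := J.isOpen
      isBounded := J.isBounded
      isConnected := J.isConnected
      continuous_boundary := J.continuous_boundary.comp (continuous_id.add continuous_const)
      periodic_boundary := hγp
      injOn_boundary := injOn_shift' J.periodic_boundary J.injOn_boundary s
      range_boundary := by rw [hγ, range_shift', J.range_boundary] }
  set m : ℝ := Int.fract (s' - s) with hm
  have hγ0 : γ 0 = J.boundary s := by simp [hγ]
  have hγm : γ m = J.boundary s' := by
    simp only [hγ, hm, Int.fract]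
    have := J.periodic_boundary.sub_int_mul_eq (x := s') ⌊s' - s⌋
    rw [mul_one] at this
    rw [← this]
    congr 1
    ring
  have hm0 : m ≠ 0 := fun h ↦ hpq (by rw [← hγ0, ← hγm, h])
  have hmpos : 0 < m := lt_of_le_of_ne (Int.fract_nonneg _) (Ne.symm hm0)
  have hm1 : m < 1 := Int.fract_lt_one _
  refine ⟨{ toJordanDomain := J'
            mark := ![0, m]
            strictMono_mark := Fin.strictMono_iff_lt_succ.2 fun i ↦ by fin_cases i; simpa using hmpos
            mark_mem := fun i ↦ by fin_cases i <;> simp [hmpos.le, hm1] }, rfl, ?_, ?_⟩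
  · exact hγ0
  · exact hγm

/-- The marked points of `D` lie on the frontier of any hull-type subdomain `D' ⊆ D` agreeing with `D`
in a ball around them. [folklore] -/
theorem pt_mem_frontier_of_ball_agree {D D' : DobrushinDomain} (hsub : D'.carrier ⊆ D.carrier)
    {i : Fin 2} {ε : ℝ} (hε : 0 < ε)
    (hball : D'.carrier ∩ Metric.ball (D.pt i) ε = D.carrier ∩ Metric.ball (D.pt i) ε) :
    D.pt i ∈ frontier D'.carrier := by
  have hfr := D.pt_mem_frontier i
  rw [frontier_eq_closure_inter_closure] at hfr ⊢
  refine ⟨?_, closure_mono (compl_subset_compl.2 hsub) hfr.2⟩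
  -- `closure D ∩ ball ⊆ closure (ball ∩ D) = closure (ball ∩ D') ⊆ closure D'`
  have h1 : D.pt i ∈ closure (Metric.ball (D.pt i) ε ∩ D.carrier) :=
    Metric.isOpen_ball.inter_closure ⟨Metric.mem_ball_self hε, hfr.1⟩
  rw [inter_comm, ← hball] at h1
  exact closure_mono inter_subset_left h1

/-- **`hpt` is decorative**: the crux is equivalent to its variant without the marked-point clauses. -/
theorem avoidanceLimitWithoutPt_iff : AvoidanceLimitWithoutPt ↔ AvoidanceLimit := by
  constructor
  · exact fun h D D' a b hab hsub _ _ hball ↦ h D D' a b hab hsub hball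
  · intro h D D' a b hab hsub hball φ hφ A hA Φ d hΦ hd
    obtain ⟨ε, hε, hb0, hb1⟩ := hball
    -- re-mark `D'` at `a = D.pt 0`, `b = D.pt 1`
    obtain ⟨D'', hcar, h0, h1⟩ := exists_dobrushin_remark D'.toJordanDomain
      (pt_mem_frontier_of_ball_agree hsub hε hb0) (pt_mem_frontier_of_ball_agree hsub hε hb1)
      (fun heq ↦ absurd (D.pt_injective heq) (by decide))
    have hcar' : D''.carrier = D'.carrier := hcar
    have := h D D'' a b hab (hcar' ▸ hsub) h0 h1 ⟨ε, hε, hcar' ▸ hb0, hcar' ▸ hb1⟩ φ hφ A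
      (by rw [hA, hcar']) Φ d hΦ hd
    rwa [hcar'] at this

/-! ### (e) Near-miss: the ε-ball agreement at the marked points -/

/-- The crux with the ε-ball agreement clause DROPPED (`D' ⊆ D` with the same marked points only). -/
def AvoidanceLimitWithoutBall : Prop :=
  ∀ (D D' : DobrushinDomain) (a b : ℝ → Site 2), SAW.IsEndpointApprox D a b →
    D'.carrier ⊆ D.carrier → D'.pt 0 = D.pt 0 → D'.pt 1 = D.pt 1 →
    ∀ (φ : ConformalEquiv upperHalfPlaneSet D.carrier), D.IsChordalUniformizing φ →
    ∀ (A : Set ℂ), A = closure (upperHalfPlaneSet \ {z | z ∈ upperHalfPlaneSet ∧ φ z ∈ D'.carrier}) →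
    ∀ (Φ : ConformalEquiv (upperHalfPlaneSet \ A) upperHalfPlaneSet) (d : ℝ),
      IsRestrictionMap A Φ → HasRestrictionDeriv A Φ d →
      Tendsto (fun δ => ((SAW.law D.carrier δ (a δ) (b δ)).map (fun γ => γ.curve))
        (CurveClass.rangeSubset (closure D'.carrier))) (𝓝[>] 0)
        (𝓝 (ENNReal.ofReal (d ^ ((5 : ℝ) / 8))))

theorem avoidanceLimit_of_withoutBall (h : AvoidanceLimitWithoutBall) : AvoidanceLimit :=
  fun D D' a b hab hsub h0 h1 _ ↦ h D D' a b hab hsub h0 h1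

/-- NEAR-MISS (mathematically false, NOT formalisable cheaply). Paper witness: `D` = unit disc with
`a = pt 0`, `b = pt 1`; `D' = D ∖ ⋃ₖ closedBall cₖ sₖ` for boundary points `cₖ → a` (off `b`) with
`rₖ = dist (cₖ, a) = 2^{-k}` and `sₖ = rₖ³` (pairwise disjoint bites). Then `D'` IS a Dobrushin domain
(the boundary loop follows the circle and the inner semicircles; it is continuous at `a` because
`sₖ → 0`, injective, and bounds `D'` by the Jordan curve theorem), `D' ⊆ D`, `a, b ∈ ∂D'` (marks
agree), agreement near `b` but in NO ball around `a`. Endpoints: `a_δ :=` a lattice site whose mesh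
point lies in the open bite `ball c_{k(δ)} s_{k(δ)} ∩ D` with `s_{k(δ)+1} < δ ≤ s_{k(δ)}` (a disc of
radius `≥ δ` contains a mesh point; the disc's mesh graph is connected, so `a_δ ∈ Ω_δ` is joined to
`b_δ`), `b_δ` standard: an `IsEndpointApprox` with `meshPoint δ (a_δ) ∉ closure D'`, hence
`P_δ(range ⊆ closure D') = 0` for EVERY small `δ`. Restriction side: `A = closure (ℍ ∖ φ⁻¹D')`
accumulates at `0` (`0 ∈ A`, not a `*`-hull) but is bounded; `ℍ ∖ A = φ⁻¹ D'` is simply connected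
and equals `ℍ` near `∞`, so the normalised Riemann map `Φ` (`Φ(z)/z → 1`) exists, `Φ → 0` at the
prime end `0` (Carathéodory for the Jordan domain `D'`), and — the bites having relative size
`sₖ/rₖ = rₖ² ` with `Σ (sₖ/rₖ)² < ∞` and local distortion `O(sₖ/rₖ) → 0` — the UNRESTRICTED limit
`d = lim_{z→0} Φ(z)/z ∈ (0, 1)` exists (angular-derivative theory, Rodin–Warschawski type). So all
hypotheses hold with `d > 0` while the left side is identically `0`: the variant is false.
Obstruction to a Lean proof: no construction of `Φ` with a certified positive derivative at a
boundary point where `∂(ℍ ∖ A)` accumulates (Schwarz reflection is unavailable at `0 ∈ A`); the tree's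
`IsStarHull.exists_hasRestrictionDeriv_holds` needs `0 ∉ A`. Cheap vacuity tricks fail here: with
`hpt` kept, `0 ∈ closure (ℍ ∖ A)` and `ℍ ∖ A` is unbounded, so both normalising filters are non-trivial.
Moral for provers: the ball agreement at `a` is what puts `a_δ ∈ D'` eventually and what makes `A` a
`*`-hull (so that `d` is an honest derivative `Φ'_A(0) ∈ (0,1]`).
CYCLE 3 (cleaner witness, same verdict): instead of bites, remove a thin HORN tangent to `∂D` at `a`:
in `ℍ`-coordinates `G = ℍ ∖ cl H`, `H = {0 < Re z < 1, 0 < Im z < (Re z)²}`, `D' = φ(G)` (Jordan: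
`∂G = (-∞,0] ∪ {x + ix²} ∪ {1 + iy, y ≤ 1} ∪ [1,∞)` is a simple closed curve through `0` and `∞`,
and `φ` is a homeomorphism of closures); `D' ⊆ D`, same marked points, agreement near `b`, none near
`a`. `∂G` is Dini-smooth at `0` (the two arcs leave `0` in the directions `π` and `0`), so the
normalised Riemann map `Φ : G → ℍ` has a continuous non-vanishing derivative at `0`
(Kellogg–Warschawski, local form: Pommerenke, Boundary Behaviour of Conformal Maps, Thm 3.5 with
§3.4) and `d = lim_{z → 0, z ∈ G} Φ(z)/z ∈ (0, 1)` UNRESTRICTEDLY — exactly `HasRestrictionDeriv`;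
`Φ(z)/z → 1` at `∞` by the hydrodynamic normalisation (`A = cl H` compact). Lattice side: sites
`a_δ` with mesh point in the open horn image `φ(H) = D ∖ cl D'` accumulating at `a`, joined to `b_δ`
in `Ω_δ` (the horn is open in `D`): `P_δ(range ⊆ cl D') = 0` along a sequence, against `d^{5/8} > 0`.
Obstruction unchanged: no boundary regularity theory for Riemann maps in the tree. -/
theorem avoidanceLimit_false_without_ball : ¬ AvoidanceLimitWithoutBall := by
  sorry


/-! ### (a') Cycle 2 — both anchoring clauses dropped: provably false
(LANDED copy: `Theorems/AvoidanceLimit/Negative/AvoidanceLimitFalseWithoutBallAndPt.lean`, p75773) -/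

/-- The small square `(-1, 1)²` (marked anywhere: at the midpoints `1`, `-1` of its vertical
sides), a Dobrushin subdomain of `bigSq` whose closure misses the marked points `±2` of `bigSq`.
[folklore] -/
def smallSq : DobrushinDomain where
  toJordanDomain := rectDomain 1 1 one_pos one_pos
  mark := ![3 / 8, 7 / 8]
  strictMono_mark := Fin.strictMono_iff_lt_succ.2 fun i ↦ by fin_cases i; simp; norm_num
  mark_mem i := by fin_cases i <;> simp <;> norm_num

/-- The carrier of the small square is the open rectangle `(-1,1)²`. [folklore] -/
theorem smallSq_carrier : smallSq.carrier = symRect 1 1 := rfl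

/-- The small square lies in the big square. [folklore] -/
theorem smallSq_subset : smallSq.carrier ⊆ bigSq.carrier := by
  intro z hz
  rw [smallSq_carrier, mem_symRect] at hz
  rw [bigSq_carrier, mem_symRect]
  exact ⟨⟨by linarith [hz.1.1], by linarith [hz.1.2]⟩, by linarith [hz.2.1], by linarith [hz.2.2]⟩

/-- The marked points `±2` of `bigSq` are off the closed small square. [folklore] -/
theorem bigSq_pt_notMem_closure_smallSq (i : Fin 2) : bigSq.pt i ∉ closure smallSq.carrier := by
  rw [smallSq_carrier, closure_symRect one_pos one_pos, mem_reProdIm]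
  fin_cases i
  · simp [bigSq_pt_zero]
  · norm_num [bigSq_pt_one]

/-- The crux with BOTH anchoring clauses DROPPED: no `D'.pt i = D.pt i` and no ε-ball agreement
(only `D' ⊆ D`), everything else verbatim. -/
def AvoidanceLimitWithoutBallAndPt : Prop :=
  ∀ (D D' : DobrushinDomain) (a b : ℝ → Site 2), SAW.IsEndpointApprox D a b →
    D'.carrier ⊆ D.carrier →
    ∀ (φ : ConformalEquiv upperHalfPlaneSet D.carrier), D.IsChordalUniformizing φ →
    ∀ (A : Set ℂ), A = closure (upperHalfPlaneSet \ {z | z ∈ upperHalfPlaneSet ∧ φ z ∈ D'.carrier}) →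
    ∀ (Φ : ConformalEquiv (upperHalfPlaneSet \ A) upperHalfPlaneSet) (d : ℝ),
      IsRestrictionMap A Φ → HasRestrictionDeriv A Φ d →
      Tendsto (fun δ => ((SAW.law D.carrier δ (a δ) (b δ)).map (fun γ => γ.curve))
        (CurveClass.rangeSubset (closure D'.carrier))) (𝓝[>] 0)
        (𝓝 (ENNReal.ofReal (d ^ ((5 : ℝ) / 8))))

/-- Sanity: the doubly-weakened variant implies the crux. -/
theorem avoidanceLimit_of_withoutBallAndPt (h : AvoidanceLimitWithoutBallAndPt) : AvoidanceLimit :=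
  fun D D' a b hab hsub _ _ _ ↦ h D D' a b hab hsub

/-- **The marked-point clause and the ball agreement cannot both be dropped.** Witness:
`D = bigSq`, `D' = smallSq = (-1,1)²` (so `closure D' ∌ ±2`), `φ` a chordal uniformizer of `bigSq`:
`φ z → 2 ∉ closure D'` at `0` and `φ z → -2 ∉ closure D'` at `∞`, so `ℍ ∖ A = φ⁻¹(D')` stays away
from `0` and from `∞`, the filters `𝓝[ℍ ∖ A] 0` and `cocompact ⊓ 𝓟 (ℍ ∖ A)` are `⊥`, any Riemann map
`Φ : ℍ ∖ A → ℍ` is a "restriction map" with EVERY `d`, and the conclusion would give two limits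
`1^{5/8} ≠ 0^{5/8}` of one sequence. [folklore] -/
theorem avoidanceLimit_false_without_ball_and_pt : ¬ AvoidanceLimitWithoutBallAndPt := by
  intro h
  obtain ⟨a, b, hab⟩ := SAW.exists_isEndpointApprox bigSq
  obtain ⟨φ, hφ⟩ := MarkedDomain.exists_isChordalUniformizing_holds bigSq
  set A : Set ℂ := φ.pullbackHull smallSq with hAdef
  have key := h bigSq smallSq a b hab smallSq_subset φ hφ A rfl
  have hdiff : upperHalfPlaneSet \ A = φ.pullbackDomain smallSq := ConformalEquiv.diff_pullbackHull
  -- (1) the filter at `0` is trivial: `φ z → 2 ∉ closure D'`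
  have hbot0 : 𝓝[upperHalfPlaneSet \ A] (0 : ℂ) = ⊥ := by
    have hev : ∀ᶠ z in 𝓝[upperHalfPlaneSet] (0 : ℂ), φ z ∈ (closure smallSq.carrier)ᶜ :=
      hφ.1 (isClosed_closure.isOpen_compl.mem_nhds (bigSq_pt_notMem_closure_smallSq 0))
    have hle : 𝓝[upperHalfPlaneSet \ A] (0 : ℂ) ≤ 𝓝[upperHalfPlaneSet] 0 :=
      nhdsWithin_mono _ sdiff_le
    rw [← Filter.eventually_false_iff_eq_bot]
    filter_upwards [hle hev, self_mem_nhdsWithin] with z hz hzA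
    rw [hdiff] at hzA
    exact hz (subset_closure hzA.2)
  -- (2) the filter at `∞` is trivial: `φ z → -2 ∉ closure D'`
  have hbotInf : cocompact ℂ ⊓ 𝓟 (upperHalfPlaneSet \ A) = ⊥ := by
    have hev : ∀ᶠ z in cocompact ℂ ⊓ 𝓟 upperHalfPlaneSet, φ z ∈ (closure smallSq.carrier)ᶜ :=
      hφ.2 (isClosed_closure.isOpen_compl.mem_nhds (bigSq_pt_notMem_closure_smallSq 1))
    have hle : cocompact ℂ ⊓ 𝓟 (upperHalfPlaneSet \ A) ≤ cocompact ℂ ⊓ 𝓟 upperHalfPlaneSet :=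
      inf_le_inf_left _ (principal_mono.2 sdiff_le)
    rw [← Filter.eventually_false_iff_eq_bot]
    have hself : ∀ᶠ z in cocompact ℂ ⊓ 𝓟 (upperHalfPlaneSet \ A), z ∈ upperHalfPlaneSet \ A :=
      mem_inf_of_right (mem_principal_self _)
    filter_upwards [hle hev, hself] with z hz hzA
    rw [hdiff] at hzA
    exact hz (subset_closure hzA.2)
  -- a Riemann map of `ℍ ∖ A ≅ D'`
  have hsc : IsSimplyConnected (upperHalfPlaneSet \ A) :=
    (φ.restrHull smallSq smallSq_subset).isSimplyConnected_iff.2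
      (JordanDomain.isSimplyConnected_carrier smallSq.toJordanDomain)
  have hopen : IsOpen (upperHalfPlaneSet \ A) := by
    rw [hdiff]; exact ConformalEquiv.isOpen_pullbackDomain
  have hne : upperHalfPlaneSet \ A ≠ univ := fun heq ↦ by
    have : (-I : ℂ) ∈ upperHalfPlaneSet \ A := by rw [heq]; exact mem_univ _
    have h' : (0 : ℝ) < (-I).im := this.1
    norm_num at h'
  obtain ⟨Ψ⟩ := exists_conformalEquiv_upperHalfPlaneSet_holds hopen hsc hne
  set Φ := Ψ.symm with hΦ
  have hR : IsRestrictionMap A Φ := by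
    refine ⟨?_, ?_⟩
    · show Tendsto Φ (𝓝[upperHalfPlaneSet \ A] 0) (𝓝 0)
      rw [hbot0]; exact tendsto_bot
    · rw [hbotInf]; exact tendsto_bot
  have hD : ∀ d : ℝ, HasRestrictionDeriv A Φ d := fun d ↦ by
    show Tendsto _ (𝓝[upperHalfPlaneSet \ A] 0) _
    rw [hbot0]; exact tendsto_bot
  exact one_ne_zero_rpow (limit_unique (key Φ 1 hR (hD 1)) (key Φ 0 hR (hD 0)))


/-! ### (c') Cycle 2 — the exponent `5/8` is rigid; `Φ'_A(0) < 1` for non-trivial hulls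
(LANDED copy: `Theorems/AvoidanceLimit/Negative/AvoidanceLimitExponentRigidity.lean`, p75063) -/

/-! ### The one-parameter family of statements -/

/-- The crux `AvoidanceLimit` with the exponent `5/8` replaced by `p` (everything else verbatim). -/
def AvoidanceLimitExp (p : ℝ) : Prop :=
  ∀ (D D' : DobrushinDomain) (a b : ℝ → Site 2), SAW.IsEndpointApprox D a b →
    D'.carrier ⊆ D.carrier → D'.pt 0 = D.pt 0 → D'.pt 1 = D.pt 1 →
    (∃ ε : ℝ, 0 < ε ∧ D'.carrier ∩ Metric.ball (D.pt 0) ε = D.carrier ∩ Metric.ball (D.pt 0) ε ∧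
      D'.carrier ∩ Metric.ball (D.pt 1) ε = D.carrier ∩ Metric.ball (D.pt 1) ε) →
    ∀ (φ : ConformalEquiv upperHalfPlaneSet D.carrier), D.IsChordalUniformizing φ →
    ∀ (A : Set ℂ), A = closure (upperHalfPlaneSet \ {z | z ∈ upperHalfPlaneSet ∧ φ z ∈ D'.carrier}) →
    ∀ (Φ : ConformalEquiv (upperHalfPlaneSet \ A) upperHalfPlaneSet) (d : ℝ),
      IsRestrictionMap A Φ → HasRestrictionDeriv A Φ d →
      Tendsto (fun δ => ((SAW.law D.carrier δ (a δ) (b δ)).map (fun γ => γ.curve))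
        (CurveClass.rangeSubset (closure D'.carrier))) (𝓝[>] 0)
        (𝓝 (ENNReal.ofReal (d ^ p)))

/-- The member `p = 5/8` of the family is the crux, definitionally. -/
theorem avoidanceLimitExp_iff : AvoidanceLimitExp ((5 : ℝ) / 8) ↔ AvoidanceLimit := Iff.rfl

/-! ### `Φ'_A(0) < 1` for hulls meeting the open half-plane -/

/-- Local analysis at a real boundary point, non-strict version of the tree's
`SchwarzReflection.deriv_ne_zero_of_im_pos`: if `F` is holomorphic on `B(0, r)`, `F(0) = 0`, `F` is
not identically zero near `0` and `Im F ≥ 0` on the upper half-disc, then `F'(0) ≠ 0` (otherwise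
`F = zⁿ g` with `n ≥ 2`, `g(0) ≠ 0`, and `Im F(tω) < 0` for small `t > 0` along a direction `ω ∈ ℍ`
with `Im (ωⁿ g(0)) < 0`). [folklore] -/
theorem deriv_ne_zero_of_im_nonneg {F : ℂ → ℂ} {r : ℝ} (hr : 0 < r)
    (hF : DifferentiableOn ℂ F (ball (0 : ℂ) r)) (hF0 : F 0 = 0)
    (hnn : ∀ z ∈ upperHalfPlaneSet ∩ ball (0 : ℂ) r, 0 ≤ (F z).im)
    (hne : ¬∀ᶠ z in 𝓝 (0 : ℂ), F z = 0) : deriv F 0 ≠ 0 := by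
  intro hc
  have han : AnalyticAt ℂ F 0 := hF.analyticAt (ball_mem_nhds 0 hr)
  -- paths `t ↦ t ω` into the half-disc
  have hpath : ∀ ω : ℂ, 0 < ω.im → Tendsto (fun t : ℝ ↦ (t : ℂ) * ω) (𝓝[>] 0) (𝓝 0) ∧
      ∀ᶠ t : ℝ in 𝓝[>] 0, (t : ℂ) * ω ∈ upperHalfPlaneSet ∩ ball (0 : ℂ) r := by
    intro ω hω
    have h1 : Tendsto (fun t : ℝ ↦ (t : ℂ) * ω) (𝓝[>] 0) (𝓝 0) := by
      have : Continuous fun t : ℝ ↦ (t : ℂ) * ω := by fun_prop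
      simpa using (this.tendsto 0).mono_left nhdsWithin_le_nhds
    refine ⟨h1, ?_⟩
    filter_upwards [h1.eventually (ball_mem_nhds (0 : ℂ) hr), self_mem_nhdsWithin] with t ht ht0
    refine ⟨?_, ht⟩
    show 0 < ((t : ℂ) * ω).im
    have ht0' : 0 < t := ht0
    simpa using mul_pos ht0' hω
  obtain ⟨n, g, hg, hg0, hFg⟩ := han.exists_eventuallyEq_pow_smul_nonzero_iff.2 hne
  simp only [sub_zero, smul_eq_mul] at hFg
  have hn0 : n ≠ 0 := by
    rintro rfl
    have h := hFg.self_of_nhds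
    rw [hF0, pow_zero, one_mul] at h
    exact hg0 h.symm
  have hn1 : n ≠ 1 := by
    rintro rfl
    have hg' : HasDerivAt (fun z ↦ z ^ 1 * g z) (g 0) 0 := by
      have h := (hasDerivAt_id' (0 : ℂ)).fun_mul hg.differentiableAt.hasDerivAt
      simp only [one_mul, zero_mul, add_zero] at h
      simpa only [pow_one] using h
    have hF' : HasDerivAt F (g 0) 0 := hg'.congr_of_eventuallyEq hFg
    exact hg0 (by rw [← hF'.deriv, hc])
  have hn2 : 2 ≤ n := by omega
  obtain ⟨ω, hωim, hωneg⟩ := SchwarzReflection.exists_im_pow_mul_neg hn2 hg0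
  obtain ⟨h1, h2⟩ := hpath ω hωim
  have hgt : Tendsto (fun t : ℝ ↦ ω ^ n * g (t * ω)) (𝓝[>] 0) (𝓝 (ω ^ n * g 0)) :=
    ((hg.continuousAt.tendsto).comp h1).const_mul _
  have hev_neg : ∀ᶠ t : ℝ in 𝓝[>] 0, (ω ^ n * g (t * ω)).im < 0 :=
    ((continuous_im.tendsto _).comp hgt).eventually (Iio_mem_nhds hωneg)
  have hev_eq : ∀ᶠ t : ℝ in 𝓝[>] 0, F (t * ω) = (t * ω) ^ n * g (t * ω) := h1.eventually hFg
  obtain ⟨t, ht1, ht2, ht3, ht0⟩ := (hev_neg.and (hev_eq.and (h2.and self_mem_nhdsWithin))).exists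
  have ht0' : 0 < t := ht0
  have hFnn := hnn _ ht3
  rw [ht2, mul_pow, mul_assoc, ← ofReal_pow, im_ofReal_mul] at hFnn
  have : (t : ℝ) ^ n * (ω ^ n * g (t * ω)).im < 0 := mul_neg_of_pos_of_neg (pow_pos ht0' n) ht1
  linarith

/-- **`Φ'_A(0) < 1` as soon as the `*`-hull `A` meets the open half-plane** (strict form of
[LSW] (2.4): `0 < Φ'_A(0) ≤ 1`, with equality only for the trivial hull). Proof: `G(z) = z − E(z)`,
`E` the Schwarz reflection `hullExt Φ` of `Φ_A` across `ℝ ∖ A`, is holomorphic near `0` with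
`G(0) = 0`, `G'(0) = 1 − Φ'_A(0)` and `Im G ≥ 0` on the upper half-disc (`Im Φ_A ≤ Im z`). If
`Φ'_A(0) = 1` then `G'(0) = 0`, so by `deriv_ne_zero_of_im_nonneg` `G ≡ 0` near `0`; then
`Φ_A = id` near a point of `ℍ ∖ A`, hence on all of the connected open set `ℍ ∖ A` (identity
theorem), and `Φ_A(ℍ ∖ A) = ℍ` would force `A ∩ ℍ = ∅`.
[cite: LawlerSchrammWerner2003Restriction, §2 (2.4) p. 7] -/
theorem restrictionDeriv_lt_one {A : Set ℂ} (hA : IsStarHull A)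
    {Φ : ConformalEquiv (upperHalfPlaneSet \ A) upperHalfPlaneSet} (hΦ : IsRestrictionMap A Φ)
    {d : ℝ} (hd : HasRestrictionDeriv A Φ d) (hne : (A ∩ upperHalfPlaneSet).Nonempty) : d < 1 := by
  obtain ⟨d', -, hd1', hd'⟩ := IsStarHull.exists_hasRestrictionDeriv_holds hA hΦ
  have hdd : d = d' := hd.unique hA hd'
  have hd1 : d ≤ 1 := hdd ▸ hd1'
  refine lt_of_le_of_ne hd1 fun hdeq ↦ ?_
  -- the reflected map and `G = id - E`
  have hEd : DifferentiableOn ℂ (hullExt Φ) (symmDomain A) :=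
    differentiableOn_hullExt hA.isBoundedHull hΦ
  obtain ⟨r, hr, hball⟩ : ∃ r > 0, ball (0 : ℂ) r ⊆ symmDomain A :=
    Metric.isOpen_iff.1 (isOpen_symmDomain hA.isBoundedHull.isClosed) 0 hA.zero_mem_symmDomain
  set G : ℂ → ℂ := fun z ↦ z - hullExt Φ z with hG
  have hGd : DifferentiableOn ℂ G (ball (0 : ℂ) r) := differentiableOn_id.sub (hEd.mono hball)
  have hG0 : G 0 = 0 := by
    simp only [hG, hullExt_zero hA hΦ, sub_zero]
  have hGderiv : deriv G 0 = 1 - (d : ℂ) :=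
    ((hasDerivAt_id (0 : ℂ)).sub (hasDerivAt_hullExt_zero hA hΦ hd)).deriv
  have hGnn : ∀ z ∈ upperHalfPlaneSet ∩ ball (0 : ℂ) r, 0 ≤ (G z).im := by
    rintro z ⟨hzU, hzr⟩
    have hzA : z ∈ upperHalfPlaneSet \ A := ⟨hzU, (hball hzr).1⟩
    have h := hullExt_im_le hA.isBoundedHull hΦ hzA
    simp only [hG, sub_im, sub_nonneg]
    exact h
  -- `G` is not identically zero near `0`: otherwise `Φ = id` on `ℍ ∖ A`
  have hGne : ¬∀ᶠ z in 𝓝 (0 : ℂ), G z = 0 := by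
    intro hev
    obtain ⟨r', hr', hsub'⟩ := Metric.eventually_nhds_iff_ball.1 hev
    set ρ : ℝ := min r r' with hρ
    have hρ0 : 0 < ρ := lt_min hr hr'
    set z₀ : ℂ := ((ρ / 2 : ℝ) : ℂ) * I with hz₀
    have hz₀im : z₀.im = ρ / 2 := by simp [hz₀]
    have hz₀norm : ‖z₀‖ = ρ / 2 := by
      rw [hz₀, norm_mul, Complex.norm_I, mul_one, Complex.norm_real, Real.norm_eq_abs,
        abs_of_pos (by positivity)]
    have hz₀U : z₀ ∈ upperHalfPlaneSet := by
      show 0 < z₀.im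
      rw [hz₀im]; positivity
    have hz₀r : z₀ ∈ ball (0 : ℂ) r := by
      rw [Metric.mem_ball, dist_zero_right, hz₀norm]
      linarith [min_le_left r r']
    have hz₀A : z₀ ∈ upperHalfPlaneSet \ A := ⟨hz₀U, (hball hz₀r).1⟩
    -- `Φ = id` near `z₀`
    have hevid : (fun z ↦ Φ z) =ᶠ[𝓝 z₀] id := by
      have hmem : ball z₀ (ρ / 2) ∩ upperHalfPlaneSet ∈ 𝓝 z₀ :=
        inter_mem (ball_mem_nhds _ (by positivity)) (isOpen_upperHalfPlaneSet.mem_nhds hz₀U)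
      filter_upwards [hmem] with z hz
      obtain ⟨hzb, hzU⟩ := hz
      have hzr' : z ∈ ball (0 : ℂ) r' := by
        rw [Metric.mem_ball, dist_zero_right]
        rw [Metric.mem_ball] at hzb
        calc ‖z‖ = ‖(z - z₀) + z₀‖ := by ring_nf
          _ ≤ ‖z - z₀‖ + ‖z₀‖ := norm_add_le _ _
          _ < ρ / 2 + ρ / 2 := by rw [hz₀norm, ← dist_eq_norm]; linarith
          _ = ρ := by ring
          _ ≤ r' := min_le_right r r'
      have h := hsub' z hzr'
      simp only [hG, sub_eq_zero] at h
      rw [hullExt_of_im_pos hzU] at h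
      exact h.symm
    -- identity theorem on the connected open set `ℍ ∖ A`
    have hopen : IsOpen (upperHalfPlaneSet \ A) :=
      isOpen_upperHalfPlaneSet.sdiff hA.isBoundedHull.isClosed
    have hpre : IsPreconnected (upperHalfPlaneSet \ A) :=
      hA.1.2.2.isPathConnected.isConnected.isPreconnected
    have hanΦ : AnalyticOnNhd ℂ (fun z ↦ Φ z) (upperHalfPlaneSet \ A) :=
      Φ.differentiableOn_coe.analyticOnNhd hopen
    have heq : EqOn (fun z ↦ Φ z) id (upperHalfPlaneSet \ A) :=
      hanΦ.eqOn_of_preconnected_of_eventuallyEq analyticOnNhd_id hpre hz₀A hevid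
    obtain ⟨w, hwA, hwU⟩ := hne
    have hw' : Φ.symm w ∈ upperHalfPlaneSet \ A := Φ.symm_mapsTo hwU
    have h1 : Φ (Φ.symm w) = w := Φ.apply_symm_apply hwU
    have h2 : Φ (Φ.symm w) = Φ.symm w := heq hw'
    rw [h1] at h2
    exact hw'.2 (h2 ▸ hwA)
  have key := deriv_ne_zero_of_im_nonneg hr hGd hG0 hGnn hGne
  rw [hGderiv, hdeq, Complex.ofReal_one, sub_self] at key
  exact key rfl

/-! ### The strip in the square is a genuine hull subdomain -/

/-- `flatRect` is a hull subdomain of `bigSq` in the tree's sense (`MarkedDomain.IsHullSubdomain`):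
the removed part `bigSq ∖ flatRect` lies in `{|Im z| ≥ 1}`, away from the marked points `±2`.
[folklore] -/
theorem isHullSubdomain_flatRect : bigSq.IsHullSubdomain flatRect := by
  have hcl : closure (bigSq.carrier \ flatRect.carrier) ⊆ {z : ℂ | 1 ≤ |z.im|} := by
    refine closure_minimal ?_ (isClosed_le continuous_const (continuous_abs.comp continuous_im))
    rintro z ⟨hzD, hzD'⟩
    rw [bigSq_carrier, mem_symRect] at hzD
    rw [flatRect_carrier, mem_symRect] at hzD'
    show 1 ≤ |z.im|
    by_contra hlt
    push Not at hlt
    rw [abs_lt] at hlt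
    exact hzD' ⟨hzD.1, hlt.1, hlt.2⟩
  have hnot : ∀ c : ℂ, c.im = 0 → c ∉ closure (bigSq.carrier \ flatRect.carrier) := by
    intro c hc hmem
    have h := hcl hmem
    simp only [mem_setOf_eq, hc, abs_zero] at h
    linarith
  refine ⟨flatRect_subset, ?_, ?_, ?_, ?_⟩
  · rw [flatRect_pt_zero, bigSq_pt_zero]
  · rw [flatRect_pt_one, bigSq_pt_one]
  · rw [bigSq_pt_zero]; exact hnot 2 (by simp)
  · rw [bigSq_pt_one]; exact hnot (-2) (by simp)

/-- The pulled-back hull of the strip meets the open half-plane: the point `φ⁻¹(3i/2)` of `ℍ` is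
mapped into `bigSq ∖ flatRect`. [folklore] -/
theorem pullbackHull_flatRect_inter_nonempty (φ : ConformalEquiv upperHalfPlaneSet bigSq.carrier) :
    (φ.pullbackHull flatRect ∩ upperHalfPlaneSet).Nonempty := by
  set w : ℂ := ((3 / 2 : ℝ) : ℂ) * I with hw
  have hwim : w.im = 3 / 2 := by simp [hw]
  have hwre : w.re = 0 := by simp [hw]
  have hwD : w ∈ bigSq.carrier := by
    rw [bigSq_carrier, mem_symRect, hwre, hwim]
    norm_num
  have hwD' : w ∉ flatRect.carrier := by
    rw [flatRect_carrier, mem_symRect, hwim]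
    norm_num
  have hz : φ.symm w ∈ upperHalfPlaneSet := φ.symm_mapsTo hwD
  refine ⟨φ.symm w, subset_closure ⟨hz, ?_⟩, hz⟩
  rintro ⟨-, h⟩
  rw [φ.apply_symm_apply hwD] at h
  exact hwD' h

/-! ### At most one exponent -/

/-- **The exponent is rigid**: if the avoidance probabilities converge to `Φ'_A(0)^p` for all hull
subdomains and also to `Φ'_A(0)^q`, then `p = q`. Witness: `D = bigSq`, `D' = flatRect`, any
endpoint approximation and chordal uniformizer; the pulled-back hull is a `*`-hull meeting `ℍ`, so
`d = Φ'_A(0) ∈ (0, 1)` (`restrictionDeriv_lt_one`) and `d^p = d^q` forces `p = q`. [folklore] -/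
theorem avoidanceLimitExp_unique {p q : ℝ} (hp : AvoidanceLimitExp p) (hq : AvoidanceLimitExp q) :
    p = q := by
  obtain ⟨a, b, hab⟩ := SAW.exists_isEndpointApprox bigSq
  obtain ⟨φ, hφ⟩ := MarkedDomain.exists_isChordalUniformizing_holds bigSq
  have hball : ∃ ε : ℝ, 0 < ε ∧
      flatRect.carrier ∩ Metric.ball (bigSq.pt 0) ε = bigSq.carrier ∩ Metric.ball (bigSq.pt 0) ε ∧
      flatRect.carrier ∩ Metric.ball (bigSq.pt 1) ε = bigSq.carrier ∩ Metric.ball (bigSq.pt 1) ε := by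
    refine ⟨1, one_pos, ?_, ?_⟩
    · rw [bigSq_pt_zero]; exact flatRect_ball_agree 2 (by simp)
    · rw [bigSq_pt_one]; exact flatRect_ball_agree (-2) (by simp)
  have hpt0 : flatRect.pt 0 = bigSq.pt 0 := by rw [flatRect_pt_zero, bigSq_pt_zero]
  have hpt1 : flatRect.pt 1 = bigSq.pt 1 := by rw [flatRect_pt_one, bigSq_pt_one]
  set A : Set ℂ := φ.pullbackHull flatRect with hAdef
  have hstar : IsStarHull A :=
    IsStarHull.pullbackHull JordanDomain.isSimplyConnected_holds hφ isHullSubdomain_flatRect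
  obtain ⟨Φ, hΦ, -⟩ := IsStarHull.existsUnique_isRestrictionMap_holds hstar
  obtain ⟨d, hd0, -, hd⟩ := IsStarHull.exists_hasRestrictionDeriv_holds hstar hΦ
  have hd1 : d < 1 := restrictionDeriv_lt_one hstar hΦ hd (pullbackHull_flatRect_inter_nonempty φ)
  have kp := hp bigSq flatRect a b hab flatRect_subset hpt0 hpt1 hball φ hφ A rfl Φ d hΦ hd
  have kq := hq bigSq flatRect a b hab flatRect_subset hpt0 hpt1 hball φ hφ A rfl Φ d hΦ hd
  have heq : ENNReal.ofReal (d ^ p) = ENNReal.ofReal (d ^ q) := tendsto_nhds_unique kp kq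
  rw [ENNReal.ofReal_eq_ofReal_iff (Real.rpow_nonneg hd0.le p) (Real.rpow_nonneg hd0.le q)] at heq
  have hlog := congrArg Real.log heq
  rw [Real.log_rpow hd0, Real.log_rpow hd0] at hlog
  have hlogd : Real.log d ≠ 0 := (Real.log_neg hd0 hd1).ne
  exact mul_right_cancel₀ hlogd hlog

/-- No two distinct exponents can hold simultaneously. [folklore] -/
theorem not_avoidanceLimitExp_and {p q : ℝ} (hpq : p ≠ q) :
    ¬ (AvoidanceLimitExp p ∧ AvoidanceLimitExp q) :=
  fun h ↦ hpq (avoidanceLimitExp_unique h.1 h.2)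

/-- **The crux excludes every other exponent**: under `AvoidanceLimit`, the variant with exponent
`q ≠ 5/8` is false — in particular the Ising/`n = 1` value `q = 1/2` and the Brownian-excursion
value `q = 1`. So the crux is not a consequence of any exponent-blind argument. [folklore] -/
theorem avoidanceLimit_not_exp (h : AvoidanceLimit) {q : ℝ} (hq : q ≠ (5 : ℝ) / 8) :
    ¬ AvoidanceLimitExp q :=
  fun hq' ↦ hq (avoidanceLimitExp_unique hq' (avoidanceLimitExp_iff.2 h))

/-- The Ising boundary exponent `1/2` transplanted to the SAW avoidance law contradicts the crux. -/
theorem avoidanceLimit_not_exp_half (h : AvoidanceLimit) : ¬ AvoidanceLimitExp ((1 : ℝ) / 2) :=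
  avoidanceLimit_not_exp h (by norm_num)

/-- The excursion exponent `1` transplanted to the SAW avoidance law contradicts the crux. -/
theorem avoidanceLimit_not_exp_one (h : AvoidanceLimit) : ¬ AvoidanceLimitExp 1 :=
  avoidanceLimit_not_exp h (by norm_num)

/-! ### Negative exponents are refuted unconditionally -/

/-- The pushed-forward SAW law gives mass at most `1` to every event (it is the zero measure or a
probability measure). [folklore] -/
theorem map_law_apply_le_one (Ω : Set ℂ) (δ : ℝ) (a b : Site 2) (s : Set (CurveClass ℂ)) :
    (SAW.law Ω δ a b).map (fun γ ↦ γ.curve) s ≤ 1 := by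
  have htot : SAW.law Ω δ a b univ ≤ 1 := by
    rw [SAW.law, Measure.smul_apply, smul_eq_mul]
    rcases eq_or_ne (SAW.weight Ω δ a b univ) 0 with h0 | h0
    · rw [h0]; simp
    rcases eq_or_ne (SAW.weight Ω δ a b univ) ⊤ with ht | ht
    · rw [ht]; simp
    · rw [ENNReal.inv_mul_cancel h0 ht]
  calc (SAW.law Ω δ a b).map (fun γ ↦ γ.curve) s
      ≤ (SAW.law Ω δ a b).map (fun γ ↦ γ.curve) univ := measure_mono (subset_univ _)
    _ = SAW.law Ω δ a b univ := by
        rw [Measure.map_apply (SAW.DomainSAW.measurable_of_top _) MeasurableSet.univ, preimage_univ]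
    _ ≤ 1 := htot

/-- **Negative exponents are refuted**: for `p < 0` the statement `AvoidanceLimitExp p` would make
avoidance probabilities (`≤ 1`) converge to `d^p > 1` for the strip in the square. [folklore] -/
theorem not_avoidanceLimitExp_of_neg {p : ℝ} (hp : p < 0) : ¬ AvoidanceLimitExp p := by
  intro h
  obtain ⟨a, b, hab⟩ := SAW.exists_isEndpointApprox bigSq
  obtain ⟨φ, hφ⟩ := MarkedDomain.exists_isChordalUniformizing_holds bigSq
  have hball : ∃ ε : ℝ, 0 < ε ∧
      flatRect.carrier ∩ Metric.ball (bigSq.pt 0) ε = bigSq.carrier ∩ Metric.ball (bigSq.pt 0) ε ∧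
      flatRect.carrier ∩ Metric.ball (bigSq.pt 1) ε = bigSq.carrier ∩ Metric.ball (bigSq.pt 1) ε := by
    refine ⟨1, one_pos, ?_, ?_⟩
    · rw [bigSq_pt_zero]; exact flatRect_ball_agree 2 (by simp)
    · rw [bigSq_pt_one]; exact flatRect_ball_agree (-2) (by simp)
  have hpt0 : flatRect.pt 0 = bigSq.pt 0 := by rw [flatRect_pt_zero, bigSq_pt_zero]
  have hpt1 : flatRect.pt 1 = bigSq.pt 1 := by rw [flatRect_pt_one, bigSq_pt_one]
  set A : Set ℂ := φ.pullbackHull flatRect with hAdef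
  have hstar : IsStarHull A :=
    IsStarHull.pullbackHull JordanDomain.isSimplyConnected_holds hφ isHullSubdomain_flatRect
  obtain ⟨Φ, hΦ, -⟩ := IsStarHull.existsUnique_isRestrictionMap_holds hstar
  obtain ⟨d, hd0, -, hd⟩ := IsStarHull.exists_hasRestrictionDeriv_holds hstar hΦ
  have hd1 : d < 1 := restrictionDeriv_lt_one hstar hΦ hd (pullbackHull_flatRect_inter_nonempty φ)
  have key := h bigSq flatRect a b hab flatRect_subset hpt0 hpt1 hball φ hφ A rfl Φ d hΦ hd
  -- the limit of quantities `≤ 1` is `≤ 1`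
  have hle : ENNReal.ofReal (d ^ p) ≤ 1 :=
    le_of_tendsto' key fun δ ↦ map_law_apply_le_one _ _ _ _ _
  have hgt : 1 < d ^ p := Real.one_lt_rpow_of_pos_of_lt_one_of_neg hd0 hd1 hp
  rw [← ENNReal.ofReal_one, ENNReal.ofReal_le_ofReal_iff zero_le_one] at hle
  linarith


/-! ### (b') Cycle 2 — an OPEN consequence much weaker than the crux: non-degenerate strip confinement

Under the crux, the probability that the critical SAW crossing the square `(-2,2)²` from `2` to `-2`
stays in the closed middle strip `[-2,2] × [-1,1]` converges to a number STRICTLY between `0` and `1`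
(`d^{5/8}` with `d ∈ (0,1)` by `restrictionDeriv_lt_one`). Even the qualitative shadow
"`liminf > 0` and `limsup < 1`" (scale invariance of a confinement probability at `x_c`) is not in
print: it is a natural cheaper milestone for planners and the place where transfer-matrix numerics
could bite (trend of `Z_strip/Z_box` for boxes of side `N`). -/

/-- **Strip window**: `AvoidanceLimit` gives the strip-in-square avoidance probabilities a limit in
`(0, 1)`, for EVERY endpoint approximation of `(bigSq; 2, -2)`. [folklore] -/
theorem avoidanceLimit_strip_limit (h : AvoidanceLimit) {a b : ℝ → Site 2}
    (hab : SAW.IsEndpointApprox bigSq a b) :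
    ∃ L : ℝ, 0 < L ∧ L < 1 ∧
      Tendsto (fun δ => ((SAW.law bigSq.carrier δ (a δ) (b δ)).map (fun γ => γ.curve))
        (CurveClass.rangeSubset (closure flatRect.carrier))) (𝓝[>] 0) (𝓝 (ENNReal.ofReal L)) := by
  obtain ⟨φ, hφ⟩ := MarkedDomain.exists_isChordalUniformizing_holds bigSq
  have hball : ∃ ε : ℝ, 0 < ε ∧
      flatRect.carrier ∩ Metric.ball (bigSq.pt 0) ε = bigSq.carrier ∩ Metric.ball (bigSq.pt 0) ε ∧
      flatRect.carrier ∩ Metric.ball (bigSq.pt 1) ε = bigSq.carrier ∩ Metric.ball (bigSq.pt 1) ε := by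
    refine ⟨1, one_pos, ?_, ?_⟩
    · rw [bigSq_pt_zero]; exact flatRect_ball_agree 2 (by simp)
    · rw [bigSq_pt_one]; exact flatRect_ball_agree (-2) (by simp)
  have hpt0 : flatRect.pt 0 = bigSq.pt 0 := by rw [flatRect_pt_zero, bigSq_pt_zero]
  have hpt1 : flatRect.pt 1 = bigSq.pt 1 := by rw [flatRect_pt_one, bigSq_pt_one]
  set A : Set ℂ := φ.pullbackHull flatRect with hAdef
  have hstar : IsStarHull A :=
    IsStarHull.pullbackHull JordanDomain.isSimplyConnected_holds hφ isHullSubdomain_flatRect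
  obtain ⟨Φ, hΦ, -⟩ := IsStarHull.existsUnique_isRestrictionMap_holds hstar
  obtain ⟨d, hd0, -, hd⟩ := IsStarHull.exists_hasRestrictionDeriv_holds hstar hΦ
  have hd1 : d < 1 := restrictionDeriv_lt_one hstar hΦ hd (pullbackHull_flatRect_inter_nonempty φ)
  refine ⟨d ^ ((5 : ℝ) / 8), Real.rpow_pos_of_pos hd0 _,
    Real.rpow_lt_one hd0.le hd1 (by norm_num), ?_⟩
  exact h bigSq flatRect a b hab flatRect_subset hpt0 hpt1 hball φ hφ A rfl Φ d hΦ hd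

/-- **Strip confinement is non-degenerate under the crux**: for some `c > 0` and all small `δ`,
`c ≤ P_δ(range ⊆ closed strip) ≤ 1 - c`. The lower bound says critical SAW pays only an `O(1)`
price for confinement in a fixed-aspect-ratio strip (scale invariance at `x_c`); the upper bound that
it leaves the strip with probability bounded below. Neither is a theorem in print. [folklore] -/
theorem avoidanceLimit_strip_window (h : AvoidanceLimit) {a b : ℝ → Site 2}
    (hab : SAW.IsEndpointApprox bigSq a b) :
    ∃ c : ℝ, 0 < c ∧ ∀ᶠ δ in 𝓝[>] 0,
      ENNReal.ofReal c ≤ ((SAW.law bigSq.carrier δ (a δ) (b δ)).map (fun γ => γ.curve))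
        (CurveClass.rangeSubset (closure flatRect.carrier)) ∧
      ((SAW.law bigSq.carrier δ (a δ) (b δ)).map (fun γ => γ.curve))
        (CurveClass.rangeSubset (closure flatRect.carrier)) ≤ ENNReal.ofReal (1 - c) := by
  obtain ⟨L, hL0, hL1, hT⟩ := avoidanceLimit_strip_limit h hab
  set c : ℝ := min (L / 2) ((1 - L) / 2) with hc
  have hc0 : 0 < c := lt_min (by linarith) (by linarith)
  have hcL : c < L := lt_of_le_of_lt (min_le_left _ _) (by linarith)
  have hLc : L < 1 - c := by
    have : c ≤ (1 - L) / 2 := min_le_right _ _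
    linarith
  refine ⟨c, hc0, ?_⟩
  have h1 : ∀ᶠ δ in 𝓝[>] 0, ENNReal.ofReal c < ((SAW.law bigSq.carrier δ (a δ) (b δ)).map
      (fun γ => γ.curve)) (CurveClass.rangeSubset (closure flatRect.carrier)) :=
    (tendsto_order.1 hT).1 _ ((ENNReal.ofReal_lt_ofReal_iff hL0).2 hcL)
  have h2 : ∀ᶠ δ in 𝓝[>] 0, ((SAW.law bigSq.carrier δ (a δ) (b δ)).map
      (fun γ => γ.curve)) (CurveClass.rangeSubset (closure flatRect.carrier)) < ENNReal.ofReal (1 - c) :=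
    (tendsto_order.1 hT).2 _ ((ENNReal.ofReal_lt_ofReal_iff (by linarith)).2 hLc)
  filter_upwards [h1, h2] with δ hδ1 hδ2
  exact ⟨hδ1.le, hδ2.le⟩



/-! ### (d'') Cycle 3 — KILL CRITERIA, the ENDPOINT TRANSFER in the reference square, the WINDOW
(landing copies: `Theorems/AvoidanceLimit/Negative/AvoidanceLimitKillCriteria.lean` (part 6),
`…/AvoidanceLimitStaircase.lean` (part 7), `…/AvoidanceLimitEndpointTransfer.lean` (part 8);
namespace `…Theorems.AvoidanceLimit.Negative`, same declaration names)

What a LATTICE refutation must exhibit, as theorems: `not_avoidanceLimit_of_frequently_zero`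
(a datum with NO confined SAW for meshes accumulating at `0`) or `not_avoidanceLimit_of_frequently_one`
(a hull subdomain `D' ≠ D` with ALL SAWs confined, frequently). The first is impossible whenever
`(a_δ, b_δ)` is also an endpoint approximation of `D'` (`eventually_map_law_rangeSubset_pos`: one
`Ω'_δ`-path gives `P_δ > 0`), and THAT holds for every hull subdomain of the reference square and
every endpoint approximation (`isEndpointApprox_of_hull_bigSq`, lattice staircases in the caps
`bigSq ∩ B(±2, ε)` + the tree's bulk theorem) — so `eventually_pos_bigSq` closes the probability-zero
door in `bigSq` unconditionally; the general `EndpointTransfer` is recorded with its paper proof.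
Under the crux, `avoidanceLimit_window`: `c ≤ P_δ ≤ 1 - c` eventually for every `D' ≠ D`. -/

/-! ### Lattice side: one confined self-avoiding path makes the avoidance probability positive -/

/-- The trace of the class of a SAW is the trace of its polyline. [folklore] -/
theorem range_curve {Ω : Set ℂ} {δ : ℝ} {a b : Site 2} (γ : SAW.DomainSAW Ω δ a b) :
    γ.curve.range = Set.range (γ.walk.toCurve (meshPoint δ)) := rfl

/-- If every closed edge of a SAW between distinct vertices lies in `S`, its polyline lies in `S`.
[folklore] -/
theorem curve_mem_rangeSubset {Ω : Set ℂ} {δ : ℝ} {a b : Site 2} {S : Set ℂ}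
    (γ : SAW.DomainSAW Ω δ a b) (hab : a ≠ b)
    (h : ∀ d ∈ γ.walk.darts, segment ℝ (meshPoint δ d.fst) (meshPoint δ d.snd) ⊆ S) :
    γ.curve ∈ CurveClass.rangeSubset S := by
  rw [CurveClass.mem_rangeSubset, range_curve]
  exact SimpleGraph.Walk.range_toCurve_subset_of_not_nil (fun hnil ↦ hab hnil.eq) h

/-- The critical SAW law of a bounded domain gives positive mass to every non-empty set of walks
from a vertex of `Ω_δ` to a different vertex (total weight finite, single weights `x_c^n > 0`).
[folklore] -/
theorem law_apply_pos {Ω : Set ℂ} (hΩ : Bornology.IsBounded Ω) {δ : ℝ} (hδ : 0 < δ) {a b : Site 2}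
    (ha : a ∈ meshDomain Ω δ) (hab : a ≠ b) {s : Set (SAW.DomainSAW Ω δ a b)} (hs : s.Nonempty) :
    0 < SAW.law Ω δ a b s := by
  have ha' : a ∈ meshDomainFinset Ω δ := by
    rw [← Finset.mem_coe, coe_meshDomainFinset hΩ hδ]; exact ha
  obtain ⟨γ, hγ⟩ := hs
  rw [SAW.law, Measure.smul_apply, smul_eq_mul]
  refine ENNReal.mul_pos ?_ ?_
  · rw [Ne, ENNReal.inv_eq_zero, DiluteLoopModel.SAW.weight_univ_eq_domainPartitionFunction ha' hab]
    exact ENNReal.ofReal_ne_top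
  · refine (lt_of_lt_of_le ?_ (measure_mono (singleton_subset_iff.2 hγ))).ne'
    rw [SAW.weight_singleton]
    exact ENNReal.ofReal_pos.2 (pow_pos SAW.criticalFugacity_pos_lt_one'.1 _)

/-- **One confined path makes the avoidance probability positive.** If `Ω_δ` contains a
self-avoiding path from `a` to `b ≠ a` all of whose closed edges lie in `S`, then
`P_δ(range ⊆ S) > 0` for the critical SAW of the bounded domain `Ω`. [folklore] -/
theorem map_law_rangeSubset_pos {Ω : Set ℂ} (hΩ : Bornology.IsBounded Ω) {δ : ℝ} (hδ : 0 < δ)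
    {a b : Site 2} (hab : a ≠ b) {S : Set ℂ} (p : (discreteDomainGraph Ω δ).Walk a b)
    (hp : p.IsPath) (hS : ∀ d ∈ p.darts, segment ℝ (meshPoint δ d.fst) (meshPoint δ d.snd) ⊆ S) :
    0 < ((SAW.law Ω δ a b).map (fun γ ↦ γ.curve)) (CurveClass.rangeSubset S) := by
  have ha : a ∈ meshDomain Ω δ := mem_meshDomain_of_reachable_ne ⟨p⟩ hab
  refine lt_of_lt_of_le ?_ (Measure.le_map_apply (SAW.aemeasurable_curve Ω δ a b) _)
  exact law_apply_pos hΩ hδ ha hab ⟨⟨p, hp⟩, curve_mem_rangeSubset ⟨p, hp⟩ hab hS⟩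

/-! ### Sub-domain walks are confined walks of the big domain -/

/-- The edges of a walk of `Ω'_δ` (`Ω' ⊆ Ω`) starting at a vertex of `Ω_δ` are edges of `Ω_δ`:
vertices of `Ω'_δ` lie in `Ω' ⊆ Ω`, closed edges in `closure Ω' ⊆ closure Ω`, and `Ω_δ` is a union
of mesh components. [folklore] -/
theorem edges_mem_edgeSet_of_subset {Ω Ω' : Set ℂ} (hsub : Ω' ⊆ Ω) {δ : ℝ} :
    ∀ {u v : Site 2} (q : (discreteDomainGraph Ω' δ).Walk u v), u ∈ meshDomain Ω δ →
      ∀ e ∈ q.edges, e ∈ (discreteDomainGraph Ω δ).edgeSet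
  | _, _, .nil, _ => by simp
  | u, v, .cons (v := w) hadj q, hu => by
    have h' := discreteDomainGraph_adj_iff.1 hadj
    have hm' := meshGraph_adj_iff.1 h'.1
    have hadjΩ : (meshGraph Ω δ).Adj u w :=
      meshGraph_adj_iff.2 ⟨hm'.1, hm'.2.trans (closure_mono hsub)⟩
    have hu' : u ∈ meshVertices Ω δ := meshDomain_subset_meshVertices _ _ hu
    have hw' : w ∈ meshVertices Ω δ := hsub (meshDomain_subset_meshVertices _ _ h'.2.2)
    have hw : w ∈ meshDomain Ω δ :=
      mem_meshDomain_of_adj (u := ⟨u, hu'⟩) (w := ⟨w, hw'⟩) hu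
        (by simpa only [SimpleGraph.comap_adj, Function.Embedding.subtype_apply] using hadjΩ)
    intro e he
    rw [SimpleGraph.Walk.edges_cons, List.mem_cons] at he
    rcases he with rfl | he
    · exact (SimpleGraph.mem_edgeSet _).2 (discreteDomainGraph_adj_iff.2 ⟨hadjΩ, hu, hw⟩)
    · exact edges_mem_edgeSet_of_subset hsub q hw e he

/-- **A joinable sub-domain gives positive avoidance probability.** If `a ≠ b` are joined in
`Ω'_δ` for some `Ω' ⊆ Ω` (bounded `Ω`, `δ > 0`) and `a ∈ Ω_δ`, then the critical SAW of `Ω_δ` from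
`a` to `b` stays in `closure Ω'` with positive probability. [folklore] -/
theorem map_law_rangeSubset_pos_of_reachable {Ω Ω' : Set ℂ} (hΩ : Bornology.IsBounded Ω)
    (hsub : Ω' ⊆ Ω) {δ : ℝ} (hδ : 0 < δ) {a b : Site 2} (hab : a ≠ b) (ha : a ∈ meshDomain Ω δ)
    (hr : (discreteDomainGraph Ω' δ).Reachable a b) :
    0 < ((SAW.law Ω δ a b).map (fun γ ↦ γ.curve)) (CurveClass.rangeSubset (closure Ω')) := by
  obtain ⟨q⟩ := hr
  set q' := q.toPath with hq'
  have hedges := edges_mem_edgeSet_of_subset hsub (q' : (discreteDomainGraph Ω' δ).Walk a b) ha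
  set p := (q' : (discreteDomainGraph Ω' δ).Walk a b).transfer (discreteDomainGraph Ω δ) hedges
    with hpdef
  have hp : p.IsPath := q'.2.transfer _
  refine map_law_rangeSubset_pos hΩ hδ hab p hp fun d hd ↦ ?_
  have he : d.edge ∈ (q' : (discreteDomainGraph Ω' δ).Walk a b).edges := by
    rw [← SimpleGraph.Walk.edges_transfer _ hedges]
    exact List.mem_map.2 ⟨d, hd, rfl⟩
  have hadj : (discreteDomainGraph Ω' δ).Adj d.fst d.snd :=
    (SimpleGraph.Walk.adj_of_mem_edges _ he)
  exact (meshGraph_adj_iff.1 (discreteDomainGraph_adj_iff.1 hadj).1).2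

/-- **Eventual positivity from an endpoint approximation of the SUB-domain.** If `(a_δ, b_δ)` is an
endpoint approximation of `D` AND of `D' ⊆ D`, then eventually `P_δ(range γ_δ ⊆ closure D') > 0`
for the critical SAW of `D`: a "probability-zero" refutation of the crux along such data is
impossible. [folklore] -/
theorem eventually_map_law_rangeSubset_pos {D D' : DobrushinDomain} {a b : ℝ → Site 2}
    (hab : SAW.IsEndpointApprox D a b) (hab' : SAW.IsEndpointApprox D' a b)
    (hsub : D'.carrier ⊆ D.carrier) :
    ∀ᶠ δ in 𝓝[>] (0 : ℝ), 0 < ((SAW.law D.carrier δ (a δ) (b δ)).map (fun γ ↦ γ.curve))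
      (CurveClass.rangeSubset (closure D'.carrier)) := by
  filter_upwards [hab.reachable, hab'.reachable, eventually_ne hab, self_mem_nhdsWithin]
    with δ hr hr' hne' hδ
  exact map_law_rangeSubset_pos_of_reachable D.isBounded hsub hδ hne'
    (mem_meshDomain_of_reachable_ne hr hne') hr'


/-! ### Restriction side: the crux's `d` is the honest derivative `Φ'_A(0) ∈ (0, 1]`, `< 1` off `D' = D` -/

/-- The inline hull hypotheses of the crux give the tree's `IsHullSubdomain` (ball agreement ⇒ the
marked points are off `closure (D ∖ D')`). (Same statement as the symplectic-fermion-anchor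
skeleton's lemma of that name; reproved here to keep the Negative lane self-contained.) [folklore] -/
theorem isHullSubdomain_of_ball {D D' : DobrushinDomain} (hsub : D'.carrier ⊆ D.carrier)
    (h0 : D'.pt 0 = D.pt 0) (h1 : D'.pt 1 = D.pt 1)
    (hball : ∃ ε : ℝ, 0 < ε ∧ D'.carrier ∩ ball (D.pt 0) ε = D.carrier ∩ ball (D.pt 0) ε ∧
      D'.carrier ∩ ball (D.pt 1) ε = D.carrier ∩ ball (D.pt 1) ε) :
    D.IsHullSubdomain D' := by
  obtain ⟨ε, hε, hb0, hb1⟩ := hball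
  have key : ∀ p : ℂ, D'.carrier ∩ ball p ε = D.carrier ∩ ball p ε →
      p ∉ closure (D.carrier \ D'.carrier) := by
    intro p hp hmem
    rw [mem_closure_iff_nhds] at hmem
    obtain ⟨z, hzb, hzD, hzD'⟩ := hmem (ball p ε) (ball_mem_nhds p hε)
    have hz : z ∈ D'.carrier ∩ ball p ε := by rw [hp]; exact ⟨hzD, hzb⟩
    exact hzD' hz.1
  exact ⟨hsub, h0, h1, key _ hb0, key _ hb1⟩

/-- **No junk `d`**: under the crux's hypotheses the number `d` IS `Φ'_A(0) ∈ (0, 1]` — the pulled-back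
hull is a `*`-hull (`IsStarHull.pullbackHull`), its restriction derivative exists in `(0, 1]` and is
unique. [folklore] -/
theorem restrictionDeriv_pos_le_one {D D' : DobrushinDomain} (hsub : D'.carrier ⊆ D.carrier)
    (h0 : D'.pt 0 = D.pt 0) (h1 : D'.pt 1 = D.pt 1)
    (hball : ∃ ε : ℝ, 0 < ε ∧ D'.carrier ∩ ball (D.pt 0) ε = D.carrier ∩ ball (D.pt 0) ε ∧
      D'.carrier ∩ ball (D.pt 1) ε = D.carrier ∩ ball (D.pt 1) ε)
    {φ : ConformalEquiv upperHalfPlaneSet D.carrier} (hφ : D.IsChordalUniformizing φ)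
    {A : Set ℂ} (hA : A = closure (upperHalfPlaneSet \ {z | z ∈ upperHalfPlaneSet ∧ φ z ∈ D'.carrier}))
    {Φ : ConformalEquiv (upperHalfPlaneSet \ A) upperHalfPlaneSet} {d : ℝ}
    (hΦ : IsRestrictionMap A Φ) (hd : HasRestrictionDeriv A Φ d) :
    IsStarHull A ∧ 0 < d ∧ d ≤ 1 := by
  subst hA
  have hstar : IsStarHull (φ.pullbackHull D') :=
    IsStarHull.pullbackHull JordanDomain.isSimplyConnected_holds hφ
      (isHullSubdomain_of_ball hsub h0 h1 hball)
  obtain ⟨d₀, hd₀, hd₀1, hd₀'⟩ := IsStarHull.exists_hasRestrictionDeriv_holds hstar hΦ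
  have hdd : d = d₀ := hd.unique hstar hd₀'
  exact ⟨hstar, hdd ▸ hd₀, hdd ▸ hd₀1⟩

/-- A point of `D ∖ D'` pulls back into the hull: `A ∩ ℍ ≠ ∅` as soon as `D' ≠ D`. [folklore] -/
theorem pullbackHull_inter_nonempty {D D' : DobrushinDomain}
    (φ : ConformalEquiv upperHalfPlaneSet D.carrier) {w : ℂ} (hw : w ∈ D.carrier)
    (hw' : w ∉ D'.carrier) : (φ.pullbackHull D' ∩ upperHalfPlaneSet).Nonempty := by
  have hz : φ.symm w ∈ upperHalfPlaneSet := φ.symm_mapsTo hw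
  refine ⟨φ.symm w, subset_closure ⟨hz, ?_⟩, hz⟩
  rintro ⟨-, h⟩
  rw [φ.apply_symm_apply hw] at h
  exact hw' h

/-! ### What the crux forbids eventually: the two lattice kill criteria -/

/-- **The crux forces eventual positivity** of `P_δ(range γ_δ ⊆ closure D')` along every datum
(its limit is `d^{5/8} > 0`). [folklore] -/
theorem avoidanceLimit_eventually_pos (h : AvoidanceLimit) {D D' : DobrushinDomain}
    {a b : ℝ → Site 2} (hab : SAW.IsEndpointApprox D a b) (hsub : D'.carrier ⊆ D.carrier)
    (h0 : D'.pt 0 = D.pt 0) (h1 : D'.pt 1 = D.pt 1)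
    (hball : ∃ ε : ℝ, 0 < ε ∧ D'.carrier ∩ ball (D.pt 0) ε = D.carrier ∩ ball (D.pt 0) ε ∧
      D'.carrier ∩ ball (D.pt 1) ε = D.carrier ∩ ball (D.pt 1) ε)
    {φ : ConformalEquiv upperHalfPlaneSet D.carrier} (hφ : D.IsChordalUniformizing φ)
    {A : Set ℂ} (hA : A = closure (upperHalfPlaneSet \ {z | z ∈ upperHalfPlaneSet ∧ φ z ∈ D'.carrier}))
    {Φ : ConformalEquiv (upperHalfPlaneSet \ A) upperHalfPlaneSet} {d : ℝ}
    (hΦ : IsRestrictionMap A Φ) (hd : HasRestrictionDeriv A Φ d) :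
    ∀ᶠ δ in 𝓝[>] (0 : ℝ), 0 < ((SAW.law D.carrier δ (a δ) (b δ)).map (fun γ ↦ γ.curve))
      (CurveClass.rangeSubset (closure D'.carrier)) := by
  have key := h D D' a b hab hsub h0 h1 hball φ hφ A hA Φ d hΦ hd
  have hd0 : 0 < d := (restrictionDeriv_pos_le_one hsub h0 h1 hball hφ hA hΦ hd).2.1
  exact (tendsto_order.1 key).1 _ (ENNReal.ofReal_pos.2 (Real.rpow_pos_of_pos hd0 _))

/-- **The crux forces the avoidance probability eventually below `1`** as soon as `D' ≠ D`
(its limit is `d^{5/8}` with `d < 1`, `restrictionDeriv_lt_one`). [folklore] -/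
theorem avoidanceLimit_eventually_lt_one (h : AvoidanceLimit) {D D' : DobrushinDomain}
    {a b : ℝ → Site 2} (hab : SAW.IsEndpointApprox D a b) (hsub : D'.carrier ⊆ D.carrier)
    (h0 : D'.pt 0 = D.pt 0) (h1 : D'.pt 1 = D.pt 1)
    (hball : ∃ ε : ℝ, 0 < ε ∧ D'.carrier ∩ ball (D.pt 0) ε = D.carrier ∩ ball (D.pt 0) ε ∧
      D'.carrier ∩ ball (D.pt 1) ε = D.carrier ∩ ball (D.pt 1) ε)
    (hne : (D.carrier \ D'.carrier).Nonempty)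
    {φ : ConformalEquiv upperHalfPlaneSet D.carrier} (hφ : D.IsChordalUniformizing φ)
    {A : Set ℂ} (hA : A = closure (upperHalfPlaneSet \ {z | z ∈ upperHalfPlaneSet ∧ φ z ∈ D'.carrier}))
    {Φ : ConformalEquiv (upperHalfPlaneSet \ A) upperHalfPlaneSet} {d : ℝ}
    (hΦ : IsRestrictionMap A Φ) (hd : HasRestrictionDeriv A Φ d) :
    ∀ᶠ δ in 𝓝[>] (0 : ℝ), ((SAW.law D.carrier δ (a δ) (b δ)).map (fun γ ↦ γ.curve))
      (CurveClass.rangeSubset (closure D'.carrier)) < 1 := by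
  have key := h D D' a b hab hsub h0 h1 hball φ hφ A hA Φ d hΦ hd
  obtain ⟨hstar, hd0, -⟩ := restrictionDeriv_pos_le_one hsub h0 h1 hball hφ hA hΦ hd
  obtain ⟨w, hw, hw'⟩ := hne
  have hAne : (A ∩ upperHalfPlaneSet).Nonempty := by
    subst hA; exact pullbackHull_inter_nonempty φ hw hw'
  have hd1 : d < 1 := restrictionDeriv_lt_one hstar hΦ hd hAne
  refine (tendsto_order.1 key).2 _ ?_
  show ENNReal.ofReal (d ^ ((5 : ℝ) / 8)) < 1
  rw [← ENNReal.ofReal_one, ENNReal.ofReal_lt_ofReal_iff zero_lt_one]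
  exact Real.rpow_lt_one hd0.le hd1 (by norm_num)

/-- **Kill criterion 1 (probability zero).** A refutation of the crux "from below" must exhibit a
Dobrushin domain, a hull subdomain and an endpoint approximation along which, for mesh sizes
accumulating at `0`, NO self-avoiding walk of `Ω_δ` from `a_δ` to `b_δ` stays in `closure D'`
(`P_δ = 0` frequently). By `eventually_map_law_rangeSubset_pos` this never happens when
`(a_δ, b_δ)` is also an endpoint approximation of `D'`; by `isEndpointApprox_of_hull_bigSq` below it
never happens in the reference square. [folklore] -/
theorem not_avoidanceLimit_of_frequently_zero {D D' : DobrushinDomain} {a b : ℝ → Site 2}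
    (hab : SAW.IsEndpointApprox D a b) (hsub : D'.carrier ⊆ D.carrier)
    (h0 : D'.pt 0 = D.pt 0) (h1 : D'.pt 1 = D.pt 1)
    (hball : ∃ ε : ℝ, 0 < ε ∧ D'.carrier ∩ ball (D.pt 0) ε = D.carrier ∩ ball (D.pt 0) ε ∧
      D'.carrier ∩ ball (D.pt 1) ε = D.carrier ∩ ball (D.pt 1) ε)
    (hfreq : ∃ᶠ δ in 𝓝[>] (0 : ℝ), ((SAW.law D.carrier δ (a δ) (b δ)).map (fun γ ↦ γ.curve))
      (CurveClass.rangeSubset (closure D'.carrier)) = 0) :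
    ¬ AvoidanceLimit := by
  intro h
  obtain ⟨φ, hφ⟩ := MarkedDomain.exists_isChordalUniformizing_holds D
  have hstar : IsStarHull (φ.pullbackHull D') :=
    IsStarHull.pullbackHull JordanDomain.isSimplyConnected_holds hφ
      (isHullSubdomain_of_ball hsub h0 h1 hball)
  obtain ⟨Φ, hΦ, -⟩ := IsStarHull.existsUnique_isRestrictionMap_holds hstar
  obtain ⟨d, -, -, hd⟩ := IsStarHull.exists_hasRestrictionDeriv_holds hstar hΦ
  have hev := avoidanceLimit_eventually_pos h hab hsub h0 h1 hball hφ rfl hΦ hd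
  obtain ⟨δ, hpos, hzero⟩ := (hev.and_frequently hfreq).exists
  exact hpos.ne' hzero

/-- **Kill criterion 2 (probability one).** A refutation "from above" must exhibit a hull
subdomain `D' ≠ D` along which, for mesh sizes accumulating at `0`, EVERY self-avoiding walk of
`Ω_δ` from `a_δ` to `b_δ` stays in `closure D'` (`P_δ = 1` frequently) — the non-empty open set
`D ∖ closure D'` must be unusable by SAWs at those meshes. [folklore] -/
theorem not_avoidanceLimit_of_frequently_one {D D' : DobrushinDomain} {a b : ℝ → Site 2}
    (hab : SAW.IsEndpointApprox D a b) (hsub : D'.carrier ⊆ D.carrier)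
    (h0 : D'.pt 0 = D.pt 0) (h1 : D'.pt 1 = D.pt 1)
    (hball : ∃ ε : ℝ, 0 < ε ∧ D'.carrier ∩ ball (D.pt 0) ε = D.carrier ∩ ball (D.pt 0) ε ∧
      D'.carrier ∩ ball (D.pt 1) ε = D.carrier ∩ ball (D.pt 1) ε)
    (hne : (D.carrier \ D'.carrier).Nonempty)
    (hfreq : ∃ᶠ δ in 𝓝[>] (0 : ℝ), ((SAW.law D.carrier δ (a δ) (b δ)).map (fun γ ↦ γ.curve))
      (CurveClass.rangeSubset (closure D'.carrier)) = 1) :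
    ¬ AvoidanceLimit := by
  intro h
  obtain ⟨φ, hφ⟩ := MarkedDomain.exists_isChordalUniformizing_holds D
  have hstar : IsStarHull (φ.pullbackHull D') :=
    IsStarHull.pullbackHull JordanDomain.isSimplyConnected_holds hφ
      (isHullSubdomain_of_ball hsub h0 h1 hball)
  obtain ⟨Φ, hΦ, -⟩ := IsStarHull.existsUnique_isRestrictionMap_holds hstar
  obtain ⟨d, -, -, hd⟩ := IsStarHull.exists_hasRestrictionDeriv_holds hstar hΦ
  have hev := avoidanceLimit_eventually_lt_one h hab hsub h0 h1 hball hne hφ rfl hΦ hd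
  obtain ⟨δ, hlt, hone⟩ := (hev.and_frequently hfreq).exists
  exact hlt.ne hone


/-! ### Lattice staircases inside a cap

A monotone lattice staircase (first vertically towards the real axis, then along it) joins any two
mesh points of a set `W` that is stable under vertical shrinking towards the axis and is an interval
on the axis; all intermediate closed edges stay in `W`. Used with the two caps
`D ∩ B(±2, ε) = {|z ∓ 2| < ε, ∓(Re z) > -2}` of the reference square `bigSq`. -/

section Staircase

variable {Ω W : Set ℂ} {δ : ℝ}

/-- Squared distance in `ℂ` in coordinates. [folklore] -/
theorem dist_sq_re_im (z w : ℂ) : dist z w ^ 2 = (z.re - w.re) ^ 2 + (z.im - w.im) ^ 2 := by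
  rw [Complex.dist_eq, Complex.sq_norm, Complex.normSq_apply, Complex.sub_re, Complex.sub_im]
  ring

/-- A vertical segment shrinking towards the axis stays in `W`. [folklore] -/
theorem segment_subset_of_vert
    (hvert : ∀ z ∈ W, ∀ w : ℂ, w.re = z.re → |w.im| ≤ |z.im| → w ∈ W)
    {p q : ℂ} (hp : p ∈ W) (hre : q.re = p.re) (him : |q.im| ≤ |p.im|) : segment ℝ p q ⊆ W := by
  rintro w ⟨s, t, hs, ht, hst, rfl⟩
  refine hvert p hp _ ?_ ?_
  · simp only [Complex.add_re, Complex.smul_re, smul_eq_mul, hre]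
    rw [← add_mul, hst, one_mul]
  · simp only [Complex.add_im, Complex.smul_im, smul_eq_mul]
    calc |s * p.im + t * q.im| ≤ |s * p.im| + |t * q.im| := abs_add_le _ _
      _ = s * |p.im| + t * |q.im| := by rw [abs_mul, abs_mul, abs_of_nonneg hs, abs_of_nonneg ht]
      _ ≤ s * |p.im| + t * |p.im| := by gcongr
      _ = |p.im| := by rw [← add_mul, hst, one_mul]

/-- A segment of the axis between two points of `W` stays in `W`. [folklore] -/
theorem segment_subset_of_hor
    (hhor : ∀ z₁ ∈ W, ∀ z₂ ∈ W, z₁.im = 0 → z₂.im = 0 →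
      ∀ w : ℂ, w.im = 0 → z₁.re ≤ w.re → w.re ≤ z₂.re → w ∈ W)
    {p q : ℂ} (hp : p ∈ W) (hq : q ∈ W) (hp0 : p.im = 0) (hq0 : q.im = 0) (hle : p.re ≤ q.re) :
    segment ℝ p q ⊆ W := by
  rintro w ⟨s, t, hs, ht, hst, rfl⟩
  have h1 := mul_le_mul_of_nonneg_left hle ht
  have h2 := mul_le_mul_of_nonneg_left hle hs
  obtain rfl : s = 1 - t := by linarith
  refine hhor p hp q hq hp0 hq0 _ ?_ ?_ ?_
  · simp [Complex.add_im, hp0, hq0]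
  · simp only [Complex.add_re, Complex.smul_re, smul_eq_mul]
    linarith
  · simp only [Complex.add_re, Complex.smul_re, smul_eq_mul]
    linarith

/-- One closed lattice edge inside `W ⊆ Ω` is an edge of the mesh graph on mesh vertices. [folklore] -/
theorem meshVertexGraph_adj_of (hWΩ : W ⊆ Ω) {x y : Site 2} (hx : meshPoint δ x ∈ W)
    (hy : meshPoint δ y ∈ W) (hzd : (zdGraph 2).Adj x y)
    (hseg : segment ℝ (meshPoint δ x) (meshPoint δ y) ⊆ W) :
    (meshVertexGraph Ω δ).Adj ⟨x, hWΩ hx⟩ ⟨y, hWΩ hy⟩ := by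
  simp only [SimpleGraph.comap_adj, Function.Embedding.subtype_apply]
  exact meshGraph_adj_iff.2 ⟨hzd, (hseg.trans hWΩ).trans subset_closure⟩

/-- **Vertical leg**: from a mesh point of `W` straight to the axis, inside `W`. [folklore] -/
theorem stair_vert (hWΩ : W ⊆ Ω) (hδ : 0 < δ)
    (hvert : ∀ z ∈ W, ∀ w : ℂ, w.re = z.re → |w.im| ≤ |z.im| → w ∈ W) :
    ∀ (n : ℕ) (c : ℤ) (x : Site 2), x 0 = c → (x 1).natAbs = n → meshPoint δ x ∈ W →
      ∃ (hx : x ∈ meshVertices Ω δ) (hy : (![c, 0] : Site 2) ∈ meshVertices Ω δ),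
        (meshVertexGraph Ω δ).Reachable ⟨x, hx⟩ ⟨![c, 0], hy⟩ := by
  intro n
  induction n with
  | zero =>
    intro c x hc hn hxW
    have h1 : x 1 = 0 := Int.natAbs_eq_zero.1 hn
    have heq : (![c, 0] : Site 2) = x := by
      funext i; fin_cases i
      · simp [hc]
      · simp [h1]
    refine ⟨hWΩ hxW, heq ▸ hWΩ hxW, ?_⟩
    have : (⟨![c, 0], heq ▸ hWΩ hxW⟩ : meshVertices Ω δ) = ⟨x, hWΩ hxW⟩ := Subtype.ext heq
    rw [this]
  | succ n ih =>
    intro c x hc hn hxW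
    have hx1 : x 1 ≠ 0 := by
      intro h; rw [h] at hn; simp at hn
    -- the next site towards the axis
    obtain hneg | hpos := lt_or_gt_of_ne hx1
    · set x' : Site 2 := x + Pi.single 1 1 with hx'def
      have hx'0 : x' 0 = c := by simp [hx'def, hc]
      have hx'1 : x' 1 = x 1 + 1 := by simp [hx'def]
      have hn' : (x' 1).natAbs = n := by omega
      have hre : (meshPoint δ x').re = (meshPoint δ x).re := by simp [meshPoint_re, hx'0, hc]
      have him : |(meshPoint δ x').im| ≤ |(meshPoint δ x).im| := by
        rw [meshPoint_im, meshPoint_im, hx'1, abs_mul, abs_mul, abs_of_pos hδ]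
        push_cast
        have hle : ((x 1 : ℤ) : ℝ) ≤ -1 := by exact_mod_cast (show x 1 ≤ -1 by omega)
        have h1 : |((x 1 : ℤ) : ℝ) + 1| ≤ |((x 1 : ℤ) : ℝ)| := by
          rw [abs_of_nonpos (by linarith), abs_of_nonpos (by linarith)]; linarith
        exact mul_le_mul_of_nonneg_left h1 hδ.le
      have hx'W : meshPoint δ x' ∈ W := hvert _ hxW _ hre him
      have hadj : (meshVertexGraph Ω δ).Adj ⟨x, hWΩ hxW⟩ ⟨x', hWΩ hx'W⟩ :=
        meshVertexGraph_adj_of hWΩ hxW hx'W ((zdGraph_adj_iff _ _).2 ⟨1, Or.inl rfl⟩)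
          (segment_subset_of_vert hvert hxW hre him)
      obtain ⟨_, hy, hreach⟩ := ih c x' hx'0 hn' hx'W
      exact ⟨hWΩ hxW, hy, hadj.reachable.trans hreach⟩
    · set x' : Site 2 := x - Pi.single 1 1 with hx'def
      have hx'0 : x' 0 = c := by simp [hx'def, hc]
      have hx'1 : x' 1 = x 1 - 1 := by simp [hx'def]
      have hn' : (x' 1).natAbs = n := by omega
      have hre : (meshPoint δ x').re = (meshPoint δ x).re := by simp [meshPoint_re, hx'0, hc]
      have him : |(meshPoint δ x').im| ≤ |(meshPoint δ x).im| := by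
        rw [meshPoint_im, meshPoint_im, hx'1, abs_mul, abs_mul, abs_of_pos hδ]
        push_cast
        have hle : (1 : ℝ) ≤ ((x 1 : ℤ) : ℝ) := by exact_mod_cast (show 1 ≤ x 1 by omega)
        have h1 : |((x 1 : ℤ) : ℝ) - 1| ≤ |((x 1 : ℤ) : ℝ)| := by
          rw [abs_of_nonneg (by linarith), abs_of_nonneg (by linarith)]; linarith
        exact mul_le_mul_of_nonneg_left h1 hδ.le
      have hx'W : meshPoint δ x' ∈ W := hvert _ hxW _ hre him
      have hadj : (meshVertexGraph Ω δ).Adj ⟨x, hWΩ hxW⟩ ⟨x', hWΩ hx'W⟩ :=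
        meshVertexGraph_adj_of hWΩ hxW hx'W
          ((zdGraph_adj_iff _ _).2 ⟨1, Or.inr (by simp [hx'def])⟩)
          (segment_subset_of_vert hvert hxW hre him)
      obtain ⟨_, hy, hreach⟩ := ih c x' hx'0 hn' hx'W
      exact ⟨hWΩ hxW, hy, hadj.reachable.trans hreach⟩

/-- **Horizontal leg**: along the axis between two mesh points of `W`, inside `W`. [folklore] -/
theorem stair_hor (hWΩ : W ⊆ Ω) (hδ : 0 < δ)
    (hhor : ∀ z₁ ∈ W, ∀ z₂ ∈ W, z₁.im = 0 → z₂.im = 0 →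
      ∀ w : ℂ, w.im = 0 → z₁.re ≤ w.re → w.re ≤ z₂.re → w ∈ W) :
    ∀ (n : ℕ) (i j : ℤ), i ≤ j → (j - i).toNat = n →
      meshPoint δ ![i, 0] ∈ W → meshPoint δ ![j, 0] ∈ W →
      ∃ (hx : (![i, 0] : Site 2) ∈ meshVertices Ω δ) (hy : (![j, 0] : Site 2) ∈ meshVertices Ω δ),
        (meshVertexGraph Ω δ).Reachable ⟨![i, 0], hx⟩ ⟨![j, 0], hy⟩ := by
  intro n
  induction n with
  | zero =>
    intro i j hij hn hiW hjW
    have : j = i := by omega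
    subst this
    exact ⟨hWΩ hiW, hWΩ hjW, SimpleGraph.Reachable.refl _⟩
  | succ n ih =>
    intro i j hij hn hiW hjW
    have hlt : i + 1 ≤ j := by omega
    have hn' : (j - (i + 1)).toNat = n := by omega
    have him0 : ∀ k : ℤ, (meshPoint δ ![k, 0]).im = 0 := fun k ↦ by simp [meshPoint_im]
    have hre : ∀ k : ℤ, (meshPoint δ ![k, 0]).re = δ * k := fun k ↦ by simp [meshPoint_re]
    have hi'W : meshPoint δ ![i + 1, 0] ∈ W := by
      refine hhor _ hiW _ hjW (him0 i) (him0 j) _ (him0 _) ?_ ?_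
      · rw [hre, hre]; push_cast; nlinarith
      · rw [hre, hre]
        have : ((i + 1 : ℤ) : ℝ) ≤ j := by exact_mod_cast hlt
        nlinarith
    have hzd : (zdGraph 2).Adj (![i, 0] : Site 2) ![i + 1, 0] := by
      refine (zdGraph_adj_iff _ _).2 ⟨0, Or.inl ?_⟩
      funext k; fin_cases k <;> simp
    have hseg : segment ℝ (meshPoint δ ![i, 0]) (meshPoint δ ![i + 1, 0]) ⊆ W :=
      segment_subset_of_hor hhor hiW hi'W (him0 i) (him0 _)
        (by rw [hre, hre]; push_cast; nlinarith)
    have hadj := meshVertexGraph_adj_of hWΩ hiW hi'W hzd hseg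
    obtain ⟨_, hy, hreach⟩ := ih (i + 1) j hlt hn' hi'W hjW
    exact ⟨hWΩ hiW, hy, hadj.reachable.trans hreach⟩

/-- **The staircase**: any two mesh points of `W` are joined in the mesh graph of `Ω ⊇ W` on mesh
vertices, through `W`. [folklore] -/
theorem stair (hWΩ : W ⊆ Ω) (hδ : 0 < δ)
    (hvert : ∀ z ∈ W, ∀ w : ℂ, w.re = z.re → |w.im| ≤ |z.im| → w ∈ W)
    (hhor : ∀ z₁ ∈ W, ∀ z₂ ∈ W, z₁.im = 0 → z₂.im = 0 →
      ∀ w : ℂ, w.im = 0 → z₁.re ≤ w.re → w.re ≤ z₂.re → w ∈ W)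
    {x y : Site 2} (hx : meshPoint δ x ∈ W) (hy : meshPoint δ y ∈ W) :
    ∃ (hx' : x ∈ meshVertices Ω δ) (hy' : y ∈ meshVertices Ω δ),
      (meshVertexGraph Ω δ).Reachable ⟨x, hx'⟩ ⟨y, hy'⟩ := by
  have hfoot : ∀ z : Site 2, meshPoint δ z ∈ W → meshPoint δ ![z 0, 0] ∈ W := fun z hz ↦
    hvert _ hz _ (by simp [meshPoint_re]) (by simp [meshPoint_im]; positivity)
  obtain ⟨_, hx0, hX⟩ := stair_vert hWΩ hδ hvert _ (x 0) x rfl rfl hx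
  obtain ⟨_, hy0, hY⟩ := stair_vert hWΩ hδ hvert _ (y 0) y rfl rfl hy
  rcases le_total (x 0) (y 0) with hle | hle
  · obtain ⟨_, _, hH⟩ := stair_hor hWΩ hδ hhor _ (x 0) (y 0) hle rfl (hfoot x hx) (hfoot y hy)
    exact ⟨hWΩ hx, hWΩ hy, (hX.trans hH).trans hY.symm⟩
  · obtain ⟨_, _, hH⟩ := stair_hor hWΩ hδ hhor _ (y 0) (x 0) hle rfl (hfoot y hy) (hfoot x hx)
    exact ⟨hWΩ hx, hWΩ hy, (hX.trans hH.symm).trans hY.symm⟩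

end Staircase


/-! ### The endpoint transfer for domains with axis caps at the marked points -/

section Transfer

/-- The mesh point of the lattice site `(round (c/δ), 0)` is within `δ/2` of the real point `c`.
[folklore] -/
theorem dist_meshPoint_round_le {δ : ℝ} (hδ : 0 < δ) (c : ℝ) :
    dist (meshPoint δ ![round (c / δ), 0]) (c : ℂ) ≤ δ / 2 := by
  have hre : (meshPoint δ ![round (c / δ), 0]).re = δ * round (c / δ) := by simp [meshPoint_re]
  have him : (meshPoint δ ![round (c / δ), 0]).im = 0 := by simp [meshPoint_im]
  have key : |δ * round (c / δ) - c| ≤ δ / 2 := by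
    have h := abs_sub_round (c / δ)
    have : δ * round (c / δ) - c = -(δ * (c / δ - round (c / δ))) := by field_simp; ring
    rw [this, abs_neg, abs_mul, abs_of_pos hδ]
    calc δ * |c / δ - round (c / δ)| ≤ δ * (1 / 2) := by gcongr
      _ = δ / 2 := by ring
  have h2 : dist (meshPoint δ ![round (c / δ), 0]) (c : ℂ) ^ 2 ≤ (δ / 2) ^ 2 := by
    rw [dist_sq_re_im, hre, him]
    simp only [Complex.ofReal_re, Complex.ofReal_im, sub_zero]
    nlinarith [sq_abs (δ * round (c / δ) - c), abs_nonneg (δ * round (c / δ) - c)]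
  exact le_of_pow_le_pow_left₀ two_ne_zero (by positivity) h2

/-- Vertical stability towards the real axis passes to the intersection with a ball about a real
point (the distance to a real point decreases with `|Im|` at fixed `Re`). [folklore] -/
theorem vertStable_inter_ball {W : Set ℂ} {p : ℂ} (hp : p.im = 0) (ε : ℝ)
    (hW : ∀ z ∈ W, ∀ w : ℂ, w.re = z.re → |w.im| ≤ |z.im| → w ∈ W) :
    ∀ z ∈ W ∩ ball p ε, ∀ w : ℂ, w.re = z.re → |w.im| ≤ |z.im| → w ∈ W ∩ ball p ε := by
  rintro z ⟨hzW, hzb⟩ w hre him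
  refine ⟨hW z hzW w hre him, ?_⟩
  rw [mem_ball] at hzb ⊢
  have hz2 := pow_lt_pow_left₀ hzb dist_nonneg two_ne_zero
  refine lt_of_pow_lt_pow_left₀ 2 (le_of_lt (lt_of_le_of_lt dist_nonneg hzb)) ?_
  rw [dist_sq_re_im] at hz2 ⊢
  rw [hre, hp] at *
  nlinarith [sq_abs w.im, sq_abs z.im, abs_nonneg w.im,
    mul_le_mul him him (abs_nonneg _) (abs_nonneg _)]

/-- The interval property on the axis passes to the intersection with a ball about a real point.
[folklore] -/
theorem axisInterval_inter_ball {W : Set ℂ} {p : ℂ} (hp : p.im = 0) (ε : ℝ)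
    (hW : ∀ z₁ ∈ W, ∀ z₂ ∈ W, z₁.im = 0 → z₂.im = 0 →
      ∀ w : ℂ, w.im = 0 → z₁.re ≤ w.re → w.re ≤ z₂.re → w ∈ W) :
    ∀ z₁ ∈ W ∩ ball p ε, ∀ z₂ ∈ W ∩ ball p ε, z₁.im = 0 → z₂.im = 0 →
      ∀ w : ℂ, w.im = 0 → z₁.re ≤ w.re → w.re ≤ z₂.re → w ∈ W ∩ ball p ε := by
  rintro z₁ ⟨h₁W, h₁b⟩ z₂ ⟨h₂W, h₂b⟩ h₁ h₂ w hw hle₁ hle₂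
  refine ⟨hW z₁ h₁W z₂ h₂W h₁ h₂ w hw hle₁ hle₂, ?_⟩
  rw [mem_ball] at h₁b h₂b ⊢
  have hε : 0 < ε := lt_of_le_of_lt dist_nonneg h₁b
  have e₁ := pow_lt_pow_left₀ h₁b dist_nonneg two_ne_zero
  have e₂ := pow_lt_pow_left₀ h₂b dist_nonneg two_ne_zero
  refine lt_of_pow_lt_pow_left₀ 2 hε.le ?_
  rw [dist_sq_re_im] at e₁ e₂ ⊢
  rw [hw, h₁, h₂, hp] at *
  -- `(w.re - p.re)^2 ≤ max ((z₁.re - p.re)^2) ((z₂.re - p.re)^2)` since `w.re ∈ [z₁.re, z₂.re]`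
  by_cases hwp : w.re ≤ p.re
  · nlinarith
  · push Not at hwp
    nlinarith

/-- **ENDPOINT TRANSFER for domains with axis caps.** Let `(D; a, b)` have both marked points on
the real axis, near each of which `D` is stable under vertical shrinking towards the axis and meets
the axis in an interval accumulating at the marked point (true for rectangles marked at midpoints of
vertical sides, discs and ellipses marked at the ends of the horizontal axis, stadiums, …). Then every
endpoint approximation of `D` is one of each Dobrushin `D'` with the same marked points agreeing with
`D` in balls around them (the crux's inline hull hypotheses; `D' ⊆ D` is not needed): for small `δ`,
`a_δ` and `b_δ` lie in the largest mesh component `Ω'_δ` of `D'` and are joined there. Proof: lattice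
staircases (`stair`) inside the caps `D ∩ B(pt i, ε) ⊆ D'` bring `a_δ`, `b_δ` next to axis points
`cᵢ ∈ D` near the marked points, inside a fixed compact `K ⊆ D'` (two closed discs about `c₀, c₁`),
and the tree's theorem "the largest mesh component of a Jordan domain is the bulk"
(`JordanDomain.exists_forall_mem_meshDomain_and_reachable`) puts those sites in `Ω'_δ` and joins
them. [folklore] -/
theorem isEndpointApprox_of_hull_of_axisCaps {D D' : DobrushinDomain} {a b : ℝ → Site 2}
    (hab : SAW.IsEndpointApprox D a b) (h0 : D'.pt 0 = D.pt 0) (h1 : D'.pt 1 = D.pt 1)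
    (hball : ∃ ε : ℝ, 0 < ε ∧ D'.carrier ∩ ball (D.pt 0) ε = D.carrier ∩ ball (D.pt 0) ε ∧
      D'.carrier ∩ ball (D.pt 1) ε = D.carrier ∩ ball (D.pt 1) ε)
    (hreal : ∀ i : Fin 2, (D.pt i).im = 0)
    (hvert : ∃ ε₀ : ℝ, 0 < ε₀ ∧ ∀ i : Fin 2, ∀ z ∈ D.carrier ∩ ball (D.pt i) ε₀, ∀ w : ℂ,
      w.re = z.re → |w.im| ≤ |z.im| → w ∈ D.carrier ∩ ball (D.pt i) ε₀)
    (hhor : ∃ ε₀ : ℝ, 0 < ε₀ ∧ ∀ i : Fin 2, ∀ z₁ ∈ D.carrier ∩ ball (D.pt i) ε₀,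
      ∀ z₂ ∈ D.carrier ∩ ball (D.pt i) ε₀, z₁.im = 0 → z₂.im = 0 →
      ∀ w : ℂ, w.im = 0 → z₁.re ≤ w.re → w.re ≤ z₂.re → w ∈ D.carrier ∩ ball (D.pt i) ε₀)
    (haxis : ∀ i : Fin 2, ∀ ε : ℝ, 0 < ε → ∃ x : ℝ, (x : ℂ) ∈ D.carrier ∧ dist (x : ℂ) (D.pt i) < ε) :
    SAW.IsEndpointApprox D' a b := by
  obtain ⟨εb, hεb, hb0, hb1⟩ := hball
  obtain ⟨εv, hεv, hv⟩ := hvert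
  obtain ⟨εh, hεh, hh⟩ := hhor
  -- one radius for everything
  set ε : ℝ := min εb (min εv εh) with hεdef
  have hε : 0 < ε := lt_min hεb (lt_min hεv hεh)
  have hεb' : ε ≤ εb := min_le_left _ _
  have hεv' : ε ≤ εv := (min_le_right _ _).trans (min_le_left _ _)
  have hεh' : ε ≤ εh := (min_le_right _ _).trans (min_le_right _ _)
  have hagree : ∀ i : Fin 2, D'.carrier ∩ ball (D.pt i) εb = D.carrier ∩ ball (D.pt i) εb := by
    intro i; fin_cases i
    · exact hb0
    · exact hb1
  -- the caps `W i = D ∩ B(pt i, ε)`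
  set W : Fin 2 → Set ℂ := fun i ↦ D.carrier ∩ ball (D.pt i) ε with hWdef
  have hWD' : ∀ i, W i ⊆ D'.carrier := by
    rintro i z ⟨hzD, hzb⟩
    have : z ∈ D'.carrier ∩ ball (D.pt i) εb := by
      rw [hagree i]; exact ⟨hzD, ball_subset_ball hεb' hzb⟩
    exact this.1
  have hWv : ∀ i, ∀ z ∈ W i, ∀ w : ℂ, w.re = z.re → |w.im| ≤ |z.im| → w ∈ W i := by
    intro i
    have hsub : W i = (D.carrier ∩ ball (D.pt i) εv) ∩ ball (D.pt i) ε := by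
      rw [hWdef, inter_assoc, inter_eq_right.2 (ball_subset_ball hεv')]
    rw [hsub]
    exact vertStable_inter_ball (hreal i) ε (hv i)
  have hWh : ∀ i, ∀ z₁ ∈ W i, ∀ z₂ ∈ W i, z₁.im = 0 → z₂.im = 0 →
      ∀ w : ℂ, w.im = 0 → z₁.re ≤ w.re → w.re ≤ z₂.re → w ∈ W i := by
    intro i
    have hsub : W i = (D.carrier ∩ ball (D.pt i) εh) ∩ ball (D.pt i) ε := by
      rw [hWdef, inter_assoc, inter_eq_right.2 (ball_subset_ball hεh')]
    rw [hsub]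
    exact axisInterval_inter_ball (hreal i) ε (hh i)
  -- axis points `c i ∈ D` near the marked points, with closed discs inside the caps
  have hc : ∀ i : Fin 2, ∃ c : ℝ, ∃ ρ : ℝ, 0 < ρ ∧ closedBall (c : ℂ) ρ ⊆ W i := by
    intro i
    obtain ⟨c, hcD, hcd⟩ := haxis i (ε / 2) (half_pos hε)
    obtain ⟨r, hr, hrD⟩ := Metric.isOpen_iff.1 D.isOpen (c : ℂ) hcD
    refine ⟨c, min (r / 2) (ε / 4), lt_min (half_pos hr) (by positivity), fun z hz ↦ ⟨?_, ?_⟩⟩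
    · exact hrD (mem_ball.2 (lt_of_le_of_lt (mem_closedBall.1 hz)
        (lt_of_le_of_lt (min_le_left _ _) (half_lt_self hr))))
    · rw [mem_ball]
      calc dist z (D.pt i) ≤ dist z (c : ℂ) + dist (c : ℂ) (D.pt i) := dist_triangle _ _ _
        _ < ε / 4 + ε / 2 := add_lt_add_of_le_of_lt
            ((mem_closedBall.1 hz).trans (min_le_right _ _)) hcd
        _ < ε := by linarith
  choose c ρ hρ hcW using hc
  set K : Set ℂ := closedBall (c 0 : ℂ) (ρ 0) ∪ closedBall (c 1 : ℂ) (ρ 1) with hKdef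
  have hKc : IsCompact K := (isCompact_closedBall _ _).union (isCompact_closedBall _ _)
  have hKD' : K ⊆ D'.carrier := union_subset ((hcW 0).trans (hWD' 0)) ((hcW 1).trans (hWD' 1))
  obtain ⟨δ₀, hδ₀, hgood⟩ :=
    D'.toJordanDomain.exists_forall_mem_meshDomain_and_reachable hKc hKD'
  refine ⟨?_, by rw [h0]; exact hab.tendsto_fst, by rw [h1]; exact hab.tendsto_snd⟩
  have hA : ∀ᶠ δ in 𝓝[>] (0 : ℝ), meshPoint δ (a δ) ∈ ball (D.pt 0) ε :=
    hab.tendsto_fst (ball_mem_nhds _ hε)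
  have hB : ∀ᶠ δ in 𝓝[>] (0 : ℝ), meshPoint δ (b δ) ∈ ball (D.pt 1) ε :=
    hab.tendsto_snd (ball_mem_nhds _ hε)
  have hρ01 : 0 < min (ρ 0) (ρ 1) := lt_min (hρ 0) (hρ 1)
  filter_upwards [hab.reachable, hA, hB, Ioo_mem_nhdsGT (lt_min hδ₀ hρ01)] with δ hr ha hb hδ
  obtain ⟨hδpos, hδlt⟩ := hδ
  have hδ₀' : δ < δ₀ := hδlt.trans_le (min_le_left _ _)
  have hδρ : ∀ i, δ < ρ i := by
    intro i; fin_cases i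
    · exact hδlt.trans_le ((min_le_right _ _).trans (min_le_left _ _))
    · exact hδlt.trans_le ((min_le_right _ _).trans (min_le_right _ _))
  by_cases heq : a δ = b δ
  · rw [heq]
  -- the endpoints are vertices of `Ω_δ`, so their mesh points lie in `D`, hence in the caps
  have haD : a δ ∈ meshDomain D.carrier δ := mem_meshDomain_of_reachable_ne hr heq
  have hbD : b δ ∈ meshDomain D.carrier δ := mem_meshDomain_of_reachable_ne hr.symm (Ne.symm heq)
  have haW : meshPoint δ (a δ) ∈ W 0 := ⟨meshDomain_subset_meshVertices _ _ haD, ha⟩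
  have hbW : meshPoint δ (b δ) ∈ W 1 := ⟨meshDomain_subset_meshVertices _ _ hbD, hb⟩
  -- the anchor sites next to `c i`
  set k : Fin 2 → Site 2 := fun i ↦ ![round (c i / δ), 0] with hkdef
  have hkd : ∀ i, dist (meshPoint δ (k i)) (c i : ℂ) ≤ δ / 2 := fun i ↦
    dist_meshPoint_round_le hδpos (c i)
  have hkball : ∀ i, meshPoint δ (k i) ∈ closedBall (c i : ℂ) (ρ i) := fun i ↦
    mem_closedBall.2 ((hkd i).trans (by linarith [hδρ i]))
  have hkK : ∀ i, meshPoint δ (k i) ∈ K := by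
    intro i; fin_cases i
    · exact Or.inl (hkball 0)
    · exact Or.inr (hkball 1)
  have hkW : ∀ i, meshPoint δ (k i) ∈ W i := fun i ↦ hcW i (hkball i)
  obtain ⟨hin, hconn⟩ := hgood δ hδpos hδ₀'
  have hkdom : ∀ i, k i ∈ meshDomain D'.carrier δ := fun i ↦ hin (k i) (hkK i)
  -- staircases inside the caps, then the bulk theorem
  obtain ⟨_, _, hreach0⟩ := stair (hWD' 0) hδpos (hWv 0) (hWh 0) haW (hkW 0)
  obtain ⟨_, _, hreach1⟩ := stair (hWD' 1) hδpos (hWv 1) (hWh 1) hbW (hkW 1)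
  obtain ⟨p0⟩ := hreach0.symm
  obtain ⟨p1⟩ := hreach1.symm
  have h1' : (discreteDomainGraph D'.carrier δ).Reachable (k 0) (a δ) :=
    reachable_discreteDomainGraph_of_walk p0 (hkdom 0)
  have h2' : (discreteDomainGraph D'.carrier δ).Reachable (k 1) (b δ) :=
    reachable_discreteDomainGraph_of_walk p1 (hkdom 1)
  obtain ⟨_, _, ⟨pK⟩⟩ := hconn (k 0) (hkdom 0) (k 1) (hkdom 1)
  have h3' : (discreteDomainGraph D'.carrier δ).Reachable (k 0) (k 1) :=
    reachable_discreteDomainGraph_of_walk pK (hkdom 0)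
  exact h1'.symm.trans (h3'.trans h2')

/-! ### The reference square has axis caps -/

/-- The marked points `±2` of `bigSq` are real. [folklore] -/
theorem bigSq_pt_im (i : Fin 2) : (bigSq.pt i).im = 0 := by
  fin_cases i
  · simp [bigSq_pt_zero]
  · simp [bigSq_pt_one]

/-- The marked points `±2` of `bigSq` have real part `±2`. [folklore] -/
theorem bigSq_pt_re_abs (i : Fin 2) : |(bigSq.pt i).re| = 2 := by
  fin_cases i
  · simp [bigSq_pt_zero]
  · simp [bigSq_pt_one]

/-- The square near its marked points is stable under vertical shrinking towards the axis.
[folklore] -/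
theorem bigSq_vertStable (i : Fin 2) :
    ∀ z ∈ bigSq.carrier ∩ ball (bigSq.pt i) 1, ∀ w : ℂ, w.re = z.re → |w.im| ≤ |z.im| →
      w ∈ bigSq.carrier ∩ ball (bigSq.pt i) 1 := by
  refine vertStable_inter_ball (bigSq_pt_im i) 1 ?_
  rintro z hz w hre him
  rw [bigSq_carrier, mem_symRect] at hz ⊢
  rw [abs_le] at him
  obtain ⟨⟨h1, h2⟩, h3, h4⟩ := hz
  refine ⟨⟨by rw [hre]; exact h1, by rw [hre]; exact h2⟩, ?_, ?_⟩
  · rcases le_or_gt 0 z.im with hz0 | hz0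
    · rw [abs_of_nonneg hz0] at him; linarith
    · rw [abs_of_neg hz0] at him; linarith
  · rcases le_or_gt 0 z.im with hz0 | hz0
    · rw [abs_of_nonneg hz0] at him; linarith
    · rw [abs_of_neg hz0] at him; linarith

/-- The square near its marked points meets the axis in an interval. [folklore] -/
theorem bigSq_axisInterval (i : Fin 2) :
    ∀ z₁ ∈ bigSq.carrier ∩ ball (bigSq.pt i) 1, ∀ z₂ ∈ bigSq.carrier ∩ ball (bigSq.pt i) 1,
      z₁.im = 0 → z₂.im = 0 → ∀ w : ℂ, w.im = 0 → z₁.re ≤ w.re → w.re ≤ z₂.re →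
      w ∈ bigSq.carrier ∩ ball (bigSq.pt i) 1 := by
  refine axisInterval_inter_ball (bigSq_pt_im i) 1 ?_
  rintro z₁ hz₁ z₂ hz₂ - - w hw hle₁ hle₂
  rw [bigSq_carrier, mem_symRect] at hz₁ hz₂ ⊢
  refine ⟨⟨by linarith [hz₁.1.1], by linarith [hz₂.1.2]⟩, by rw [hw]; norm_num, by rw [hw]; norm_num⟩

/-- Axis points of the square accumulate at its marked points. [folklore] -/
theorem bigSq_axis (i : Fin 2) (ε : ℝ) (hε : 0 < ε) :
    ∃ x : ℝ, (x : ℂ) ∈ bigSq.carrier ∧ dist (x : ℂ) (bigSq.pt i) < ε := by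
  set t : ℝ := min ε 1 / 2 with ht
  have ht0 : 0 < t := by positivity
  have ht1 : t ≤ 1 / 2 := by
    have := min_le_right ε 1; rw [ht]; linarith
  have htε : t < ε := by
    have := min_le_left ε 1; rw [ht]; linarith
  fin_cases i
  · refine ⟨2 - t, ?_, ?_⟩
    · rw [bigSq_carrier, mem_symRect]
      simp only [Complex.ofReal_re, Complex.ofReal_im]
      exact ⟨⟨by linarith, by linarith⟩, by norm_num, by norm_num⟩
    · show dist ((2 - t : ℝ) : ℂ) (bigSq.pt 0) < ε
      rw [bigSq_pt_zero, Complex.dist_eq]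
      have : ((2 - t : ℝ) : ℂ) - 2 = ((-t : ℝ) : ℂ) := by push_cast; ring
      rw [this, Complex.norm_real, Real.norm_eq_abs, abs_neg, abs_of_pos ht0]
      exact htε
  · refine ⟨-2 + t, ?_, ?_⟩
    · rw [bigSq_carrier, mem_symRect]
      simp only [Complex.ofReal_re, Complex.ofReal_im]
      exact ⟨⟨by linarith, by linarith⟩, by norm_num, by norm_num⟩
    · show dist ((-2 + t : ℝ) : ℂ) (bigSq.pt 1) < ε
      rw [bigSq_pt_one, Complex.dist_eq]
      have : ((-2 + t : ℝ) : ℂ) - (-2) = ((t : ℝ) : ℂ) := by push_cast; ring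
      rw [this, Complex.norm_real, Real.norm_eq_abs, abs_of_pos ht0]
      exact htε

/-- **Endpoint transfer in the reference square**: every endpoint approximation of `(bigSq; 2, -2)`
is one of each Dobrushin `D'` with the same marked points agreeing with `bigSq` in balls around `±2`.
So the double hypothesis `IsEndpointApprox D a b ∧ IsEndpointApprox D' a b` of the route's
`IsingBoundaryRatio` is redundant for `D = bigSq`, and corner-germ's `stub_cornerIdentification`
gets its first clause for free there. [folklore] -/
theorem isEndpointApprox_of_hull_bigSq {D' : DobrushinDomain} {a b : ℝ → Site 2}
    (hab : SAW.IsEndpointApprox bigSq a b)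
    (h0 : D'.pt 0 = bigSq.pt 0) (h1 : D'.pt 1 = bigSq.pt 1)
    (hball : ∃ ε : ℝ, 0 < ε ∧
      D'.carrier ∩ ball (bigSq.pt 0) ε = bigSq.carrier ∩ ball (bigSq.pt 0) ε ∧
      D'.carrier ∩ ball (bigSq.pt 1) ε = bigSq.carrier ∩ ball (bigSq.pt 1) ε) :
    SAW.IsEndpointApprox D' a b :=
  isEndpointApprox_of_hull_of_axisCaps hab h0 h1 hball bigSq_pt_im ⟨1, one_pos, bigSq_vertStable⟩
    ⟨1, one_pos, bigSq_axisInterval⟩ bigSq_axis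

/-- **No probability-zero kill in the reference square.** For every hull subdomain `D'` of
`bigSq` and EVERY endpoint approximation, eventually `P_δ(range γ_δ ⊆ closure D') > 0`
(unconditionally: no SAW estimate involved). [folklore] -/
theorem eventually_pos_bigSq {D' : DobrushinDomain} {a b : ℝ → Site 2}
    (hab : SAW.IsEndpointApprox bigSq a b) (hsub : D'.carrier ⊆ bigSq.carrier)
    (h0 : D'.pt 0 = bigSq.pt 0) (h1 : D'.pt 1 = bigSq.pt 1)
    (hball : ∃ ε : ℝ, 0 < ε ∧
      D'.carrier ∩ ball (bigSq.pt 0) ε = bigSq.carrier ∩ ball (bigSq.pt 0) ε ∧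
      D'.carrier ∩ ball (bigSq.pt 1) ε = bigSq.carrier ∩ ball (bigSq.pt 1) ε) :
    ∀ᶠ δ in 𝓝[>] (0 : ℝ), 0 < ((SAW.law bigSq.carrier δ (a δ) (b δ)).map (fun γ ↦ γ.curve))
      (CurveClass.rangeSubset (closure D'.carrier)) :=
  eventually_map_law_rangeSubset_pos hab (isEndpointApprox_of_hull_bigSq hab h0 h1 hball) hsub

end Transfer

/-! ### The unit disc has axis caps -/

section Disc

open DobrushinDomain (unitDisc)

/-- The marked points `1, -1` of the tree's `DobrushinDomain.unitDisc` are real. [folklore] -/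
theorem unitDisc_pt_im (i : Fin 2) : (unitDisc.pt i).im = 0 := by
  have h0 : unitDisc.pt 0 = 1 := by
    change circleMap 0 1 (2 * Real.pi * 0) = 1
    simp [circleMap]
  have h1 : unitDisc.pt 1 = -1 := by
    change circleMap 0 1 (2 * Real.pi * (1 / 2 : ℝ)) = -1
    rw [show 2 * Real.pi * (1 / 2 : ℝ) = Real.pi by ring]
    simp [circleMap, Complex.exp_pi_mul_I]
  fin_cases i
  · simp [h0]
  · simp [h1]

/-- The open unit disc is stable under vertical shrinking towards the axis. [folklore] -/
theorem ball_zero_vertStable : ∀ z ∈ Metric.ball (0 : ℂ) 1, ∀ w : ℂ, w.re = z.re →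
    |w.im| ≤ |z.im| → w ∈ Metric.ball (0 : ℂ) 1 := by
  intro z hz w hre him
  have h := vertStable_inter_ball (W := univ) (p := (0 : ℂ)) (by simp) 1
    (fun _ _ _ _ _ ↦ mem_univ _) z ⟨mem_univ _, hz⟩ w hre him
  exact h.2

/-- The open unit disc meets the axis in an interval. [folklore] -/
theorem ball_zero_axisInterval : ∀ z₁ ∈ Metric.ball (0 : ℂ) 1, ∀ z₂ ∈ Metric.ball (0 : ℂ) 1,
    z₁.im = 0 → z₂.im = 0 → ∀ w : ℂ, w.im = 0 → z₁.re ≤ w.re → w.re ≤ z₂.re →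
    w ∈ Metric.ball (0 : ℂ) 1 := by
  intro z₁ hz₁ z₂ hz₂ h₁ h₂ w hw hle₁ hle₂
  have h := axisInterval_inter_ball (W := univ) (p := (0 : ℂ)) (by simp) 1
    (fun _ _ _ _ _ _ _ _ _ _ ↦ mem_univ _) z₁ ⟨mem_univ _, hz₁⟩ z₂ ⟨mem_univ _, hz₂⟩ h₁ h₂ w hw
    hle₁ hle₂
  exact h.2

/-- **Endpoint transfer in the unit disc**: every endpoint approximation of the tree's
`DobrushinDomain.unitDisc = (𝔻; 1, -1)` is one of each Dobrushin `D'` with the same marked points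
agreeing with the disc in balls around `±1`. [folklore] -/
theorem isEndpointApprox_of_hull_unitDisc {D' : DobrushinDomain} {a b : ℝ → Site 2}
    (hab : SAW.IsEndpointApprox unitDisc a b)
    (h0 : D'.pt 0 = unitDisc.pt 0) (h1 : D'.pt 1 = unitDisc.pt 1)
    (hball : ∃ ε : ℝ, 0 < ε ∧
      D'.carrier ∩ ball (unitDisc.pt 0) ε = unitDisc.carrier ∩ ball (unitDisc.pt 0) ε ∧
      D'.carrier ∩ ball (unitDisc.pt 1) ε = unitDisc.carrier ∩ ball (unitDisc.pt 1) ε) :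
    SAW.IsEndpointApprox D' a b := by
  have hcar : unitDisc.carrier = Metric.ball (0 : ℂ) 1 := rfl
  have hpt0 : unitDisc.pt 0 = 1 := by
    change circleMap 0 1 (2 * Real.pi * 0) = 1
    simp [circleMap]
  have hpt1 : unitDisc.pt 1 = -1 := by
    change circleMap 0 1 (2 * Real.pi * (1 / 2 : ℝ)) = -1
    rw [show 2 * Real.pi * (1 / 2 : ℝ) = Real.pi by ring]
    simp [circleMap, Complex.exp_pi_mul_I]
  refine isEndpointApprox_of_hull_of_axisCaps hab h0 h1 hball unitDisc_pt_im ⟨1, one_pos, ?_⟩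
    ⟨1, one_pos, ?_⟩ ?_
  · intro i
    rw [hcar]
    exact vertStable_inter_ball (unitDisc_pt_im i) 1 ball_zero_vertStable
  · intro i
    rw [hcar]
    exact axisInterval_inter_ball (unitDisc_pt_im i) 1 ball_zero_axisInterval
  · intro i ε hε
    set t : ℝ := min ε 1 / 2 with ht
    have ht0 : 0 < t := by positivity
    have ht1 : t ≤ 1 / 2 := by
      have := min_le_right ε 1; rw [ht]; linarith
    have htε : t < ε := by
      have := min_le_left ε 1; rw [ht]; linarith
    fin_cases i
    · refine ⟨1 - t, ?_, ?_⟩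
      · rw [hcar, Metric.mem_ball, dist_zero_right, Complex.norm_real, Real.norm_eq_abs,
          abs_of_pos (by linarith)]
        linarith
      · show dist ((1 - t : ℝ) : ℂ) (unitDisc.pt 0) < ε
        rw [hpt0, Complex.dist_eq]
        have : ((1 - t : ℝ) : ℂ) - 1 = ((-t : ℝ) : ℂ) := by push_cast; ring
        rw [this, Complex.norm_real, Real.norm_eq_abs, abs_neg, abs_of_pos ht0]
        exact htε
    · refine ⟨-1 + t, ?_, ?_⟩
      · rw [hcar, Metric.mem_ball, dist_zero_right, Complex.norm_real, Real.norm_eq_abs,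
          abs_of_neg (by linarith)]
        linarith
      · show dist ((-1 + t : ℝ) : ℂ) (unitDisc.pt 1) < ε
        rw [hpt1, Complex.dist_eq]
        have : ((-1 + t : ℝ) : ℂ) - (-1) = ((t : ℝ) : ℂ) := by push_cast; ring
        rw [this, Complex.norm_real, Real.norm_eq_abs, abs_of_pos ht0]
        exact htε

end Disc

/-! ### The general endpoint transfer (open lattice topology) and the window under the crux -/

/-- **ENDPOINT TRANSFER** (general form; PROVED for the reference square in
`isEndpointApprox_of_hull_bigSq`, open for general Jordan `D`): every endpoint approximation of
`(D; a, b)` is one of each hull subdomain `D'` (inline hypotheses of the crux). This is the lattice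
topology hidden in the route's "largest-component bookkeeping" (corner-germ `stub_cornerIdentification`,
first clause; the route item `IsingBoundaryRatio` ASSUMES both approximations instead). Paper proof
for Jordan `D` (sketch): by Carathéodory, `a` has prime-end neighbourhoods `W_k ↓ {a}` cut off by
circular crosscuts `Q_k`; for small `δ`, `a_δ ∈ W_{k+1}` and any `Ω_δ`-path from `a_δ` to the bulk
crosses the fixed region `A_k = W_k ∖ cl W_{k+1} ⊆ B(a, ε/2)` from `Q_{k+1}` to `Q_k`; a crossing
lattice corridor of `A_k` that is lattice-separated (inside the ball) from a fixed compact `K ⊆ A_k`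
for infinitely many `δ_n → 0` forces boundary detours of `∂D` of diameter `≥ dist(Q_k, Q_{k+1})`
accumulating on a limit arc — a convergence continuum, excluded by local connectivity of the Jordan
curve `∂D`. A domain violating it would refute the crux through `not_avoidanceLimit_of_frequently_zero`
only if, in addition, `D ∖ cl D'` re-joined those corridors to `b` (see the cycle-3 log in the crux's
`Disproof.lean`). [folklore] -/
def EndpointTransfer : Prop :=
  ∀ (D D' : DobrushinDomain) (a b : ℝ → Site 2), SAW.IsEndpointApprox D a b →
    D'.carrier ⊆ D.carrier → D'.pt 0 = D.pt 0 → D'.pt 1 = D.pt 1 →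
    (∃ ε : ℝ, 0 < ε ∧ D'.carrier ∩ ball (D.pt 0) ε = D.carrier ∩ ball (D.pt 0) ε ∧
      D'.carrier ∩ ball (D.pt 1) ε = D.carrier ∩ ball (D.pt 1) ε) →
    SAW.IsEndpointApprox D' a b

/-- The reference-square instance of the endpoint transfer holds (even without `D' ⊆ bigSq`).
[folklore] -/
theorem endpointTransfer_bigSq (D' : DobrushinDomain) (a b : ℝ → Site 2)
    (hab : SAW.IsEndpointApprox bigSq a b) (h0 : D'.pt 0 = bigSq.pt 0) (h1 : D'.pt 1 = bigSq.pt 1)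
    (hball : ∃ ε : ℝ, 0 < ε ∧
      D'.carrier ∩ ball (bigSq.pt 0) ε = bigSq.carrier ∩ ball (bigSq.pt 0) ε ∧
      D'.carrier ∩ ball (bigSq.pt 1) ε = bigSq.carrier ∩ ball (bigSq.pt 1) ε) :
    SAW.IsEndpointApprox D' a b :=
  isEndpointApprox_of_hull_bigSq hab h0 h1 hball

/-- **Under the endpoint transfer no probability-zero kill exists anywhere**: eventually
`P_δ(range γ_δ ⊆ closure D') > 0` along every datum of the crux. [folklore] -/
theorem eventually_pos_of_endpointTransfer (hT : EndpointTransfer) {D D' : DobrushinDomain}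
    {a b : ℝ → Site 2} (hab : SAW.IsEndpointApprox D a b) (hsub : D'.carrier ⊆ D.carrier)
    (h0 : D'.pt 0 = D.pt 0) (h1 : D'.pt 1 = D.pt 1)
    (hball : ∃ ε : ℝ, 0 < ε ∧ D'.carrier ∩ ball (D.pt 0) ε = D.carrier ∩ ball (D.pt 0) ε ∧
      D'.carrier ∩ ball (D.pt 1) ε = D.carrier ∩ ball (D.pt 1) ε) :
    ∀ᶠ δ in 𝓝[>] (0 : ℝ), 0 < ((SAW.law D.carrier δ (a δ) (b δ)).map (fun γ ↦ γ.curve))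
      (CurveClass.rangeSubset (closure D'.carrier)) :=
  eventually_map_law_rangeSubset_pos hab (hT D D' a b hab hsub h0 h1 hball) hsub

/-- **The window under the crux** (generalises cycle 2's `avoidanceLimit_strip_window` to every
hull subdomain `D' ≠ D`): for some `c > 0` and all small `δ`, `c ≤ P_δ(range ⊆ closure D') ≤ 1 - c`.
Any refutation must violate one of the two bounds frequently; any proof must establish both (an
`O(1)` confinement cost and a uniformly positive escape probability at `x_c`). [folklore] -/
theorem avoidanceLimit_window (h : AvoidanceLimit) {D D' : DobrushinDomain}
    {a b : ℝ → Site 2} (hab : SAW.IsEndpointApprox D a b) (hsub : D'.carrier ⊆ D.carrier)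
    (h0 : D'.pt 0 = D.pt 0) (h1 : D'.pt 1 = D.pt 1)
    (hball : ∃ ε : ℝ, 0 < ε ∧ D'.carrier ∩ ball (D.pt 0) ε = D.carrier ∩ ball (D.pt 0) ε ∧
      D'.carrier ∩ ball (D.pt 1) ε = D.carrier ∩ ball (D.pt 1) ε)
    (hne : (D.carrier \ D'.carrier).Nonempty) :
    ∃ c : ℝ, 0 < c ∧ ∀ᶠ δ in 𝓝[>] (0 : ℝ),
      ENNReal.ofReal c ≤ ((SAW.law D.carrier δ (a δ) (b δ)).map (fun γ ↦ γ.curve))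
        (CurveClass.rangeSubset (closure D'.carrier)) ∧
      ((SAW.law D.carrier δ (a δ) (b δ)).map (fun γ ↦ γ.curve))
        (CurveClass.rangeSubset (closure D'.carrier)) ≤ ENNReal.ofReal (1 - c) := by
  obtain ⟨φ, hφ⟩ := MarkedDomain.exists_isChordalUniformizing_holds D
  have hstar : IsStarHull (φ.pullbackHull D') :=
    IsStarHull.pullbackHull JordanDomain.isSimplyConnected_holds hφ
      (isHullSubdomain_of_ball hsub h0 h1 hball)
  obtain ⟨Φ, hΦ, -⟩ := IsStarHull.existsUnique_isRestrictionMap_holds hstar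
  obtain ⟨d, hd0, -, hd⟩ := IsStarHull.exists_hasRestrictionDeriv_holds hstar hΦ
  obtain ⟨w, hw, hw'⟩ := hne
  have hd1 : d < 1 := restrictionDeriv_lt_one hstar hΦ hd (pullbackHull_inter_nonempty φ hw hw')
  have hT := h D D' a b hab hsub h0 h1 hball φ hφ _ rfl Φ d hΦ hd
  set L : ℝ := d ^ ((5 : ℝ) / 8) with hL
  have hL0 : 0 < L := Real.rpow_pos_of_pos hd0 _
  have hL1 : L < 1 := Real.rpow_lt_one hd0.le hd1 (by norm_num)
  set c : ℝ := min (L / 2) ((1 - L) / 2) with hc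
  have hc0 : 0 < c := lt_min (by linarith) (by linarith)
  have hcL : c < L := lt_of_le_of_lt (min_le_left _ _) (by linarith)
  have hLc : L < 1 - c := by
    have : c ≤ (1 - L) / 2 := min_le_right _ _
    linarith
  refine ⟨c, hc0, ?_⟩
  have hlo := (tendsto_order.1 hT).1 _ ((ENNReal.ofReal_lt_ofReal_iff hL0).2 hcL)
  have hhi := (tendsto_order.1 hT).2 _ ((ENNReal.ofReal_lt_ofReal_iff (by linarith)).2 hLc)
  filter_upwards [hlo, hhi] with δ hδ1 hδ2
  exact ⟨hδ1.le, hδ2.le⟩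


end Summit.CriticalPhenomena.SAWScalingLimit.Cruxes.AvoidanceLimit.Disproof

end
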